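import Summits.HodgeConjecture.HodgeConjecture.Cruxes.BlochSeedDiscOne.RingFourEmpty
import Summits.HodgeConjecture.HodgeConjecture.Cruxes.BlochSeedDiscOne.HeightTower
import Summits.HodgeConjecture.HodgeConjecture.Cruxes.BlochSeedDiscOne.LeggedFloor
import Summits.HodgeConjecture.HodgeConjecture.Cruxes.BlochSeedDiscOne.RuleDPlate

/-!
v6 (dual g15, 2026-08-31): + §14 `ClassLaw` — the CLASS LAW `8·W_p = Re(i^{|p|}μ)`, the CUBE LAW `2·CS_k = 2E − Re(i^{Σk}μ)`, the LATTICE LAW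
`48 ∣ m_P(H,u,u,D)`, `96 ∣ 3·Re μ + m_P(H,u,u,D)`, and the DOOR LAW (`m_P(H,u,u,D) = m_P(H,H,D,D) = 0`, `32 ∣ Re μ, Im μ`, `m_N(u⁴) = m_P(u⁴) + 2·m_P(A) ≥ 16`)
under `copies + rank ≤ 116`.  v7 (dual g15, same day): + §15 THE CUBE COVERING — **the ring-2 door is SHUT in the kernel**:
`ClassLaw.ring2_door_shut : OnAlphabet h → Ring2 → Disj → RuleD → (A1) → μ ≠ 0 → HallPlusUp 8 → 116 < copies + rank` (so `Σ_N m ≥ 59`,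
`ClassLaw.nmass_ge_59`), and the ring-2 case of the door of record `ClassLaw.sPlus_ring2` (any `σ ≥ 28·copies`, budget `σ + 28(r−4) ≤ 3136` ⇒ ⊥).
Memo: `DUAL-CERT-FAMILY-g15.md`.  Sections §0–§13 = v5 verbatim.

# RingTwoMassLaw — PARITY-COUPLED LP CERTIFICATES on ring 2 under WEAK arrows (`RuleD ∧ Disj ∧ (A1)`):
# `copies ≥ 29` and `copies + 24·m_N(unit⁴) ≥ 400` (regime «N ∌ unit⁴» costs `≥ 400`); and WITH THE HALL RANK ROW of the statement
# of record (`HallUp ∕ HallPlusUp 8`, §8): `copies + 31·m_N(unit⁴) ≥ 512 ∕ 520`, regime «N ∌ unit⁴» `≥ 520`, and the v4.2 door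
# `copies + rank ≤ 116` forces `Σ_N m ≤ 58`, `8 ≤ Σ_P m ≤ 50`, N-unit⁴ mass `≥ 14`; and (§9, NO `μ ≠ 0` ∕ parity ∕ Hall needed) THREE SPARSE
# E-FREE LAWS of the LAW-F room: B-HOOK EXCLUSION (no supported cell is `(D; u, u, u)`), `m_P(H,u,u,D) = 4·m_P(H,H,D,D)`,
# `6·(m_N(u⁴) − m_P(u⁴)) = 12·m_P(A-hooks) − m_P(H,u,u,D)`; and (§10) THE COMPLETE E-FREE CONTENT of (A1) on the room = FIVE INTEGER
# IDENTITIES I1–I5 in the signed shape masses (a ℤ-basis of the saturated identity lattice) + all their congruences; and (§11–§12, v5)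
# EVERYTHING UNCONDITIONAL: monad-1's charge ideal law (inlined, `CI.charge_ideal_law`) discharges `ParityCoupled`, so `copies ≥ 29`,
# regime «N ∌ unit⁴» `≥ 520`, `Σ_P m ≥ 8`, the ring-2 door digits and (§13) THE DISTANCE DIGIT `copies + rank = 2Σ_N m ≥ 40` (door 116),
# `copies ≥ 31` hold for EVERY (A1)-clean weak-arrow ring-2 design with `μ ≠ 0`, every height
# (plan-lens-HodgeAV-dual g14; lens «dual»; kernel; v5)

Token: line stmt-HodgeConjecture-18881 Cruxes/BlochSeedDiscOne/Lines/birth.lean 814a6a70c14e831a stub_rung_pad4_seedAt.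
LETTER-MODEL BOOKKEEPING ONLY (`DepthBoundA4.Design` on the height-14 alphabet; ring 2 = the thirteen letters of co-level ≤ 2; `RuleD`, `Disj`
are `LeggedFloor`'s, the notions of record).  Letters ≠ sheaves ≠ SEED; nothing here is proved toward HC ∕ HC_CM ∕ HC_AV ∕ №4 ∕ 26512 ∕ 18881 ∕
H2; `Nonex 14 199 8` stays REFUTED as typed (`RotatedPairB136`).  No `axiom` ∕ `instance` ∕ `sorry` ∕ `native_decide` ∕ `unsafe`.

THE TWO INPUTS.
* PARITY COUPLING (`ParityCoupled D`, §3): `Re μ = 16t − 32a`, `Im μ = 16t − 32b` for some integers `t, a, b` — i.e. `Re μ, Im μ ∈ 16ℤ` AND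
  `Re μ ≡ Im μ (mod 32)`.  This is conjuncts 4, 9, 10 of the KERNEL theorem `ChargeLatticeLaw.ChargeLattice 14` (strengthen g13,
  `chargeLattice_fourteen`: `8 ∣ q₄`, `32 ∣ 2q₄ − Re μ`, `32 ∣ 2q₄ − Im μ` for every (A1)-clean design); it is carried here AS A NAMED HYPOTHESIS
  only because `ChargeLatticeLaw` is not yet importable on the farm (unbuilt at the time of writing); **v5: DISCHARGED in §12 by monad-1's charge
  ideal law `16 ∣ Re μ ∧ 16 ∣ Im μ ∧ 32 ∣ Re μ + Im μ` (§11, inlined for the same reason) — `parityCoupled_of_A1`, suffix-`U` theorems** — the ChargeLattice bridge is two lines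
  (`parityCoupled_of_dvd D (D.Tz wPP) h.2.2.2.1 h.2.2.2.2.2.2.2.2.1 h.2.2.2.2.2.2.2.2.2` with `h := chargeLattice_fourteen D hD h1`; filed as
  `ParityCoupledCL.lean` next to this module as soon as `ChargeLatticeLaw` builds), after which every theorem below holds for ALL (A1)-clean
  designs, and at every height (§7: the shift to height 14 preserves `μ` and (A1)).
  Consequence (`exists_dir`): if `μ ≠ 0`, ONE OF THE EIGHT DIRECTIONS `s = σ·Re + τ·Im`, `(σ, τ) ∈ {0, ±1}² ∖ 0`, has `s(μ) ≥ 32` (both `Re μ/16`,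
  `Im μ/16` odd: a diagonal direction, `|Re| + |Im| ≥ 32`; both even and `μ ≠ 0`: an axis direction).  The book's normalisation «WLOG
  `Re μ = |μ|_∞ = 16`» sits in the odd class, where `|Im μ| = 16` as well: Im μ is never 0 at `|μ|_∞ = 16`, and every plain LP floor of the
  ring-2 book DOUBLES.
* LAW F (§A, verbatim from `RingTwoEffEmpty` §0–§5 (strengthen g16), restated over `LeggedFloor.RuleD ∕ Disj` because `RingTwoEffEmpty` is not
  importable on the farm either; the statements are literally the same): in the classes `H X A D` (hub ∕ level 13 ∕ axis floor ∕ diagonal floor)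
  supported N-cells satisfy `NAnat` (`#floor ≤ 1`, `#floor = 1 → #H ≥ 2`) and supported P-cells the WEAK P-anatomy `PAnatW` (`#floor ≤ 2`,
  `#floor = 2 → #H = 2`) — LAW F2 only: NO Hall-out ∕ EffOut diagonal, NO cover rows, NO HallUp (the «weak arrows» column of the ring ledger).

THE CERTIFICATES (§4; this seat's exact type-level LP `work/regime_lp.py ∕ parity_lp.py ∕ certs.py`, stdlib rationals).  A direction is bounded
on a cell by `|s(∏ β̄_f)| ≤ R'(k) := ⌊√(2·∏|β_f|²)⌋`, a CLASS-TUPLE quantity (`bv H X A D = 0 1 4 2`).  A certificate is `(Γ; P, Q, Q_X)`: `Γ` =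
six integer multipliers of `RingFourEmpty`'s e-free (A1) rows `ρ₂ … ρ₇` (`G = Gcell Γ`, killed by (A1): `G_vanishes`), and the finite checks
  N: `G(k) + P·R'(k) ≤ Q` on every `NAnat` class tuple `k ≠ X⁴`, `≤ Q_X` on `X⁴`;     P: `−G(k) + P·R'(k) ≤ Q` on every `PAnatW` tuple
(`decide` over `4⁴ + 4⁴` tuples; the `⌊√·⌋` table is certified tuple-wise by `2∏bv < (R'+1)²`).  Summing with multiplicities (`cert_bound`):
`P·s(μ) ≤ Q·copies + (Q_X − Q)·m_N(unit⁴)`, `m_N(unit⁴) := Σ {m_N(y) : all four letters of y have co-level 1}` (`massU4`).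
* `C0 = ((0, 69812848, −9798922, −5353250, 1096088, −26433); 1671096, 1843968, 1843968)`, `32P = 29Q`: **`copies ≥ 29`** (`copies_ge_29`; LP value
  29/32 per unit of `s`; the cell-level plain LP of plan-lens-HodgeAV-anomaly g15 gives 14.5 = 16·29/32 at `Re μ = 16`).
* `C1 = ((0, 51104256, −7098140, −3640308, 751912, −17543); 2881200, 230496, 5762400)`, `32P = 400Q`, `Q_X − Q = 24Q`:
  **`copies + 24·m_N(unit⁴) ≥ 400`** (`massLaw`; LP value 25/2; 24 = the exact saturation threshold θ* of the parametric LP).  Hence the regime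
  «no supported N-cell is unit⁴» costs **`copies ≥ 400`** (`regime_noNunit4`; the book's floor was 200 at Re μ = 16, ×3-machine 202); under
  `copies ≤ 199`: `m_N(unit⁴) ≥ 9`; under `copies ≤ 108` (what the v4.2 cycle door leaves, `SigmaH.copies_le_108_of_budget`): **`m_N(unit⁴) ≥ 13`**
  (`massU4_ge_13`; the book's LP(m) digit was m ≥ 4); some N-unit⁴ cell is supported whenever `copies ≤ 399`.
* §7: the same at every height `h` (shift `a ↦ a + (14 − h)`, `HeightTower`).
* §8 (v2) THE HALL RANK ROW.  The door-1 rows of the statement of record (`RuleDPlate.SPlusB`: `HallUp D`, `HallPlusUp D 8`) enter the type LP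
  through their top instances `S = P, T = N`: `rank ≥ 0`, resp. `rank ≥ 8` once `Σ_P m > 0` — and `Σ_P m ≥ 8` is itself an LP law of the
  charged room (`Cpos = ((0, 389648, −55762, −30282, 6328, −155); P = 1176, ρ = 0, Q_N = Q_X = 0, Q_P = 4704)`, `pmass_ge_8`).  Pricing the rank
  row with a weight `ρ` (`CertR`, `certR_bound`: `P·s(μ) + ρ·rank ≤ Q_N·Σ_N m + (Q_X − Q_N)·m_N(unit⁴) + Q_P·Σ_P m`):
  `C2 = ((0, 93296, −12838, −6566, 1344, −31); P = 6272, ρ = 392, Q_N = Q_P = 392, Q_X = 12544)` (= 392 × the exact LP dual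
  `(0, 238, −131/4, −67/4, 24/7, −31/392; 16, 1)`, saturation threshold θ* = 31): **`copies + 31·m_N(unit⁴) ≥ 512` (`HallUp`, `massLawHall`) ∕
  `≥ 520` (`HallPlusUp 8`, `massLawHall8`)**; regime «N ∌ unit⁴» ⇒ **`copies ≥ 512 ∕ 520`** (`regime_noNunit4_hall ∕ _hall8`); THE RING-2 DOOR
  DIGIT (`ring2_door`): under the v4.2 budget in its kernel form `copies + rank ≤ 116` (`SigmaH.copies_add_rank_le_of_budget`) and PortHall₈:
  `rank ≥ 8`, `copies ≤ 108`, `Σ_N m ≤ 58`, `8 ≤ Σ_P m ≤ 50` and **`m_N(unit⁴) ≥ 14`** (`31·13 = 403 < 404 = 520 − 116`; from `copies ≤ 116`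
  with `HallUp` only: `≥ 13`).  LP-TIGHTNESS: the full type-level transport relaxation of `HallUp` (flow between class tuples along weak-live
  arrows, `work/hall_lp.py`) gives regime value 512 ∕ 520 and door value 404/31 as well — the aggregated Hall rows beyond the rank row are
  inactive at the door, so only the rank row is kernelised.  Every height (`massLawHall8_allHeights`, `massU4_ge_14_allHeights`, …).
* §9 (v3) THREE SPARSE E-FREE LAWS (hypotheses `OnAlphabet ∧ Ring2 ∧ Disj ∧ RuleD ∧ (A1)` only).  The six e-free rows restricted to the 16
  class types of the LAW-F room have rank 5; the sparsest vectors of their row space (`work/sparse_ids.py`) give, by `decide` over the class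
  tuples + `G_vanishes`: `Γ_B = (−2744, 588, −28, −14, 1, 0)` has `G ≡ 0` on the room except `G(D; u, u, u) = −6`  ⇒  **B-HOOK EXCLUSION
  `no_bhook_P ∕ no_bhook_N ∕ no_bhook_allHeights`: no supported cell of such a design is a B-hook `(D; u, u, u)`** (`D` = diagonal floor
  `(12; ±1, ±1)`, the anomaly cell's `B`; its B-packet residual corner is therefore empty, and the P-room loses its 1 024 B-hook cells);
  `Γ₂ = (−2548, 560, −28, −13, 1, 0)`  ⇒  **`m_P(H,u,u,D) = 4·m_P(H,H,D,D)`** (`huuD_law`);  `Γ₃ = (−8036, 1736, −83, −42, 3, 0)`  ⇒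
  **`6·(m_N(u⁴) − m_P(u⁴)) = 12·m_P(A-hooks) − m_P(H,u,u,D)`** (`unit4_balance`), i.e. `3·(m_N(u⁴) − m_P(u⁴)) = 6·m_P(A-hooks) − 2·m_P(H,H,D,D)`;
  hence `3 ∣ m_P(H,H,D,D)`, `12 ∣ m_P(H,u,u,D)`, `m_N(u⁴) ≡ m_P(u⁴) (mod 2)` (`divisibility`).  Every height (`massLaws_allHeights`).
* §10 (v4) THE COMPLETE E-FREE CONTENT OF (A1) ON THE ROOM.  With the signed shape masses `s(h,u,a,d) := m_N − m_P` over the cells with `h` hubs,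
  `u` units, `a` axis floors, `d` diagonal floors (`sMass`), the saturated integer identity lattice `Λ⊥ = rowspace(e-free rows) ∩ ℤ¹⁶` (rank 5,
  `work/congr2.py`) has the ℤ-basis (`efree_basis ∕ efree_identities`, multipliers `ΓI1 … ΓI5` checked by `decide`):
  I1 `−2·s(HHuD) − 4·s(HHAD) + 3·s(Huuu) + 6·s(HuuA) + 12·s(u⁴) + 21·s(uuuA) = 0`;  I2 `s(HuuD) − 6·s(u⁴) − 12·s(uuuA) = 0`;
  I3 `−3·s(HHHD) + s(HHuu) + 2·s(HHuA) − s(HHuD) + 4·s(HHAA) + s(HHAD) + 3·s(Huuu) + 5·s(HuuA) + 15·s(u⁴) + 27·s(uuuA) = 0`;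
  I4 `−2·s(HHDD) + 3·s(u⁴) + 6·s(uuuA) = 0`;  I5 `s(uuuD) = 0` — every exact or congruence law of the room's type masses implied by the e-free
  rows is an integer combination of these (P-only shapes: `s = −m_P`).  Readable congruences (`efree_congruences`): mod 2 `s(Huuu) ≡ m_P(A-hooks)`,
  `s(HHHD) + s(HHuu) + s(HHuD) + m_P(HHAD) + m_P(HuuA) ≡ 0`, `m_N(u⁴) ≡ m_P(u⁴)`; `4 ∣ m_P(HuuD)`; mod 3 `3 ∣ m_P(HHDD)`, `s(HHuD) ≡ 2·m_P(HHAD)`,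
  `s(HHuu) + 2·s(HHuA) ≡ m_P(HHAA) + 2·m_P(HuuA)`.  Every height (`efree_basis_allHeights`, `efree_congruences_allHeights`).
-/

set_option linter.dupNamespace false
set_option autoImplicit false
set_option maxRecDepth 8192
set_option maxHeartbeats 4000000

namespace Summit.HodgeConjecture.HodgeConjecture.Cruxes.BlochSeedDiscOne.RingTwoMassLaw

open Summit.HodgeConjecture.HodgeConjecture.Cruxes.BlochSeedDiscOne.DepthBoundA4
open Summit.HodgeConjecture.HodgeConjecture.Cruxes.BlochSeedDiscOne.RingFourEmpty
  (Coefs Gpoly Gcell G_vanishes linZ_mono linZ_smul linZ_add norm_cellCoef_eeee re_linG im_linG)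
open Summit.HodgeConjecture.HodgeConjecture.Cruxes.BlochSeedDiscOne.HeightTower
open Summit.HodgeConjecture.HodgeConjecture.Cruxes.BlochSeedDiscOne.LeggedFloor (NullStep Supplies Detects RuleDP RuleD Disj)
open Summit.HodgeConjecture.HodgeConjecture.Cruxes.BlochSeedDiscOne.HallB136 (HallUp sumP_le_sumN_of_hallUp)
open Summit.HodgeConjecture.HodgeConjecture.Cruxes.BlochSeedDiscOne.RuleDPlate (HallPlusUp hallUp_of_hallPlusUp eight_le_rank_of_hallPlusUp hallUp_shiftD hallPlusUp_shiftD)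

/-! ## §A  LAW F on ring 2 (verbatim from `RingTwoEffEmpty` §0–§5, over `LeggedFloor.RuleD ∕ Disj`) -/

theorem mem_supp_of_memP (D : Design) {x : Cell} (hx : x ∈ D.suppP) : x ∈ D.suppN ++ D.suppP :=
  List.mem_append_right _ hx

theorem mem_supp_of_memN (D : Design) {y : Cell} (hy : y ∈ D.suppN) : y ∈ D.suppN ++ D.suppP :=
  List.mem_append_left _ hy

/-- The letters of the height-14 alphabet of co-level `≤ 2`. -/
def R2 : List Letter :=
  [⟨14, 0, 0⟩, ⟨13, 1, 0⟩, ⟨13, -1, 0⟩, ⟨13, 0, 1⟩, ⟨13, 0, -1⟩,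
   ⟨12, 2, 0⟩, ⟨12, -2, 0⟩, ⟨12, 0, 2⟩, ⟨12, 0, -2⟩, ⟨12, 1, 1⟩, ⟨12, 1, -1⟩, ⟨12, -1, 1⟩, ⟨12, -1, -1⟩]

theorem mem_R2 {ℓ : Letter} (hℓ : ℓ.OnAlphabet 14) (hc : ℓ.colevel ≤ 2) : ℓ ∈ R2 := by
  obtain ⟨a, x, y⟩ := ℓ
  have h1 := hℓ.1
  simp only [Letter.height, Letter.colevel] at h1 hc
  have hx := abs_nonneg x
  have hy := abs_nonneg y
  have hxb : -2 ≤ x ∧ x ≤ 2 := abs_le.mp (by linarith)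
  have hyb : -2 ≤ y ∧ y ≤ 2 := abs_le.mp (by linarith)
  obtain rfl : a = 14 - |x| - |y| := by linarith
  obtain ⟨hx1, hx2⟩ := hxb
  obtain ⟨hy1, hy2⟩ := hyb
  interval_cases x <;> interval_cases y <;> first | decide | (norm_num at hc)

/-- RING 2: every letter of every supported cell has co-level `≤ 2` (same text as `RingTwoEffEmpty.Ring2`). -/
def Ring2 (D : Design) : Prop := ∀ c ∈ D.suppN ++ D.suppP, ∀ f : Fin 4, (c f).colevel ≤ 2

theorem memR2_of_supp {D : Design} (hD : D.OnAlphabet 14) (hR : Ring2 D) {c : Cell} (hc : c ∈ D.suppN ++ D.suppP)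
    (f : Fin 4) : c f ∈ R2 :=
  mem_R2 (hD c hc f) (hR c hc f)

theorem R2_levels : ∀ ℓ ∈ R2, 12 ≤ ℓ.a ∧ ℓ.a ≤ 14 ∧ (ℓ.a = 14 ↔ ℓ.x = 0 ∧ ℓ.y = 0) := by decide

theorem level_ge_12 {ℓ : Letter} (h : ℓ ∈ R2) : 12 ≤ ℓ.a := (R2_levels ℓ h).1

theorem level_eq_14_iff {ℓ : Letter} (h : ℓ ∈ R2) : ℓ.a = 14 ↔ ℓ.x = 0 ∧ ℓ.y = 0 := (R2_levels ℓ h).2.2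

theorem not_null_to_floor {ℓ ℓ' : Letter} (h : ℓ ∈ R2) (hn : NullStep ℓ ℓ') (h12 : ℓ'.a = 12) : False := by
  have := hn.1
  have := level_ge_12 h
  omega

theorem null_to_13 {ℓ ℓ' : Letter} (h : ℓ ∈ R2) (hn : NullStep ℓ ℓ') (h13 : ℓ'.a = 13) : ℓ.a = 12 := by
  have := hn.1
  have := level_ge_12 h
  omega

theorem detects_of_ne_14 {c : Cell} {g : Fin 4} (hg : c g ∈ R2) (hne : (c g).a ≠ 14) (j : Fin 4) : Detects c g j := by
  intro h
  exact hne ((level_eq_14_iff hg).mpr ⟨h.1, h.2.1⟩)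

theorem levels_of_not_detects {c : Cell} {g j : Fin 4} (hg : c g ∈ R2) (hj : c j ∈ R2) (h : ¬ Detects c g j) :
    (c g).a = 14 ∧ (c j).a = 14 := by
  have h' := not_not.mp h
  exact ⟨(level_eq_14_iff hg).mpr ⟨h'.1, h'.2.1⟩, (level_eq_14_iff hj).mpr ⟨h'.2.2.1, h'.2.2.2.1⟩⟩

theorem supplies_symm {x y : Cell} {g j : Fin 4} (h : Supplies x y g j) : Supplies x y j g :=
  ⟨fun f hfj hfg => h.1 f hfg hfj, h.2.2, h.2.1⟩

theorem detects_symm {c : Cell} {g j : Fin 4} (h : Detects c g j) : Detects c j g := by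
  intro hc
  exact h ⟨hc.2.2.1, hc.2.2.2.1, hc.1, hc.2.1, hc.2.2.2.2.symm⟩

theorem supplier_of_N {D : Design} (hrule : RuleD D) {y : Cell} (hy : y ∈ D.suppN) {g j : Fin 4} (hgj : g ≠ j)
    (hdet : Detects y g j) : ∃ x ∈ D.suppP, Supplies x y g j := by
  rcases lt_or_gt_of_ne hgj with h | h
  · exact hrule.1 y hy g j h hdet
  · obtain ⟨x, hx, hs⟩ := hrule.1 y hy j g h (detects_symm hdet)
    exact ⟨x, hx, supplies_symm hs⟩

theorem witness_of_P {D : Design} (hrule : RuleD D) {x : Cell} (hx : x ∈ D.suppP) {g j : Fin 4} (hgj : g ≠ j)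
    (hdet : Detects x g j) : ∃ y ∈ D.suppN, Supplies x y g j := by
  rcases lt_or_gt_of_ne hgj with h | h
  · exact hrule.2 x hx g j h hdet
  · obtain ⟨y, hy, hs⟩ := hrule.2 x hx j g h (detects_symm hdet)
    exact ⟨y, hy, supplies_symm hs⟩

theorem cell_eq_of_supplies {x y : Cell} {g j : Fin 4} (hs : Supplies x y g j) (hg : x g = y g) (hj : x j = y j) :
    x = y := by
  funext f
  by_cases hfg : f = g
  · rw [hfg]; exact hg
  by_cases hfj : f = j
  · rw [hfj]; exact hj
  exact hs.1 f hfg hfj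

theorem exists_fourth (a b c : Fin 4) : ∃ v : Fin 4, v ≠ a ∧ v ≠ b ∧ v ≠ c := by
  revert a b c
  decide

/-- **(F1)** no supported N-cell has two floor slots. -/
theorem F1 {D : Design} (hD : D.OnAlphabet 14) (hR : Ring2 D) (hdisj : Disj D) (hrule : RuleD D)
    {y : Cell} (hy : y ∈ D.suppN) {g j : Fin 4} (hgj : g ≠ j) (hg : (y g).a = 12) (hj : (y j).a = 12) : False := by
  have hyS := mem_supp_of_memN D hy
  have hdet : Detects y g j := detects_of_ne_14 (memR2_of_supp hD hR hyS g) (by omega) j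
  obtain ⟨x, hx, hsup⟩ := supplier_of_N hrule hy hgj hdet
  have hxS := mem_supp_of_memP D hx
  have exg : x g = y g := by
    rcases hsup.2.1 with h | h
    · exact h
    · exact (not_null_to_floor (memR2_of_supp hD hR hxS g) h hg).elim
  have exj : x j = y j := by
    rcases hsup.2.2 with h | h
    · exact h
    · exact (not_null_to_floor (memR2_of_supp hD hR hxS j) h hj).elim
  have hxy : x = y := cell_eq_of_supplies hsup exg exj
  exact hdisj y hy (hxy ▸ hx)

/-- **(F2)** a supported P-cell with two floor slots is HUB on every other slot. -/
theorem F2 {D : Design} (hD : D.OnAlphabet 14) (hR : Ring2 D) (hdisj : Disj D) (hrule : RuleD D)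
    {x : Cell} (hx : x ∈ D.suppP) {f1 f2 : Fin 4} (h12 : f1 ≠ f2) (hf1 : (x f1).a = 12) (hf2 : (x f2).a = 12)
    (u : Fin 4) (hu1 : u ≠ f1) (hu2 : u ≠ f2) : (x u).a = 14 := by
  have hxS := mem_supp_of_memP D hx
  obtain ⟨v, hv1, hv2, hvu⟩ := exists_fourth f1 f2 u
  suffices hnd : ¬ Detects x u v from
    (levels_of_not_detects (memR2_of_supp hD hR hxS u) (memR2_of_supp hD hR hxS v) hnd).1
  intro hdet
  obtain ⟨y, hy, hsup⟩ := witness_of_P hrule hx (Ne.symm hvu) hdet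
  have e1 : x f1 = y f1 := hsup.1 f1 (Ne.symm hu1) (Ne.symm hv1)
  have e2 : x f2 = y f2 := hsup.1 f2 (Ne.symm hu2) (Ne.symm hv2)
  exact F1 hD hR hdisj hrule hy h12 (by rw [← e1]; exact hf1) (by rw [← e2]; exact hf2)

/-- **(F3)** a supported N-cell with a floor slot and a level-13 slot is HUB on the other two. -/
theorem F3 {D : Design} (hD : D.OnAlphabet 14) (hR : Ring2 D) (hdisj : Disj D) (hrule : RuleD D)
    {y : Cell} (hy : y ∈ D.suppN) {f s : Fin 4} (hfs : f ≠ s) (hf : (y f).a = 12) (hs : (y s).a = 13)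
    (u : Fin 4) (huf : u ≠ f) (hus : u ≠ s) : (y u).a = 14 := by
  have hyS := mem_supp_of_memN D hy
  have hdet : Detects y f s := detects_of_ne_14 (memR2_of_supp hD hR hyS f) (by omega) s
  obtain ⟨x, hx, hsup⟩ := supplier_of_N hrule hy hfs hdet
  have hxS := mem_supp_of_memP D hx
  have exf : x f = y f := by
    rcases hsup.2.1 with h | h
    · exact h
    · exact (not_null_to_floor (memR2_of_supp hD hR hxS f) h hf).elim
  rcases hsup.2.2 with h | h
  · exact (hdisj y hy ((cell_eq_of_supplies hsup exf h) ▸ hx)).elim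
  · have hxs : (x s).a = 12 := null_to_13 (memR2_of_supp hD hR hxS s) h hs
    have hxf : (x f).a = 12 := by rw [exf]; exact hf
    rw [← hsup.1 u huf hus]
    exact F2 hD hR hdisj hrule hx hfs hxf hxs u huf hus

/-- letter classes on ring 2: hub, level 13, axis floor, diagonal floor. -/
inductive LC where
  | H | X | A | D
  deriving DecidableEq, Repr, Fintype

namespace LC

/-- level `a` -/
def av : LC → ℤ
  | H => 14 | X => 13 | A => 12 | D => 12

/-- `n = a² − |β|²` -/
def nv : LC → ℤ
  | H => 196 | X => 168 | A => 140 | D => 142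

/-- `|β|²` -/
def bv : LC → ℤ
  | H => 0 | X => 1 | A => 4 | D => 2

/-- floor classes -/
def fl : LC → Bool
  | A => true | D => true | _ => false

/-- the hub class -/
def isH : LC → Bool
  | H => true | _ => false

end LC

/-- the class of a letter (meaningful on `R2`). -/
def classOf (ℓ : Letter) : LC :=
  if ℓ.a = 14 then LC.H else if ℓ.a = 13 then LC.X else if ℓ.bnorm = 4 then LC.A else LC.D

/-- class data = letter data on `R2`. -/
theorem R2_class : ∀ ℓ ∈ R2, ℓ.a = (classOf ℓ).av ∧ ℓ.selfInt = (classOf ℓ).nv ∧ ℓ.bnorm = (classOf ℓ).bv ∧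
    ((classOf ℓ).fl = true ↔ ℓ.a = 12) ∧ ((classOf ℓ).isH = true ↔ ℓ.a = 14) ∧ (classOf ℓ = LC.X ↔ ℓ.a = 13) ∧
    (classOf ℓ = LC.X ↔ ℓ.colevel = 1) := by
  decide

theorem bv_eq {ℓ : Letter} (h : ℓ ∈ R2) : ℓ.bnorm = (classOf ℓ).bv := (R2_class ℓ h).2.2.1
theorem fl_iff {ℓ : Letter} (h : ℓ ∈ R2) : (classOf ℓ).fl = true ↔ ℓ.a = 12 := (R2_class ℓ h).2.2.2.1
theorem isH_iff {ℓ : Letter} (h : ℓ ∈ R2) : (classOf ℓ).isH = true ↔ ℓ.a = 14 := (R2_class ℓ h).2.2.2.2.1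
theorem X_iff {ℓ : Letter} (h : ℓ ∈ R2) : classOf ℓ = LC.X ↔ ℓ.a = 13 := (R2_class ℓ h).2.2.2.2.2.1
theorem X_iff_colevel {ℓ : Letter} (h : ℓ ∈ R2) : classOf ℓ = LC.X ↔ ℓ.colevel = 1 := (R2_class ℓ h).2.2.2.2.2.2

/-- `∀` over `LC` as a `Bool`. -/
def allLC (p : LC → Bool) : Bool := p LC.H && p LC.X && p LC.A && p LC.D

theorem allLC_spec (p : LC → Bool) (h : allLC p = true) (k : LC) : p k = true := by
  cases k <;> simp_all [allLC]

/-- number of floor slots -/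
def cntF (k0 k1 k2 k3 : LC) : ℕ := k0.fl.toNat + k1.fl.toNat + k2.fl.toNat + k3.fl.toNat
/-- number of hub slots -/
def cntH (k0 k1 k2 k3 : LC) : ℕ := k0.isH.toNat + k1.isH.toNat + k2.isH.toNat + k3.isH.toNat

/-- N-anatomy in counts: `#floor ≤ 1`, and `#floor = 1 → #H ≥ 2` (same text as `RingTwoEffEmpty.NAnat`). -/
abbrev NAnat (k0 k1 k2 k3 : LC) : Prop := cntF k0 k1 k2 k3 ≤ 1 ∧ (cntF k0 k1 k2 k3 = 1 → 2 ≤ cntH k0 k1 k2 k3)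

/-- WEAK P-anatomy in counts (LAW F2 only, no Hall-out diagonal): `#floor ≤ 2`, `#floor = 2 → #H = 2`. -/
abbrev PAnatW (k0 k1 k2 k3 : LC) : Prop := cntF k0 k1 k2 k3 ≤ 2 ∧ (cntF k0 k1 k2 k3 = 2 → cntH k0 k1 k2 k3 = 2)

/-- (F1) on a class vector -/
def LawF1 (k : Fin 4 → LC) : Prop := ∀ g j : Fin 4, g ≠ j → (k g).fl = true → (k j).fl = true → False

/-- (F3) on a class vector -/
def LawF3 (k : Fin 4 → LC) : Prop :=
  ∀ f s u : Fin 4, f ≠ s → u ≠ f → u ≠ s → (k f).fl = true → k s = LC.X → (k u).isH = true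

/-- (F2) on a class vector -/
def LawF2 (k : Fin 4 → LC) : Prop :=
  ∀ f1 f2 u : Fin 4, f1 ≠ f2 → u ≠ f1 → u ≠ f2 → (k f1).fl = true → (k f2).fl = true → (k u).isH = true

def lawF1B (k : Fin 4 → LC) : Bool :=
  (List.finRange 4).all fun g => (List.finRange 4).all fun j => !(decide (g ≠ j) && (k g).fl && (k j).fl)

def lawF3B (k : Fin 4 → LC) : Bool :=
  (List.finRange 4).all fun f => (List.finRange 4).all fun s => (List.finRange 4).all fun u =>
    !(decide (f ≠ s) && decide (u ≠ f) && decide (u ≠ s) && (k f).fl && decide (k s = LC.X)) || (k u).isH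

def lawF2B (k : Fin 4 → LC) : Bool :=
  (List.finRange 4).all fun f1 => (List.finRange 4).all fun f2 => (List.finRange 4).all fun u =>
    !(decide (f1 ≠ f2) && decide (u ≠ f1) && decide (u ≠ f2) && (k f1).fl && (k f2).fl) || (k u).isH

theorem lawF1B_of {k : Fin 4 → LC} (h : LawF1 k) : lawF1B k = true := by
  unfold lawF1B
  simp only [List.all_eq_true, List.mem_finRange, true_implies]
  intro g j
  have := h g j
  revert this
  cases (k g).fl <;> cases (k j).fl <;> by_cases hgj : g = j <;> simp [hgj]

theorem lawF3B_of {k : Fin 4 → LC} (h : LawF3 k) : lawF3B k = true := by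
  unfold lawF3B
  simp only [List.all_eq_true, List.mem_finRange, true_implies]
  intro f s u
  have := h f s u
  revert this
  cases (k f).fl <;> cases (k u).isH <;> by_cases hfs : f = s <;> by_cases huf : u = f <;> by_cases hus : u = s <;>
    by_cases hX : k s = LC.X <;> simp [hfs, huf, hus, hX]

theorem lawF2B_of {k : Fin 4 → LC} (h : LawF2 k) : lawF2B k = true := by
  unfold lawF2B
  simp only [List.all_eq_true, List.mem_finRange, true_implies]
  intro f1 f2 u
  have := h f1 f2 u
  revert this
  cases (k f1).fl <;> cases (k f2).fl <;> cases (k u).isH <;> by_cases h12 : f1 = f2 <;> by_cases hu1 : u = f1 <;>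
    by_cases hu2 : u = f2 <;> simp [h12, hu1, hu2]

theorem nanat_of_pairwise (k0 k1 k2 k3 : LC) (h1 : lawF1B ![k0, k1, k2, k3] = true) (h3 : lawF3B ![k0, k1, k2, k3] = true) :
    NAnat k0 k1 k2 k3 := by
  revert k0 k1 k2 k3
  decide

theorem panatW_of_pairwise (k0 k1 k2 k3 : LC) (h2 : lawF2B ![k0, k1, k2, k3] = true) : PAnatW k0 k1 k2 k3 := by
  revert k0 k1 k2 k3
  decide

/-- `G` on a class tuple. -/
def GP (γ : Coefs) (k0 k1 k2 k3 : LC) : ℤ := Gpoly γ k0.av k0.nv k1.av k1.nv k2.av k2.nv k3.av k3.nv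

/-- the class tuple of a cell -/
def K (c : Cell) : Fin 4 → LC := fun f => classOf (c f)

theorem K_vec (c : Cell) : (![K c 0, K c 1, K c 2, K c 3] : Fin 4 → LC) = K c := by
  funext f
  fin_cases f <;> rfl

theorem Gcell_eq_GP (γ : Coefs) {c : Cell} (hc : ∀ f : Fin 4, c f ∈ R2) :
    Gcell γ c = GP γ (K c 0) (K c 1) (K c 2) (K c 3) := by
  have e := fun f => (R2_class (c f) (hc f)).1
  have n := fun f => (R2_class (c f) (hc f)).2.1
  show Gpoly γ (c 0).a (c 0).selfInt (c 1).a (c 1).selfInt (c 2).a (c 2).selfInt (c 3).a (c 3).selfInt =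
    Gpoly γ (classOf (c 0)).av (classOf (c 0)).nv (classOf (c 1)).av (classOf (c 1)).nv
      (classOf (c 2)).av (classOf (c 2)).nv (classOf (c 3)).av (classOf (c 3)).nv
  rw [e 0, n 0, e 1, n 1, e 2, n 2, e 3, n 3]

theorem nanat_of_suppN {D : Design} (hD : D.OnAlphabet 14) (hR : Ring2 D) (hdisj : Disj D) (hrule : RuleD D)
    {y : Cell} (hy : y ∈ D.suppN) : NAnat (K y 0) (K y 1) (K y 2) (K y 3) := by
  have hyS := mem_supp_of_memN D hy
  have hm := fun f => memR2_of_supp hD hR hyS f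
  apply nanat_of_pairwise
  · rw [K_vec]
    apply lawF1B_of
    intro g j hgj hg hj
    exact F1 hD hR hdisj hrule hy hgj ((fl_iff (hm g)).mp hg) ((fl_iff (hm j)).mp hj)
  · rw [K_vec]
    apply lawF3B_of
    intro f s u hfs huf hus hf hs
    exact (isH_iff (hm u)).mpr (F3 hD hR hdisj hrule hy hfs ((fl_iff (hm f)).mp hf) ((X_iff (hm s)).mp hs) u huf hus)

theorem panatW_of_suppP {D : Design} (hD : D.OnAlphabet 14) (hR : Ring2 D) (hdisj : Disj D) (hrule : RuleD D)
    {x : Cell} (hx : x ∈ D.suppP) : PAnatW (K x 0) (K x 1) (K x 2) (K x 3) := by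
  have hxS := mem_supp_of_memP D hx
  have hm := fun f => memR2_of_supp hD hR hxS f
  apply panatW_of_pairwise
  rw [K_vec]
  apply lawF2B_of
  intro f1 f2 u h12 hu1 hu2 hf1 hf2
  exact (isH_iff (hm u)).mpr (F2 hD hR hdisj hrule hx h12 ((fl_iff (hm f1)).mp hf1) ((fl_iff (hm f2)).mp hf2) u hu1 hu2)

/-! ## §0 Bookkeeping -/

theorem linZ_lin (L : List (Cell × ℕ)) (a b : ℤ) (φ ψ : Cell → ℤ) :
    linZ L (fun c => a * φ c + b * ψ c) = a * linZ L φ + b * linZ L ψ := by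
  induction L with
  | nil => simp [linZ]
  | cons x t ih => simp only [linZ_cons]; rw [ih]; ring

theorem linZ_map (φ : Cell → Cell) (L : List (Cell × ℕ)) (ψ : Cell → ℤ) :
    linZ (L.map fun cm => (φ cm.1, cm.2)) ψ = linZ L (fun c => ψ (φ c)) := by
  induction L with
  | nil => simp [linZ]
  | cons x t ih => rw [List.map_cons, linZ_cons, linZ_cons, ih]

/-- `|s| ≤ R` from `s² ≤ M < (R+1)²`, `R ≥ 0`. -/
theorem abs_le_of_sq_le {s M R : ℤ} (h : s ^ 2 ≤ M) (hR : M < (R + 1) * (R + 1)) (h0 : 0 ≤ R) : |s| ≤ R := by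
  by_contra hc
  push Not at hc
  have h1 : R + 1 ≤ |s| := Int.lt_iff_add_one_le.mp hc
  have h2 : (R + 1) * (R + 1) ≤ |s| * |s| := mul_le_mul h1 h1 (by linarith) (abs_nonneg s)
  rw [abs_mul_abs_self] at h2
  nlinarith

/-! ## §2 The eight directions and the class-level charge bound `R'` -/

/-- the eight directions `s = σ·Re + τ·Im`. -/
inductive Dir where
  | re | reN | im | imN | pp | pm | mp | mm
  deriving DecidableEq, Repr

namespace Dir

/-- coefficient of `Re` -/
def σ : Dir → ℤ
  | re => 1 | reN => -1 | im => 0 | imN => 0 | pp => 1 | pm => 1 | mp => -1 | mm => -1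

/-- coefficient of `Im` -/
def τ : Dir → ℤ
  | re => 0 | reN => 0 | im => 1 | imN => -1 | pp => 1 | pm => -1 | mp => 1 | mm => -1

/-- `s(z) = σ·Re z + τ·Im z` -/
def ev (d : Dir) (z : GaussianInt) : ℤ := d.σ * z.re + d.τ * z.im

theorem ev_sq_le (d : Dir) (z : GaussianInt) : (d.ev z) ^ 2 ≤ 2 * z.norm := by
  rw [Zsqrtd.norm_def]
  cases d <;> simp only [ev, σ, τ] <;> nlinarith [sq_nonneg (z.re - z.im), sq_nonneg (z.re + z.im), sq_nonneg z.re, sq_nonneg z.im]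

/-- `s(μ) = Σ_N m·s(∏β̄) − Σ_P m·s(∏β̄)`. -/
theorem ev_mu (d : Dir) (D : Design) :
    d.ev D.mu = linZ D.N (fun c => d.ev (cellCoef c Word.eeee)) - linZ D.P (fun c => d.ev (cellCoef c Word.eeee)) := by
  have hre : D.mu.re = linZ D.N (fun c => (cellCoef c Word.eeee).re) - linZ D.P (fun c => (cellCoef c Word.eeee).re) := by
    unfold Design.mu; rw [T_eq_linG, Zsqrtd.re_sub, re_linG, re_linG]
  have him : D.mu.im = linZ D.N (fun c => (cellCoef c Word.eeee).im) - linZ D.P (fun c => (cellCoef c Word.eeee).im) := by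
    unfold Design.mu; rw [T_eq_linG, Zsqrtd.im_sub, im_linG, im_linG]
  unfold ev
  rw [linZ_lin, linZ_lin, hre, him]
  ring

end Dir

/-- `⌊√n⌋` for `0 ≤ n ≤ 528` (table-free; re-certified tuple-wise inside the certificates by `rbOK`). -/
def isqrtB (n : ℤ) : ℤ := (((List.range 23).filter fun r => ((r * r : ℕ) : ℤ) ≤ n).length : ℤ) - 1

/-- the class-level bound `R'(k) = ⌊√(2·∏ bv)⌋` for the eight directions -/
def RB (k0 k1 k2 k3 : LC) : ℤ := isqrtB (2 * (k0.bv * k1.bv * k2.bv * k3.bv))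

/-- its tuple-wise certificate of correctness -/
abbrev rbOK (k0 k1 k2 k3 : LC) : Prop :=
  0 ≤ RB k0 k1 k2 k3 ∧ 2 * (k0.bv * k1.bv * k2.bv * k3.bv) < (RB k0 k1 k2 k3 + 1) * (RB k0 k1 k2 k3 + 1)

theorem abs_ev_le_RB (d : Dir) {c : Cell} (hc : ∀ f : Fin 4, c f ∈ R2) (hok : rbOK (K c 0) (K c 1) (K c 2) (K c 3)) :
    |d.ev (cellCoef c Word.eeee)| ≤ RB (K c 0) (K c 1) (K c 2) (K c 3) := by
  have h1 := d.ev_sq_le (cellCoef c Word.eeee)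
  rw [norm_cellCoef_eeee, bv_eq (hc 0), bv_eq (hc 1), bv_eq (hc 2), bv_eq (hc 3)] at h1
  exact abs_le_of_sq_le h1 hok.2 hok.1

/-! ## §3 The parity-lattice input and a direction with `s(μ) ≥ 32` -/

/-- **PARITY COUPLING** (= conjuncts 4, 9, 10 of `ChargeLatticeLaw.ChargeLattice 14`, kernel there for every (A1)-clean design):
`Re μ = 16t − 32a`, `Im μ = 16t − 32b` — `Re μ, Im μ ∈ 16ℤ` and `Re μ ≡ Im μ (mod 32)`. -/
def ParityCoupled (D : Design) : Prop := ∃ t a b : ℤ, D.mu.re = 16 * t - 32 * a ∧ D.mu.im = 16 * t - 32 * b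

/-- the form in which `ChargeLatticeLaw` states it (`q₄ = Tz wPP`): `8 ∣ q`, `32 ∣ 2q − Re μ`, `32 ∣ 2q − Im μ`. -/
theorem parityCoupled_of_dvd (D : Design) (q : ℤ) (h8 : (8 : ℤ) ∣ q) (hre : (32 : ℤ) ∣ 2 * q - D.mu.re)
    (him : (32 : ℤ) ∣ 2 * q - D.mu.im) : ParityCoupled D := by
  obtain ⟨t, ht⟩ := h8
  obtain ⟨a, ha⟩ := hre
  obtain ⟨b, hb⟩ := him
  exact ⟨t, a, b, by omega, by omega⟩

theorem exists_dir {D : Design} (hpc : ParityCoupled D) (hμ : D.mu ≠ 0) : ∃ d : Dir, 32 ≤ d.ev D.mu := by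
  obtain ⟨t, a, b, ha, hb⟩ := hpc
  have hne : ¬ (D.mu.re = 0 ∧ D.mu.im = 0) := fun h => hμ (Zsqrtd.ext h.1 h.2)
  have key : 32 ≤ D.mu.re ∨ 32 ≤ -D.mu.re ∨ 32 ≤ D.mu.im ∨ 32 ≤ -D.mu.im ∨ 32 ≤ D.mu.re + D.mu.im ∨
      32 ≤ D.mu.re - D.mu.im ∨ 32 ≤ -D.mu.re + D.mu.im ∨ 32 ≤ -D.mu.re - D.mu.im := by omega
  rcases key with h | h | h | h | h | h | h | h
  · exact ⟨.re, by simp only [Dir.ev, Dir.σ, Dir.τ]; linarith⟩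
  · exact ⟨.reN, by simp only [Dir.ev, Dir.σ, Dir.τ]; linarith⟩
  · exact ⟨.im, by simp only [Dir.ev, Dir.σ, Dir.τ]; linarith⟩
  · exact ⟨.imN, by simp only [Dir.ev, Dir.σ, Dir.τ]; linarith⟩
  · exact ⟨.pp, by simp only [Dir.ev, Dir.σ, Dir.τ]; linarith⟩
  · exact ⟨.pm, by simp only [Dir.ev, Dir.σ, Dir.τ]; linarith⟩
  · exact ⟨.mp, by simp only [Dir.ev, Dir.σ, Dir.τ]; linarith⟩
  · exact ⟨.mm, by simp only [Dir.ev, Dir.σ, Dir.τ]; linarith⟩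

/-- conversely the bound 32 is attained in each class: nothing below 32 can be certified from parity alone. -/
theorem parityCoupled_examples :
    (∃ t a b : ℤ, (16 : ℤ) = 16 * t - 32 * a ∧ (16 : ℤ) = 16 * t - 32 * b) ∧
    (∃ t a b : ℤ, (32 : ℤ) = 16 * t - 32 * a ∧ (0 : ℤ) = 16 * t - 32 * b) :=
  ⟨⟨1, 0, 0, by norm_num, by norm_num⟩, ⟨0, -1, 0, by norm_num, by norm_num⟩⟩

/-! ## §4 Certificates and their finite checks -/

/-- a certificate: six e-free row multipliers, the charge weight `P`, the unit row bound `Q`, the N-unit⁴ row bound `Q_X`. -/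
structure Cert where
  Γ : Coefs
  P : ℤ
  Q : ℤ
  QX : ℤ

/-- the class tuple `X⁴` -/
def isX4 (k0 k1 k2 k3 : LC) : Bool :=
  decide (k0 = LC.X) && decide (k1 = LC.X) && decide (k2 = LC.X) && decide (k3 = LC.X)

/-- right-hand side of the N rows -/
def rhsN (C : Cert) (k0 k1 k2 k3 : LC) : ℤ := if isX4 k0 k1 k2 k3 = true then C.QX else C.Q

/-- N-side check over the N-anatomy. -/
def okN (C : Cert) : Bool :=
  allLC fun k0 => allLC fun k1 => allLC fun k2 => allLC fun k3 =>
    decide (NAnat k0 k1 k2 k3 → rbOK k0 k1 k2 k3 ∧ GP C.Γ k0 k1 k2 k3 + C.P * RB k0 k1 k2 k3 ≤ rhsN C k0 k1 k2 k3)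

/-- P-side check over the weak P-anatomy. -/
def okP (C : Cert) : Bool :=
  allLC fun k0 => allLC fun k1 => allLC fun k2 => allLC fun k3 =>
    decide (PAnatW k0 k1 k2 k3 → rbOK k0 k1 k2 k3 ∧ -GP C.Γ k0 k1 k2 k3 + C.P * RB k0 k1 k2 k3 ≤ C.Q)

theorem okN_spec (C : Cert) (h : okN C = true) (k0 k1 k2 k3 : LC) (hk : NAnat k0 k1 k2 k3) :
    rbOK k0 k1 k2 k3 ∧ GP C.Γ k0 k1 k2 k3 + C.P * RB k0 k1 k2 k3 ≤ rhsN C k0 k1 k2 k3 :=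
  of_decide_eq_true (allLC_spec _ (allLC_spec _ (allLC_spec _ (allLC_spec _ h k0) k1) k2) k3) hk

theorem okP_spec (C : Cert) (h : okP C = true) (k0 k1 k2 k3 : LC) (hk : PAnatW k0 k1 k2 k3) :
    rbOK k0 k1 k2 k3 ∧ -GP C.Γ k0 k1 k2 k3 + C.P * RB k0 k1 k2 k3 ≤ C.Q :=
  of_decide_eq_true (allLC_spec _ (allLC_spec _ (allLC_spec _ (allLC_spec _ h k0) k1) k2) k3) hk

/-- **C0** (all regimes): LP value `29/32`, `32P = 29Q`. -/
def C0 : Cert := ⟨⟨0, 69812848, -9798922, -5353250, 1096088, -26433⟩, 1671096, 1843968, 1843968⟩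

/-- **C1** (N-unit⁴ priced `1 + 24`): LP value `25/2`, `32P = 400Q`, `Q_X − Q = 24Q`. -/
def C1 : Cert := ⟨⟨0, 51104256, -7098140, -3640308, 751912, -17543⟩, 2881200, 230496, 5762400⟩

theorem okN_C0 : okN C0 = true := by decide
theorem okP_C0 : okP C0 = true := by decide
theorem okN_C1 : okN C1 = true := by decide
theorem okP_C1 : okP C1 = true := by decide

/-! ## §5 Summation: `P·s(μ) ≤ Q·copies + (Q_X − Q)·m_N(unit⁴)` -/

/-- unit⁴ cells: all four letters of co-level 1 -/
def u4B (c : Cell) : Bool := (List.finRange 4).all fun f => decide ((c f).colevel = 1)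

/-- indicator of unit⁴ cells -/
def u4Ind (c : Cell) : ℤ := if u4B c = true then 1 else 0

/-- **N-unit⁴ mass** `m_N(unit⁴) = Σ {m_N(y) : y a unit⁴ cell}`. -/
def massU4 (D : Design) : ℤ := linZ D.N u4Ind

theorem u4Ind_nonneg (c : Cell) : 0 ≤ u4Ind c := by
  unfold u4Ind; split <;> norm_num

theorem massU4_nonneg (D : Design) : 0 ≤ massU4 D :=
  linZ_nonneg _ _ fun cm _ _ => u4Ind_nonneg cm.1

theorem isX4_iff_u4B {c : Cell} (hc : ∀ f : Fin 4, c f ∈ R2) :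
    isX4 (K c 0) (K c 1) (K c 2) (K c 3) = true ↔ u4B c = true := by
  have e := fun f => X_iff_colevel (hc f)
  simp only [isX4, u4B, K, Bool.and_eq_true, decide_eq_true_eq, List.all_eq_true, List.mem_finRange, true_implies]
  constructor
  · rintro ⟨⟨⟨h0, h1⟩, h2⟩, h3⟩ f
    fin_cases f
    · exact (e 0).mp h0
    · exact (e 1).mp h1
    · exact (e 2).mp h2
    · exact (e 3).mp h3
  · intro h
    exact ⟨⟨⟨(e 0).mpr (h 0), (e 1).mpr (h 1)⟩, (e 2).mpr (h 2)⟩, (e 3).mpr (h 3)⟩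

theorem rhsN_cell (C : Cert) {c : Cell} (hc : ∀ f : Fin 4, c f ∈ R2) :
    rhsN C (K c 0) (K c 1) (K c 2) (K c 3) = C.Q * 1 + (C.QX - C.Q) * u4Ind c := by
  unfold rhsN u4Ind
  by_cases h : u4B c = true
  · rw [if_pos ((isX4_iff_u4B hc).mpr h), if_pos h]; ring
  · rw [if_neg (fun h' => h ((isX4_iff_u4B hc).mp h')), if_neg h]; ring

/-- **THE CERTIFICATE BOUND** `P·s(μ) ≤ Q·copies + (Q_X − Q)·m_N(unit⁴)` for every passing certificate and every direction. -/
theorem cert_bound (C : Cert) (hN : okN C = true) (hP : okP C = true) (hP0 : 0 ≤ C.P)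
    {D : Design} (hD : D.OnAlphabet 14) (hR : Ring2 D) (hdisj : Disj D) (hrule : RuleD D) (h1 : D.A1) (d : Dir) :
    C.P * d.ev D.mu ≤ C.Q * (D.copies : ℤ) + (C.QX - C.Q) * massU4 D := by
  -- N side, cell by cell
  have hNpt : ∀ cm ∈ D.N, 0 < cm.2 →
      (1 : ℤ) * Gcell C.Γ cm.1 + C.P * d.ev (cellCoef cm.1 Word.eeee) ≤ C.Q * 1 + (C.QX - C.Q) * u4Ind cm.1 := by
    intro cm hcm hpos
    have hmem : cm.1 ∈ D.suppN := (mem_suppN_iff D cm.1).mpr ⟨cm.2, hcm, hpos⟩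
    have hc := fun f => memR2_of_supp hD hR (mem_supp_of_memN D hmem) f
    have hk := okN_spec C hN _ _ _ _ (nanat_of_suppN hD hR hdisj hrule hmem)
    have hev := (abs_le.mp (abs_ev_le_RB d hc hk.1)).2
    rw [← rhsN_cell C hc, Gcell_eq_GP C.Γ hc]
    nlinarith [hk.2]
  -- P side, cell by cell (a P-cell enters `μ` with a minus sign: use `−s ≤ R'`)
  have hPpt : ∀ cm ∈ D.P, 0 < cm.2 →
      (-1 : ℤ) * Gcell C.Γ cm.1 + (-C.P) * d.ev (cellCoef cm.1 Word.eeee) ≤ C.Q * 1 := by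
    intro cm hcm hpos
    have hmem : cm.1 ∈ D.suppP := (mem_suppP_iff D cm.1).mpr ⟨cm.2, hcm, hpos⟩
    have hc := fun f => memR2_of_supp hD hR (mem_supp_of_memP D hmem) f
    have hk := okP_spec C hP _ _ _ _ (panatW_of_suppP hD hR hdisj hrule hmem)
    have hev := (abs_le.mp (abs_ev_le_RB d hc hk.1)).1
    rw [Gcell_eq_GP C.Γ hc]
    nlinarith [hk.2]
  have hNs := linZ_mono D.N (fun c => (1 : ℤ) * Gcell C.Γ c + C.P * d.ev (cellCoef c Word.eeee))
    (fun c => C.Q * 1 + (C.QX - C.Q) * u4Ind c) hNpt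
  have hPs := linZ_mono D.P (fun c => (-1 : ℤ) * Gcell C.Γ c + (-C.P) * d.ev (cellCoef c Word.eeee))
    (fun _ => C.Q * 1) hPpt
  rw [linZ_lin, linZ_lin] at hNs
  rw [linZ_lin] at hPs
  have hQ : linZ D.P (fun _ => C.Q * 1) = C.Q * linZ D.P (fun _ => (1 : ℤ)) := by
    rw [← linZ_smul]
  rw [hQ, linZ_const_one] at hPs
  rw [linZ_const_one] at hNs
  have hv := G_vanishes D h1 C.Γ
  have hmu := d.ev_mu D
  have hcop : (D.copies : ℤ) = ((D.N.map Prod.snd).sum : ℕ) + ((D.P.map Prod.snd).sum : ℕ) := by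
    unfold Design.copies; push_cast; rfl
  rw [hcop, hmu]
  unfold massU4
  linarith

/-! ## §6 The laws at height 14 -/

/-- **C0: `copies ≥ 29`** for every `Ring2 ∧ Disj ∧ RuleD ∧ (A1)` design with parity-coupled `μ ≠ 0` on the height-14 alphabet. -/
theorem copies_ge_29 {D : Design} (hD : D.OnAlphabet 14) (hR : Ring2 D) (hdisj : Disj D) (hrule : RuleD D) (h1 : D.A1)
    (hpc : ParityCoupled D) (hμ : D.mu ≠ 0) : 29 ≤ D.copies := by
  obtain ⟨d, hd⟩ := exists_dir hpc hμ
  have hb := cert_bound C0 okN_C0 okP_C0 (by decide) hD hR hdisj hrule h1 d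
  simp only [C0] at hb
  have : (29 : ℤ) ≤ (D.copies : ℤ) := by nlinarith
  exact_mod_cast this

/-- **C1, THE MASS LAW: `copies + 24·m_N(unit⁴) ≥ 400`.** -/
theorem massLaw {D : Design} (hD : D.OnAlphabet 14) (hR : Ring2 D) (hdisj : Disj D) (hrule : RuleD D) (h1 : D.A1)
    (hpc : ParityCoupled D) (hμ : D.mu ≠ 0) : 400 ≤ (D.copies : ℤ) + 24 * massU4 D := by
  obtain ⟨d, hd⟩ := exists_dir hpc hμ
  have hb := cert_bound C1 okN_C1 okP_C1 (by decide) hD hR hdisj hrule h1 d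
  simp only [C1] at hb
  nlinarith [massU4_nonneg D]

/-- the regime «no supported N-cell is a unit⁴ cell» -/
def NoNUnit4 (D : Design) : Prop := ∀ y ∈ D.suppN, u4B y = false

theorem massU4_eq_zero {D : Design} (h : NoNUnit4 D) : massU4 D = 0 := by
  unfold massU4 linZ
  apply List.sum_eq_zero
  intro x hx
  obtain ⟨cm, hcm, rfl⟩ := List.mem_map.mp hx
  rcases Nat.eq_zero_or_pos cm.2 with h0 | hpos
  · rw [h0]; simp
  · have hmem : cm.1 ∈ D.suppN := (mem_suppN_iff D cm.1).mpr ⟨cm.2, hcm, hpos⟩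
    simp [u4Ind, h cm.1 hmem]

/-- **THE P-CARRIES-THE-CHARGE REGIME COSTS 400 COPIES**: `NoNUnit4 ⇒ copies ≥ 400`. -/
theorem regime_noNunit4 {D : Design} (hD : D.OnAlphabet 14) (hR : Ring2 D) (hdisj : Disj D) (hrule : RuleD D) (h1 : D.A1)
    (hpc : ParityCoupled D) (hμ : D.mu ≠ 0) (hreg : NoNUnit4 D) : 400 ≤ D.copies := by
  have h := massLaw hD hR hdisj hrule h1 hpc hμ
  rw [massU4_eq_zero hreg] at h
  exact_mod_cast (by linarith : (400 : ℤ) ≤ (D.copies : ℤ))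

/-- **UNDER `copies ≤ 108` THE N-SIDE CARRIES ≥ 13 COPIES ON unit⁴ CELLS.** -/
theorem massU4_ge_13 {D : Design} (hD : D.OnAlphabet 14) (hR : Ring2 D) (hdisj : Disj D) (hrule : RuleD D) (h1 : D.A1)
    (hpc : ParityCoupled D) (hμ : D.mu ≠ 0) (hB : D.copies ≤ 108) : 13 ≤ massU4 D := by
  have h := massLaw hD hR hdisj hrule h1 hpc hμ
  have hB' : (D.copies : ℤ) ≤ 108 := by exact_mod_cast hB
  omega

/-- under `copies ≤ 199`: `m_N(unit⁴) ≥ 9`. -/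
theorem massU4_ge_9 {D : Design} (hD : D.OnAlphabet 14) (hR : Ring2 D) (hdisj : Disj D) (hrule : RuleD D) (h1 : D.A1)
    (hpc : ParityCoupled D) (hμ : D.mu ≠ 0) (hB : D.copies ≤ 199) : 9 ≤ massU4 D := by
  have h := massLaw hD hR hdisj hrule h1 hpc hμ
  have hB' : (D.copies : ℤ) ≤ 199 := by exact_mod_cast hB
  omega

/-- in particular some unit⁴ cell is supported on the N side whenever `copies ≤ 399`. -/
theorem exists_Nunit4 {D : Design} (hD : D.OnAlphabet 14) (hR : Ring2 D) (hdisj : Disj D) (hrule : RuleD D) (h1 : D.A1)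
    (hpc : ParityCoupled D) (hμ : D.mu ≠ 0) (hB : D.copies ≤ 399) : ∃ y ∈ D.suppN, u4B y = true := by
  by_contra hno
  push Not at hno
  have hreg : NoNUnit4 D := fun y hy => by simpa using hno y hy
  have := regime_noNunit4 hD hR hdisj hrule h1 hpc hμ hreg
  omega

/-! ## §7 Every height, by the shift `a ↦ a + (14 − h)` -/

theorem shiftL_injective (t : ℤ) : Function.Injective (shiftL t) := by
  intro ℓ ℓ' h
  cases ℓ with
  | mk a x y =>
    cases ℓ' with
    | mk a' x' y' =>
      simp only [shiftL, Letter.mk.injEq] at h ⊢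
      omega

theorem shiftCell_injective (t : ℤ) : Function.Injective (shiftCell t) := by
  intro c c' h
  funext g
  have hg := congrFun h g
  simp only [shiftCell] at hg
  exact shiftL_injective t hg

theorem nullStep_shiftL (t : ℤ) (ℓ ℓ' : Letter) : NullStep (shiftL t ℓ) (shiftL t ℓ') ↔ NullStep ℓ ℓ' := by
  simp only [NullStep, shiftL_a, shiftL_x, shiftL_y, add_lt_add_iff_right, add_sub_add_right_eq_sub]

theorem detects_shift (t : ℤ) (c : Cell) (g j : Fin 4) : Detects (shiftCell t c) g j ↔ Detects c g j := by
  simp only [Detects, shiftCell, shiftL_a, shiftL_x, shiftL_y, add_left_inj]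

theorem supplies_shift (t : ℤ) (x y : Cell) (g j : Fin 4) :
    Supplies (shiftCell t x) (shiftCell t y) g j ↔ Supplies x y g j := by
  simp only [Supplies, shiftCell, nullStep_shiftL, (shiftL_injective t).eq_iff]

theorem ruleD_shift (t : ℤ) {D : Design} (hr : RuleD D) : RuleD (shiftD t D) := by
  constructor
  · intro y hy g j hgj hdet
    rw [suppN_shift] at hy
    obtain ⟨y₀, hy₀, rfl⟩ := List.mem_map.mp hy
    obtain ⟨x₀, hx₀, hs⟩ := hr.1 y₀ hy₀ g j hgj ((detects_shift t y₀ g j).mp hdet)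
    exact ⟨shiftCell t x₀, by rw [suppP_shift]; exact List.mem_map.mpr ⟨x₀, hx₀, rfl⟩, (supplies_shift t x₀ y₀ g j).mpr hs⟩
  · intro x hx g j hgj hdet
    rw [suppP_shift] at hx
    obtain ⟨x₀, hx₀, rfl⟩ := List.mem_map.mp hx
    obtain ⟨y₀, hy₀, hs⟩ := hr.2 x₀ hx₀ g j hgj ((detects_shift t x₀ g j).mp hdet)
    exact ⟨shiftCell t y₀, by rw [suppN_shift]; exact List.mem_map.mpr ⟨y₀, hy₀, rfl⟩, (supplies_shift t x₀ y₀ g j).mpr hs⟩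

theorem disj_shift (t : ℤ) {D : Design} (hd : Disj D) : Disj (shiftD t D) := by
  intro c hcN hcP
  rw [suppN_shift] at hcN
  rw [suppP_shift] at hcP
  obtain ⟨c₁, h₁, rfl⟩ := List.mem_map.mp hcN
  obtain ⟨c₂, h₂, he⟩ := List.mem_map.mp hcP
  rw [shiftCell_injective t he] at h₂
  exact hd c₁ h₁ h₂

theorem ring2_shift (t : ℤ) {D : Design} (hR : Ring2 D) : Ring2 (shiftD t D) := colevel_shift D t 2 hR

/-- a design on the height-`h` alphabet whose letters have co-level `≤ 2` shifts to the height-`14` alphabet. -/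
theorem onAlphabet14_of_shift {h : ℤ} {D : Design} (hD : D.OnAlphabet h) (hR : Ring2 D) : (shiftD (14 - h) D).OnAlphabet 14 := by
  have ha : ∀ c ∈ D.suppN ++ D.suppP, ∀ f : Fin 4, 0 ≤ (c f).a + (14 - h) := by
    intro c hc f
    have h1 := (hD c hc f).1
    have h2 := hR c hc f
    unfold Letter.height at h1
    unfold Letter.colevel at h2
    linarith
  have hA := onAlphabet_shift D h (14 - h) hD ha
  rwa [show h + (14 - h) = 14 by ring] at hA

theorem parityCoupled_shift (t : ℤ) {D : Design} (hpc : ParityCoupled D) : ParityCoupled (shiftD t D) := by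
  unfold ParityCoupled; rw [mu_shiftD]; exact hpc

theorem u4Ind_shiftCell (t : ℤ) (c : Cell) : u4Ind (shiftCell t c) = u4Ind c := by
  simp [u4Ind, u4B, shiftCell]

theorem massU4_shiftD (t : ℤ) (D : Design) : massU4 (shiftD t D) = massU4 D := by
  show linZ ((D.N.map fun cm => (shiftCell t cm.1, cm.2))) u4Ind = linZ D.N u4Ind
  rw [linZ_map]
  simp [u4Ind_shiftCell]

theorem copies_ge_29_allHeights {h : ℤ} {D : Design} (hD : D.OnAlphabet h) (hR : Ring2 D) (hdisj : Disj D) (hrule : RuleD D)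
    (h1 : D.A1) (hpc : ParityCoupled D) (hμ : D.mu ≠ 0) : 29 ≤ D.copies := by
  rw [← copies_shift D (14 - h)]
  exact copies_ge_29 (onAlphabet14_of_shift hD hR) (ring2_shift _ hR) (disj_shift _ hdisj) (ruleD_shift _ hrule)
    (a1_shiftD _ D h1) (parityCoupled_shift _ hpc) (by rw [mu_shiftD]; exact hμ)

theorem massLaw_allHeights {h : ℤ} {D : Design} (hD : D.OnAlphabet h) (hR : Ring2 D) (hdisj : Disj D) (hrule : RuleD D)
    (h1 : D.A1) (hpc : ParityCoupled D) (hμ : D.mu ≠ 0) : 400 ≤ (D.copies : ℤ) + 24 * massU4 D := by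
  rw [← copies_shift D (14 - h), ← massU4_shiftD (14 - h) D]
  exact massLaw (onAlphabet14_of_shift hD hR) (ring2_shift _ hR) (disj_shift _ hdisj) (ruleD_shift _ hrule)
    (a1_shiftD _ D h1) (parityCoupled_shift _ hpc) (by rw [mu_shiftD]; exact hμ)

theorem massU4_ge_13_allHeights {h : ℤ} {D : Design} (hD : D.OnAlphabet h) (hR : Ring2 D) (hdisj : Disj D) (hrule : RuleD D)
    (h1 : D.A1) (hpc : ParityCoupled D) (hμ : D.mu ≠ 0) (hB : D.copies ≤ 108) : 13 ≤ massU4 D := by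
  have h := massLaw_allHeights hD hR hdisj hrule h1 hpc hμ
  have hB' : (D.copies : ℤ) ≤ 108 := by exact_mod_cast hB
  omega

theorem regime_noNunit4_allHeights {h : ℤ} {D : Design} (hD : D.OnAlphabet h) (hR : Ring2 D) (hdisj : Disj D)
    (hrule : RuleD D) (h1 : D.A1) (hpc : ParityCoupled D) (hμ : D.mu ≠ 0) (hreg : NoNUnit4 D) : 400 ≤ D.copies := by
  have h := massLaw_allHeights hD hR hdisj hrule h1 hpc hμ
  rw [massU4_eq_zero hreg] at h
  exact_mod_cast (by linarith : (400 : ℤ) ≤ (D.copies : ℤ))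


/-! ## §8 The Hall rank row: `HallUp ⇒ rank ≥ 0`, `HallPlusUp 8 ⇒ rank ≥ 8`; hence `copies + 31·m_N(unit⁴) ≥ 520` and the v4.2 door
`copies + rank ≤ 116` forces `m_N(unit⁴) ≥ 14` on ring 2

The statement of record `RuleDPlate.SPlusB h Budget` carries the two door-1 rows `HallUp D` and `HallPlusUp D 8` as HYPOTHESES.  Their top
instances (`S = P`, `T = N`) are the RANK ROWS `Σ_P m ≤ Σ_N m` resp. `Σ_P m + 8 ≤ Σ_N m` (the latter needs `Σ_P m > 0`, which the LP
itself supplies: `Σ_P m ≥ 8`, certificate `Cpos`).  Pricing the rank row with a weight `ρ ≥ 0` in the type LP (exact, `work/hall_lp.py ∕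
nonly.py ∕ certs2.py`): regime «N ∌ unit⁴» value 512 (`HallUp`) ∕ 520 (`HallPlusUp 8`) instead of 400; mass-law saturation threshold θ* = 31
(instead of 24); the finer aggregated Hall rows (type-level transport relaxation of the full `HallUp`) add NOTHING at the door (LP-checked: the
door value 404/31 is attained with the rank row alone), so only the rank row is kernelised. -/

/-- a certificate with a rank-row weight `ρ` and separate budgets for N ∕ N-unit⁴ ∕ P cells: finite checks
  N: `G(k) + P·R'(k) + ρ ≤ Q_N` (`≤ Q_X` on `X⁴`) on `NAnat` tuples;   P: `−G(k) + P·R'(k) − ρ ≤ Q_P` on `PAnatW` tuples. -/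
structure CertR where
  Γ : Coefs
  P : ℤ
  ρ : ℤ
  QN : ℤ
  QX : ℤ
  QP : ℤ

/-- right-hand side of the N rows -/
def rhsNR (C : CertR) (k0 k1 k2 k3 : LC) : ℤ := if isX4 k0 k1 k2 k3 = true then C.QX else C.QN

def okNR (C : CertR) : Bool :=
  allLC fun k0 => allLC fun k1 => allLC fun k2 => allLC fun k3 =>
    decide (NAnat k0 k1 k2 k3 → rbOK k0 k1 k2 k3 ∧ GP C.Γ k0 k1 k2 k3 + C.P * RB k0 k1 k2 k3 + C.ρ ≤ rhsNR C k0 k1 k2 k3)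

def okPR (C : CertR) : Bool :=
  allLC fun k0 => allLC fun k1 => allLC fun k2 => allLC fun k3 =>
    decide (PAnatW k0 k1 k2 k3 → rbOK k0 k1 k2 k3 ∧ -GP C.Γ k0 k1 k2 k3 + C.P * RB k0 k1 k2 k3 - C.ρ ≤ C.QP)

theorem okNR_spec (C : CertR) (h : okNR C = true) (k0 k1 k2 k3 : LC) (hk : NAnat k0 k1 k2 k3) :
    rbOK k0 k1 k2 k3 ∧ GP C.Γ k0 k1 k2 k3 + C.P * RB k0 k1 k2 k3 + C.ρ ≤ rhsNR C k0 k1 k2 k3 :=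
  of_decide_eq_true (allLC_spec _ (allLC_spec _ (allLC_spec _ (allLC_spec _ h k0) k1) k2) k3) hk

theorem okPR_spec (C : CertR) (h : okPR C = true) (k0 k1 k2 k3 : LC) (hk : PAnatW k0 k1 k2 k3) :
    rbOK k0 k1 k2 k3 ∧ -GP C.Γ k0 k1 k2 k3 + C.P * RB k0 k1 k2 k3 - C.ρ ≤ C.QP :=
  of_decide_eq_true (allLC_spec _ (allLC_spec _ (allLC_spec _ (allLC_spec _ h k0) k1) k2) k3) hk

/-- **C2** (rank row priced): `Γ = 392·(0, 238, −131/4, −67/4, 24/7, −31/392)`, `P = 16·392`, `ρ = 392`, `Q_N = Q_P = 392`, `Q_X = 32·392`: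
LP value `32·16 + 8·1 = 520` per `Q`, `(Q_X − Q_N)/Q_N = 31`. -/
def C2 : CertR := ⟨⟨0, 93296, -12838, -6566, 1344, -31⟩, 6272, 392, 392, 12544, 392⟩

/-- **Cpos** (P-mass floor): N budgets `0`, P budget `4704`, `P = 1176`, `ρ = 0`: `4704·Σ_P m ≥ 32·1176`, i.e. `Σ_P m ≥ 8`. -/
def Cpos : CertR := ⟨⟨0, 389648, -55762, -30282, 6328, -155⟩, 1176, 0, 0, 0, 4704⟩

theorem okNR_C2 : okNR C2 = true := by decide
theorem okPR_C2 : okPR C2 = true := by decide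
theorem okNR_Cpos : okNR Cpos = true := by decide
theorem okPR_Cpos : okPR Cpos = true := by decide

/-- N-mass `Σ_N m` and P-mass `Σ_P m` as integers -/
def Nmass (D : Design) : ℤ := ((D.N.map Prod.snd).sum : ℕ)
def Pmass (D : Design) : ℤ := ((D.P.map Prod.snd).sum : ℕ)

theorem copies_eq (D : Design) : (D.copies : ℤ) = Nmass D + Pmass D := by
  unfold Design.copies Nmass Pmass; push_cast; rfl

theorem rank_eq (D : Design) : D.rank = Nmass D - Pmass D := by
  unfold Design.rank Nmass Pmass; rfl

theorem pmass_nonneg (D : Design) : 0 ≤ Pmass D := by unfold Pmass; exact_mod_cast Nat.zero_le _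

theorem rhsNR_cell (C : CertR) {c : Cell} (hc : ∀ f : Fin 4, c f ∈ R2) :
    rhsNR C (K c 0) (K c 1) (K c 2) (K c 3) = C.QN * 1 + (C.QX - C.QN) * u4Ind c := by
  unfold rhsNR u4Ind
  by_cases h : u4B c = true
  · rw [if_pos ((isX4_iff_u4B hc).mpr h), if_pos h]; ring
  · rw [if_neg (fun h' => h ((isX4_iff_u4B hc).mp h')), if_neg h]; ring

/-- **THE CERTIFICATE BOUND WITH THE RANK ROW**: `P·s(μ) + ρ·rank ≤ Q_N·Σ_N m + (Q_X − Q_N)·m_N(unit⁴) + Q_P·Σ_P m`. -/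
theorem certR_bound (C : CertR) (hN : okNR C = true) (hP : okPR C = true) (hP0 : 0 ≤ C.P)
    {D : Design} (hD : D.OnAlphabet 14) (hR : Ring2 D) (hdisj : Disj D) (hrule : RuleD D) (h1 : D.A1) (d : Dir) :
    C.P * d.ev D.mu + C.ρ * D.rank ≤ C.QN * Nmass D + (C.QX - C.QN) * massU4 D + C.QP * Pmass D := by
  have hNpt : ∀ cm ∈ D.N, 0 < cm.2 →
      (1 : ℤ) * Gcell C.Γ cm.1 + C.P * d.ev (cellCoef cm.1 Word.eeee) ≤
        (1 : ℤ) * (C.QN * 1 + (C.QX - C.QN) * u4Ind cm.1) + (-C.ρ) * 1 := by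
    intro cm hcm hpos
    have hmem : cm.1 ∈ D.suppN := (mem_suppN_iff D cm.1).mpr ⟨cm.2, hcm, hpos⟩
    have hc := fun f => memR2_of_supp hD hR (mem_supp_of_memN D hmem) f
    have hk := okNR_spec C hN _ _ _ _ (nanat_of_suppN hD hR hdisj hrule hmem)
    have hev := (abs_le.mp (abs_ev_le_RB d hc hk.1)).2
    rw [← rhsNR_cell C hc, Gcell_eq_GP C.Γ hc]
    nlinarith [hk.2]
  have hPpt : ∀ cm ∈ D.P, 0 < cm.2 →
      (-1 : ℤ) * Gcell C.Γ cm.1 + (-C.P) * d.ev (cellCoef cm.1 Word.eeee) ≤ (C.QP + C.ρ) * 1 := by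
    intro cm hcm hpos
    have hmem : cm.1 ∈ D.suppP := (mem_suppP_iff D cm.1).mpr ⟨cm.2, hcm, hpos⟩
    have hc := fun f => memR2_of_supp hD hR (mem_supp_of_memP D hmem) f
    have hk := okPR_spec C hP _ _ _ _ (panatW_of_suppP hD hR hdisj hrule hmem)
    have hev := (abs_le.mp (abs_ev_le_RB d hc hk.1)).1
    rw [Gcell_eq_GP C.Γ hc]
    nlinarith [hk.2]
  have hNs := linZ_mono D.N (fun c => (1 : ℤ) * Gcell C.Γ c + C.P * d.ev (cellCoef c Word.eeee))
    (fun c => (1 : ℤ) * (C.QN * 1 + (C.QX - C.QN) * u4Ind c) + (-C.ρ) * 1) hNpt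
  have hPs := linZ_mono D.P (fun c => (-1 : ℤ) * Gcell C.Γ c + (-C.P) * d.ev (cellCoef c Word.eeee))
    (fun _ => (C.QP + C.ρ) * 1) hPpt
  rw [linZ_lin, linZ_lin, linZ_lin] at hNs
  rw [linZ_lin] at hPs
  have hQ : linZ D.P (fun _ => (C.QP + C.ρ) * 1) = (C.QP + C.ρ) * linZ D.P (fun _ => (1 : ℤ)) := by
    rw [← linZ_smul]
  rw [hQ, linZ_const_one] at hPs
  rw [linZ_const_one] at hNs
  have hv := G_vanishes D h1 C.Γ
  have hmu := d.ev_mu D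
  rw [rank_eq, hmu]
  unfold massU4 Nmass Pmass
  linarith

/-- **every charged ring-2 design has P-mass `≥ 8`** (parity-coupled `μ ≠ 0`; certificate `Cpos`). -/
theorem pmass_ge_8 {D : Design} (hD : D.OnAlphabet 14) (hR : Ring2 D) (hdisj : Disj D) (hrule : RuleD D) (h1 : D.A1)
    (hpc : ParityCoupled D) (hμ : D.mu ≠ 0) : 8 ≤ Pmass D := by
  obtain ⟨d, hd⟩ := exists_dir hpc hμ
  have hb := certR_bound Cpos okNR_Cpos okPR_Cpos (by decide) hD hR hdisj hrule h1 d
  simp only [Cpos] at hb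
  linarith [massU4_nonneg D]

theorem pmass_pos_nat {D : Design} (hD : D.OnAlphabet 14) (hR : Ring2 D) (hdisj : Disj D) (hrule : RuleD D) (h1 : D.A1)
    (hpc : ParityCoupled D) (hμ : D.mu ≠ 0) : 0 < (D.P.map Prod.snd).sum := by
  have h := pmass_ge_8 hD hR hdisj hrule h1 hpc hμ
  unfold Pmass at h
  exact_mod_cast (by linarith : (0 : ℤ) < ((D.P.map Prod.snd).sum : ℕ))

/-- the rank rows -/
theorem rank_nonneg_of_hallUp {D : Design} (hU : HallUp D) : 0 ≤ D.rank := by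
  have h : ((D.P.map Prod.snd).sum : ℤ) ≤ ((D.N.map Prod.snd).sum : ℕ) := by exact_mod_cast sumP_le_sumN_of_hallUp D hU
  unfold Design.rank; linarith

theorem eight_le_rank {D : Design} (hD : D.OnAlphabet 14) (hR : Ring2 D) (hdisj : Disj D) (hrule : RuleD D) (h1 : D.A1)
    (hpc : ParityCoupled D) (hμ : D.mu ≠ 0) (hU8 : HallPlusUp D 8) : 8 ≤ D.rank :=
  eight_le_rank_of_hallPlusUp D hU8 (pmass_pos_nat hD hR hdisj hrule h1 hpc hμ)

/-- **C2, THE MASS LAW WITH THE RANK ROW (`HallUp`): `copies + 31·m_N(unit⁴) ≥ 512`.** -/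
theorem massLawHall {D : Design} (hD : D.OnAlphabet 14) (hR : Ring2 D) (hdisj : Disj D) (hrule : RuleD D) (h1 : D.A1)
    (hpc : ParityCoupled D) (hμ : D.mu ≠ 0) (hU : HallUp D) : 512 ≤ (D.copies : ℤ) + 31 * massU4 D := by
  obtain ⟨d, hd⟩ := exists_dir hpc hμ
  have hb := certR_bound C2 okNR_C2 okPR_C2 (by decide) hD hR hdisj hrule h1 d
  simp only [C2] at hb
  have hr := rank_nonneg_of_hallUp hU
  rw [copies_eq]
  linarith [massU4_nonneg D]

/-- **… WITH `HallPlusUp 8` (PortHall₈): `copies + 31·m_N(unit⁴) ≥ 520`.** -/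
theorem massLawHall8 {D : Design} (hD : D.OnAlphabet 14) (hR : Ring2 D) (hdisj : Disj D) (hrule : RuleD D) (h1 : D.A1)
    (hpc : ParityCoupled D) (hμ : D.mu ≠ 0) (hU8 : HallPlusUp D 8) : 520 ≤ (D.copies : ℤ) + 31 * massU4 D := by
  obtain ⟨d, hd⟩ := exists_dir hpc hμ
  have hb := certR_bound C2 okNR_C2 okPR_C2 (by decide) hD hR hdisj hrule h1 d
  simp only [C2] at hb
  have hr := eight_le_rank hD hR hdisj hrule h1 hpc hμ hU8
  rw [copies_eq]
  linarith [massU4_nonneg D]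

/-- **THE P-CARRIES-THE-CHARGE REGIME UNDER THE HALL ROWS COSTS 512 ∕ 520 COPIES.** -/
theorem regime_noNunit4_hall {D : Design} (hD : D.OnAlphabet 14) (hR : Ring2 D) (hdisj : Disj D) (hrule : RuleD D) (h1 : D.A1)
    (hpc : ParityCoupled D) (hμ : D.mu ≠ 0) (hU : HallUp D) (hreg : NoNUnit4 D) : 512 ≤ D.copies := by
  have h := massLawHall hD hR hdisj hrule h1 hpc hμ hU
  rw [massU4_eq_zero hreg] at h
  exact_mod_cast (by linarith : (512 : ℤ) ≤ (D.copies : ℤ))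

theorem regime_noNunit4_hall8 {D : Design} (hD : D.OnAlphabet 14) (hR : Ring2 D) (hdisj : Disj D) (hrule : RuleD D) (h1 : D.A1)
    (hpc : ParityCoupled D) (hμ : D.mu ≠ 0) (hU8 : HallPlusUp D 8) (hreg : NoNUnit4 D) : 520 ≤ D.copies := by
  have h := massLawHall8 hD hR hdisj hrule h1 hpc hμ hU8
  rw [massU4_eq_zero hreg] at h
  exact_mod_cast (by linarith : (520 : ℤ) ≤ (D.copies : ℤ))

/-- **THE RING-2 DOOR DIGIT.**  Under the v4.2 budget in its kernel form `copies + rank ≤ 116` (`SigmaH.copies_add_rank_le_of_budget`) and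
PortHall₈: `rank ≥ 8`, `copies ≤ 108`, `Σ_N m ≤ 58`, `8 ≤ Σ_P m ≤ 50`, and **the N side carries `≥ 14` copies on unit⁴ cells**. -/
theorem ring2_door {D : Design} (hD : D.OnAlphabet 14) (hR : Ring2 D) (hdisj : Disj D) (hrule : RuleD D) (h1 : D.A1)
    (hpc : ParityCoupled D) (hμ : D.mu ≠ 0) (hU8 : HallPlusUp D 8) (hdoor : (D.copies : ℤ) + D.rank ≤ 116) :
    8 ≤ D.rank ∧ D.copies ≤ 108 ∧ Nmass D ≤ 58 ∧ 8 ≤ Pmass D ∧ Pmass D ≤ 50 ∧ 14 ≤ massU4 D := by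
  have hr := eight_le_rank hD hR hdisj hrule h1 hpc hμ hU8
  have hm := massLawHall8 hD hR hdisj hrule h1 hpc hμ hU8
  have hp := pmass_ge_8 hD hR hdisj hrule h1 hpc hμ
  have hc := copies_eq D
  have hk := rank_eq D
  refine ⟨hr, ?_, by linarith, hp, by linarith, by omega⟩
  exact_mod_cast (by linarith : (D.copies : ℤ) ≤ 108)

/-- the same digit from the plain count door `copies ≤ 116` with `HallUp` only: `m_N(unit⁴) ≥ 13`. -/
theorem massU4_ge_13_of_hallUp {D : Design} (hD : D.OnAlphabet 14) (hR : Ring2 D) (hdisj : Disj D) (hrule : RuleD D) (h1 : D.A1)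
    (hpc : ParityCoupled D) (hμ : D.mu ≠ 0) (hU : HallUp D) (hB : D.copies ≤ 116) : 13 ≤ massU4 D := by
  have h := massLawHall hD hR hdisj hrule h1 hpc hμ hU
  have hB' : (D.copies : ℤ) ≤ 116 := by exact_mod_cast hB
  omega

/-- … and with PortHall₈ from `copies ≤ 116` alone: `m_N(unit⁴) ≥ 14` (`31·13 = 403 < 404`). -/
theorem massU4_ge_14 {D : Design} (hD : D.OnAlphabet 14) (hR : Ring2 D) (hdisj : Disj D) (hrule : RuleD D) (h1 : D.A1)
    (hpc : ParityCoupled D) (hμ : D.mu ≠ 0) (hU8 : HallPlusUp D 8) (hB : D.copies ≤ 116) : 14 ≤ massU4 D := by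
  have h := massLawHall8 hD hR hdisj hrule h1 hpc hμ hU8
  have hB' : (D.copies : ℤ) ≤ 116 := by exact_mod_cast hB
  omega

/-- every height (the Hall rows are shift-invariant, `RuleDPlate.hallUp_shiftD ∕ hallPlusUp_shiftD`). -/
theorem massLawHall8_allHeights {h : ℤ} {D : Design} (hD : D.OnAlphabet h) (hR : Ring2 D) (hdisj : Disj D) (hrule : RuleD D)
    (h1 : D.A1) (hpc : ParityCoupled D) (hμ : D.mu ≠ 0) (hU8 : HallPlusUp D 8) : 520 ≤ (D.copies : ℤ) + 31 * massU4 D := by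
  rw [← copies_shift D (14 - h), ← massU4_shiftD (14 - h) D]
  exact massLawHall8 (onAlphabet14_of_shift hD hR) (ring2_shift _ hR) (disj_shift _ hdisj) (ruleD_shift _ hrule)
    (a1_shiftD _ D h1) (parityCoupled_shift _ hpc) (by rw [mu_shiftD]; exact hμ) ((hallPlusUp_shiftD _ D 8).mpr hU8)

theorem massLawHall_allHeights {h : ℤ} {D : Design} (hD : D.OnAlphabet h) (hR : Ring2 D) (hdisj : Disj D) (hrule : RuleD D)
    (h1 : D.A1) (hpc : ParityCoupled D) (hμ : D.mu ≠ 0) (hU : HallUp D) : 512 ≤ (D.copies : ℤ) + 31 * massU4 D := by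
  rw [← copies_shift D (14 - h), ← massU4_shiftD (14 - h) D]
  exact massLawHall (onAlphabet14_of_shift hD hR) (ring2_shift _ hR) (disj_shift _ hdisj) (ruleD_shift _ hrule)
    (a1_shiftD _ D h1) (parityCoupled_shift _ hpc) (by rw [mu_shiftD]; exact hμ) ((hallUp_shiftD _ D).mpr hU)

theorem massU4_ge_14_allHeights {h : ℤ} {D : Design} (hD : D.OnAlphabet h) (hR : Ring2 D) (hdisj : Disj D) (hrule : RuleD D)
    (h1 : D.A1) (hpc : ParityCoupled D) (hμ : D.mu ≠ 0) (hU8 : HallPlusUp D 8) (hB : D.copies ≤ 116) : 14 ≤ massU4 D := by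
  have h := massLawHall8_allHeights hD hR hdisj hrule h1 hpc hμ hU8
  have hB' : (D.copies : ℤ) ≤ 116 := by exact_mod_cast hB
  omega

theorem regime_noNunit4_hall8_allHeights {h : ℤ} {D : Design} (hD : D.OnAlphabet h) (hR : Ring2 D) (hdisj : Disj D)
    (hrule : RuleD D) (h1 : D.A1) (hpc : ParityCoupled D) (hμ : D.mu ≠ 0) (hU8 : HallPlusUp D 8) (hreg : NoNUnit4 D) :
    520 ≤ D.copies := by
  have h := massLawHall8_allHeights hD hR hdisj hrule h1 hpc hμ hU8
  rw [massU4_eq_zero hreg] at h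
  exact_mod_cast (by linarith : (520 : ℤ) ≤ (D.copies : ℤ))

/-! ## §9 Three SPARSE E-FREE LAWS on the LAW-F room — no `μ ≠ 0`, no parity, no Hall rows (v3)

The six e-free (A1) rows restricted to the 16 class types of the LAW-F room (`NAnat ∪ PAnatW`; cell counts 1 041 ⊂ 5 009, the anomaly
cell's N- and P-rooms exactly) have rank 5, and the sparsest vectors of their row space single out three laws valid for EVERY (A1)-clean
ring-2 design closed under `RuleD ∧ Disj` (`work/sparse_ids.py`; letters: `u` = unit, co-level 1; `H` = hub, co-level 0; `A` = axis floor
`(12; ±2, 0), (12; 0, ±2)`; `D` = diagonal floor `(12; ±1, ±1)`, the anomaly cell's `B`):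
* `Γ_B = (−2744, 588, −28, −14, 1, 0)`: `G ≡ 0` on every room type except the B-HOOKS `(D; u, u, u)`, where `G = −6`  ⇒
  **B-HOOK EXCLUSION: no supported cell, N or P, is a B-hook** (`no_bhook_P`, `no_bhook_N`; hence the anomaly cell's B-packet residual
  corner is empty for free);
* `Γ₂ = (−2548, 560, −28, −13, 1, 0)`: `G = −8·[H,H,D,D] + 2·[H,u,u,D]` on the room  ⇒  **`m_P(H,u,u,D) = 4·m_P(H,H,D,D)`** (`huuD_law`);
* `Γ₃ = (−8036, 1736, −83, −42, 3, 0)`: `G = 12·[u⁴] + 24·[A-hook] − 2·[H,u,u,D]` on the room  ⇒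
  **`6·(m_N(u⁴) − m_P(u⁴)) = 12·m_P(A-hooks) − m_P(H,u,u,D)`** (`unit4_balance`); with `huuD_law`:
  `3·(m_N(u⁴) − m_P(u⁴)) = 6·m_P(A-hooks) − 2·m_P(H,H,D,D)`, so `3 ∣ m_P(H,H,D,D)`, `12 ∣ m_P(H,u,u,D)` and `m_N(u⁴) ≡ m_P(u⁴) (mod 2)`.
Every height (the shapes are co-level data). -/

namespace LC

/-- diagonal floor class `D` -/
def isDg : LC → Bool
  | D => true | _ => false

/-- axis floor class `A` -/
def isAx : LC → Bool
  | A => true | _ => false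

/-- unit class `X` -/
def isU : LC → Bool
  | X => true | _ => false

end LC

/-- letter shapes (co-level data, invariant under the height shift): unit, hub, diagonal floor, axis floor. -/
abbrev IsUnitL (ℓ : Letter) : Prop := ℓ.colevel = 1
abbrev IsHubL (ℓ : Letter) : Prop := ℓ.colevel = 0
abbrev IsDiagL (ℓ : Letter) : Prop := ℓ.colevel = 2 ∧ ℓ.x * ℓ.y ≠ 0
abbrev IsAxFlL (ℓ : Letter) : Prop := ℓ.colevel = 2 ∧ ℓ.x * ℓ.y = 0

theorem R2_flags : ∀ ℓ ∈ R2, (classOf ℓ).isDg = decide (IsDiagL ℓ) ∧ (classOf ℓ).isAx = decide (IsAxFlL ℓ) ∧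
    (classOf ℓ).isU = decide (IsUnitL ℓ) ∧ (classOf ℓ).isH = decide (IsHubL ℓ) := by
  decide

/-- class-tuple counts of diagonal floors, axis floors, units -/
def cntDg (k0 k1 k2 k3 : LC) : ℕ := k0.isDg.toNat + k1.isDg.toNat + k2.isDg.toNat + k3.isDg.toNat
def cntAx (k0 k1 k2 k3 : LC) : ℕ := k0.isAx.toNat + k1.isAx.toNat + k2.isAx.toNat + k3.isAx.toNat
def cntU (k0 k1 k2 k3 : LC) : ℕ := k0.isU.toNat + k1.isU.toNat + k2.isU.toNat + k3.isU.toNat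

/-- the same counts read off a cell intrinsically -/
def cntDiagC (c : Cell) : ℕ :=
  (decide (IsDiagL (c 0))).toNat + (decide (IsDiagL (c 1))).toNat + (decide (IsDiagL (c 2))).toNat + (decide (IsDiagL (c 3))).toNat
def cntAxFlC (c : Cell) : ℕ :=
  (decide (IsAxFlL (c 0))).toNat + (decide (IsAxFlL (c 1))).toNat + (decide (IsAxFlL (c 2))).toNat + (decide (IsAxFlL (c 3))).toNat
def cntUnitC (c : Cell) : ℕ :=
  (decide (IsUnitL (c 0))).toNat + (decide (IsUnitL (c 1))).toNat + (decide (IsUnitL (c 2))).toNat + (decide (IsUnitL (c 3))).toNat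
def cntHubC (c : Cell) : ℕ :=
  (decide (IsHubL (c 0))).toNat + (decide (IsHubL (c 1))).toNat + (decide (IsHubL (c 2))).toNat + (decide (IsHubL (c 3))).toNat

theorem cnt_bridge {c : Cell} (hc : ∀ f : Fin 4, c f ∈ R2) :
    cntDg (K c 0) (K c 1) (K c 2) (K c 3) = cntDiagC c ∧ cntAx (K c 0) (K c 1) (K c 2) (K c 3) = cntAxFlC c ∧
    cntU (K c 0) (K c 1) (K c 2) (K c 3) = cntUnitC c ∧ cntH (K c 0) (K c 1) (K c 2) (K c 3) = cntHubC c := by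
  have h := fun f => R2_flags (c f) (hc f)
  refine ⟨?_, ?_, ?_, ?_⟩
  · simp only [cntDg, cntDiagC, K, (h 0).1, (h 1).1, (h 2).1, (h 3).1]
  · simp only [cntAx, cntAxFlC, K, (h 0).2.1, (h 1).2.1, (h 2).2.1, (h 3).2.1]
  · simp only [cntU, cntUnitC, K, (h 0).2.2.1, (h 1).2.2.1, (h 2).2.2.1, (h 3).2.2.1]
  · simp only [cntH, cntHubC, K, (h 0).2.2.2, (h 1).2.2.2, (h 2).2.2.2, (h 3).2.2.2]

/-- **B-hook** `(D; u, u, u)`: one diagonal floor letter and three units (any slot order). -/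
abbrev IsBHook (c : Cell) : Prop := cntDiagC c = 1 ∧ cntUnitC c = 3
/-- **A-hook** `(A; u, u, u)`. -/
abbrev IsAHook (c : Cell) : Prop := cntAxFlC c = 1 ∧ cntUnitC c = 3
/-- the shape `(H, u, u, D)`. -/
abbrev IsHuuD (c : Cell) : Prop := cntHubC c = 1 ∧ cntUnitC c = 2 ∧ cntDiagC c = 1
/-- the shape `(H, H, D, D)`. -/
abbrev IsHHDD (c : Cell) : Prop := cntHubC c = 2 ∧ cntDiagC c = 2

/-- ℤ-valued indicators of the four shapes -/
def indB (c : Cell) : ℤ := if IsBHook c then 1 else 0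
def indA (c : Cell) : ℤ := if IsAHook c then 1 else 0
def indHuuD (c : Cell) : ℤ := if IsHuuD c then 1 else 0
def indHHDD (c : Cell) : ℤ := if IsHHDD c then 1 else 0

/-- the same indicators on class tuples, and the unit⁴ indicator -/
def indBK (k0 k1 k2 k3 : LC) : ℤ := if cntDg k0 k1 k2 k3 = 1 ∧ cntU k0 k1 k2 k3 = 3 then 1 else 0
def indAK (k0 k1 k2 k3 : LC) : ℤ := if cntAx k0 k1 k2 k3 = 1 ∧ cntU k0 k1 k2 k3 = 3 then 1 else 0
def indHuuDK (k0 k1 k2 k3 : LC) : ℤ := if cntH k0 k1 k2 k3 = 1 ∧ cntU k0 k1 k2 k3 = 2 ∧ cntDg k0 k1 k2 k3 = 1 then 1 else 0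
def indHHDDK (k0 k1 k2 k3 : LC) : ℤ := if cntH k0 k1 k2 k3 = 2 ∧ cntDg k0 k1 k2 k3 = 2 then 1 else 0
def indX4K (k0 k1 k2 k3 : LC) : ℤ := if isX4 k0 k1 k2 k3 = true then 1 else 0

theorem ind_bridge {c : Cell} (hc : ∀ f : Fin 4, c f ∈ R2) :
    indBK (K c 0) (K c 1) (K c 2) (K c 3) = indB c ∧ indAK (K c 0) (K c 1) (K c 2) (K c 3) = indA c ∧
    indHuuDK (K c 0) (K c 1) (K c 2) (K c 3) = indHuuD c ∧ indHHDDK (K c 0) (K c 1) (K c 2) (K c 3) = indHHDD c := by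
  obtain ⟨h1, h2, h3, h4⟩ := cnt_bridge hc
  simp only [indBK, indB, IsBHook, indAK, indA, IsAHook, indHuuDK, indHuuD, IsHuuD, indHHDDK, indHHDD, IsHHDD, h1, h2, h3, h4,
    and_self]

theorem indX4K_cell {c : Cell} (hc : ∀ f : Fin 4, c f ∈ R2) : indX4K (K c 0) (K c 1) (K c 2) (K c 3) = u4Ind c := by
  unfold indX4K u4Ind
  by_cases h : u4B c = true
  · rw [if_pos ((isX4_iff_u4B hc).mpr h), if_pos h]
  · rw [if_neg (fun h' => h ((isX4_iff_u4B hc).mp h')), if_neg h]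

theorem indB_nonneg (c : Cell) : 0 ≤ indB c := by unfold indB; split <;> norm_num
theorem indA_nonneg (c : Cell) : 0 ≤ indA c := by unfold indA; split <;> norm_num
theorem indHuuD_nonneg (c : Cell) : 0 ≤ indHuuD c := by unfold indHuuD; split <;> norm_num
theorem indHHDD_nonneg (c : Cell) : 0 ≤ indHHDD c := by unfold indHHDD; split <;> norm_num

/-- the three e-free multipliers -/
def ΓB : Coefs := ⟨-2744, 588, -28, -14, 1, 0⟩
def Γ2 : Coefs := ⟨-2548, 560, -28, -13, 1, 0⟩
def Γ3 : Coefs := ⟨-8036, 1736, -83, -42, 3, 0⟩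

/-- N-side finite check: on the N-anatomy `G_B = 0`, no B-hook, `G₂ = 0`, `G₃ = 12·[u⁴]`. -/
def okLawN : Bool :=
  allLC fun k0 => allLC fun k1 => allLC fun k2 => allLC fun k3 =>
    decide (NAnat k0 k1 k2 k3 → GP ΓB k0 k1 k2 k3 = 0 ∧ indBK k0 k1 k2 k3 = 0 ∧ GP Γ2 k0 k1 k2 k3 = 0 ∧
      GP Γ3 k0 k1 k2 k3 = 12 * indX4K k0 k1 k2 k3)

/-- P-side finite check: on the weak P-anatomy `G_B = −6·[B-hook]`, `G₂ = −8·[HHDD] + 2·[HuuD]`, `G₃ = −2·[HuuD] + 12·[u⁴] + 24·[A-hook]`. -/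
def okLawP : Bool :=
  allLC fun k0 => allLC fun k1 => allLC fun k2 => allLC fun k3 =>
    decide (PAnatW k0 k1 k2 k3 → GP ΓB k0 k1 k2 k3 = -6 * indBK k0 k1 k2 k3 ∧
      GP Γ2 k0 k1 k2 k3 = -8 * indHHDDK k0 k1 k2 k3 + 2 * indHuuDK k0 k1 k2 k3 ∧
      GP Γ3 k0 k1 k2 k3 = -2 * indHuuDK k0 k1 k2 k3 + 12 * indX4K k0 k1 k2 k3 + 24 * indAK k0 k1 k2 k3)

theorem okLawN_true : okLawN = true := by decide
theorem okLawP_true : okLawP = true := by decide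

theorem okLawN_spec (k0 k1 k2 k3 : LC) (hk : NAnat k0 k1 k2 k3) :
    GP ΓB k0 k1 k2 k3 = 0 ∧ indBK k0 k1 k2 k3 = 0 ∧ GP Γ2 k0 k1 k2 k3 = 0 ∧ GP Γ3 k0 k1 k2 k3 = 12 * indX4K k0 k1 k2 k3 :=
  of_decide_eq_true (allLC_spec _ (allLC_spec _ (allLC_spec _ (allLC_spec _ okLawN_true k0) k1) k2) k3) hk

theorem okLawP_spec (k0 k1 k2 k3 : LC) (hk : PAnatW k0 k1 k2 k3) :
    GP ΓB k0 k1 k2 k3 = -6 * indBK k0 k1 k2 k3 ∧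
      GP Γ2 k0 k1 k2 k3 = -8 * indHHDDK k0 k1 k2 k3 + 2 * indHuuDK k0 k1 k2 k3 ∧
      GP Γ3 k0 k1 k2 k3 = -2 * indHuuDK k0 k1 k2 k3 + 12 * indX4K k0 k1 k2 k3 + 24 * indAK k0 k1 k2 k3 :=
  of_decide_eq_true (allLC_spec _ (allLC_spec _ (allLC_spec _ (allLC_spec _ okLawP_true k0) k1) k2) k3) hk

theorem linZ_congr' (L : List (Cell × ℕ)) (φ ψ : Cell → ℤ) (h : ∀ cm ∈ L, 0 < cm.2 → φ cm.1 = ψ cm.1) :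
    linZ L φ = linZ L ψ :=
  le_antisymm (linZ_mono L φ ψ fun cm hm hp => (h cm hm hp).le) (linZ_mono L ψ φ fun cm hm hp => (h cm hm hp).ge)

theorem linZ_pos (L : List (Cell × ℕ)) (φ : Cell → ℤ) (h0 : ∀ cm ∈ L, 0 < cm.2 → 0 ≤ φ cm.1)
    {cm : Cell × ℕ} (hcm : cm ∈ L) (hp : 0 < cm.2) (hφ : 0 < φ cm.1) : 0 < linZ L φ := by
  induction L with
  | nil => simp at hcm
  | cons a t ih =>
    rw [linZ_cons]
    have ht0 : ∀ cm ∈ t, 0 < cm.2 → 0 ≤ φ cm.1 := fun cm hm hp => h0 cm (List.mem_cons_of_mem _ hm) hp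
    have htn : 0 ≤ linZ t φ := linZ_nonneg t φ ht0
    rcases List.mem_cons.mp hcm with rfl | hmem
    · have : 0 < (cm.2 : ℤ) * φ cm.1 := mul_pos (by exact_mod_cast hp) hφ
      linarith
    · have := ih ht0 hmem
      have ha : 0 ≤ (a.2 : ℤ) * φ a.1 := by
        rcases Nat.eq_zero_or_pos a.2 with h0' | hpos
        · rw [h0']; simp
        · exact mul_nonneg (by exact_mod_cast hpos.le) (h0 a List.mem_cons_self hpos)
      linarith

/-- the P-masses of the four shapes and of unit⁴ -/
def mPB (D : Design) : ℤ := linZ D.P indB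
def mPA (D : Design) : ℤ := linZ D.P indA
def mPHuuD (D : Design) : ℤ := linZ D.P indHuuD
def mPHHDD (D : Design) : ℤ := linZ D.P indHHDD
def mPU4 (D : Design) : ℤ := linZ D.P u4Ind

theorem mPB_nonneg (D : Design) : 0 ≤ mPB D := linZ_nonneg _ _ fun cm _ _ => indB_nonneg cm.1
theorem mPA_nonneg (D : Design) : 0 ≤ mPA D := linZ_nonneg _ _ fun cm _ _ => indA_nonneg cm.1
theorem mPHuuD_nonneg (D : Design) : 0 ≤ mPHuuD D := linZ_nonneg _ _ fun cm _ _ => indHuuD_nonneg cm.1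
theorem mPHHDD_nonneg (D : Design) : 0 ≤ mPHHDD D := linZ_nonneg _ _ fun cm _ _ => indHHDD_nonneg cm.1
theorem mPU4_nonneg (D : Design) : 0 ≤ mPU4 D := linZ_nonneg _ _ fun cm _ _ => u4Ind_nonneg cm.1

/-- the six class sums of the three multipliers -/
theorem law_sums {D : Design} (hD : D.OnAlphabet 14) (hR : Ring2 D) (hdisj : Disj D) (hrule : RuleD D) :
    linZ D.N (Gcell ΓB) = 0 ∧ linZ D.P (Gcell ΓB) = -6 * mPB D ∧
    linZ D.N (Gcell Γ2) = 0 ∧ linZ D.P (Gcell Γ2) = -8 * mPHHDD D + 2 * mPHuuD D ∧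
    linZ D.N (Gcell Γ3) = 12 * massU4 D ∧ linZ D.P (Gcell Γ3) = -2 * mPHuuD D + 12 * mPU4 D + 24 * mPA D := by
  have hN : ∀ cm ∈ D.N, 0 < cm.2 → Gcell ΓB cm.1 = 0 * (1 : ℤ) ∧ Gcell Γ2 cm.1 = 0 * (1 : ℤ) ∧ Gcell Γ3 cm.1 = 12 * u4Ind cm.1 := by
    intro cm hcm hpos
    have hmem : cm.1 ∈ D.suppN := (mem_suppN_iff D cm.1).mpr ⟨cm.2, hcm, hpos⟩
    have hc := fun f => memR2_of_supp hD hR (mem_supp_of_memN D hmem) f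
    have hk := okLawN_spec _ _ _ _ (nanat_of_suppN hD hR hdisj hrule hmem)
    rw [Gcell_eq_GP ΓB hc, Gcell_eq_GP Γ2 hc, Gcell_eq_GP Γ3 hc, ← indX4K_cell hc]
    exact ⟨by rw [hk.1]; ring, by rw [hk.2.2.1]; ring, hk.2.2.2⟩
  have hP : ∀ cm ∈ D.P, 0 < cm.2 → Gcell ΓB cm.1 = -6 * indB cm.1 ∧
      Gcell Γ2 cm.1 = -8 * indHHDD cm.1 + 2 * indHuuD cm.1 ∧
      Gcell Γ3 cm.1 = (-2 * indHuuD cm.1 + 12 * u4Ind cm.1) + 24 * indA cm.1 := by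
    intro cm hcm hpos
    have hmem : cm.1 ∈ D.suppP := (mem_suppP_iff D cm.1).mpr ⟨cm.2, hcm, hpos⟩
    have hc := fun f => memR2_of_supp hD hR (mem_supp_of_memP D hmem) f
    have hk := okLawP_spec _ _ _ _ (panatW_of_suppP hD hR hdisj hrule hmem)
    obtain ⟨b1, b2, b3, b4⟩ := ind_bridge hc
    rw [Gcell_eq_GP ΓB hc, Gcell_eq_GP Γ2 hc, Gcell_eq_GP Γ3 hc, ← b1, ← b2, ← b3, ← b4, ← indX4K_cell hc]
    exact ⟨hk.1, hk.2.1, by rw [hk.2.2]⟩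
  refine ⟨?_, ?_, ?_, ?_, ?_, ?_⟩
  · rw [linZ_congr' D.N (Gcell ΓB) (fun _ => 0 * (1 : ℤ)) fun cm hm hp => (hN cm hm hp).1, linZ_smul]; ring
  · rw [linZ_congr' D.P (Gcell ΓB) (fun c => -6 * indB c) fun cm hm hp => (hP cm hm hp).1, linZ_smul]; rfl
  · rw [linZ_congr' D.N (Gcell Γ2) (fun _ => 0 * (1 : ℤ)) fun cm hm hp => (hN cm hm hp).2.1, linZ_smul]; ring
  · rw [linZ_congr' D.P (Gcell Γ2) (fun c => -8 * indHHDD c + 2 * indHuuD c) fun cm hm hp => (hP cm hm hp).2.1, linZ_lin]; rfl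
  · rw [linZ_congr' D.N (Gcell Γ3) (fun c => 12 * u4Ind c) fun cm hm hp => (hN cm hm hp).2.2, linZ_smul]; rfl
  · rw [linZ_congr' D.P (Gcell Γ3) (fun c => (-2 * indHuuD c + 12 * u4Ind c) + 24 * indA c) fun cm hm hp => (hP cm hm hp).2.2,
      linZ_add, linZ_lin, linZ_smul]; rfl

/-- **B-HOOK P-MASS VANISHES.** -/
theorem mPB_eq_zero {D : Design} (hD : D.OnAlphabet 14) (hR : Ring2 D) (hdisj : Disj D) (hrule : RuleD D) (h1 : D.A1) :
    mPB D = 0 := by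
  obtain ⟨hN, hP, -, -, -, -⟩ := law_sums hD hR hdisj hrule
  have hv := G_vanishes D h1 ΓB
  rw [hN, hP] at hv
  linarith

/-- **B-HOOK EXCLUSION, P side: no supported P-cell of an (A1)-clean ring-2 design closed under `RuleD ∧ Disj` is a B-hook `(D; u, u, u)`.** -/
theorem no_bhook_P {D : Design} (hD : D.OnAlphabet 14) (hR : Ring2 D) (hdisj : Disj D) (hrule : RuleD D) (h1 : D.A1) :
    ∀ x ∈ D.suppP, ¬ IsBHook x := by
  intro x hx hB
  obtain ⟨m, hm, hpos⟩ := (mem_suppP_iff D x).mp hx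
  have hpos' : 0 < linZ D.P indB :=
    linZ_pos D.P indB (fun cm _ _ => indB_nonneg cm.1) hm hpos (by show 0 < indB x; rw [indB, if_pos hB]; norm_num)
  have h0 := mPB_eq_zero hD hR hdisj hrule h1
  unfold mPB at h0
  linarith

/-- **B-HOOK EXCLUSION, N side** (this half is LAW F1∕F3 alone: an N-cell with a floor letter has two hubs). -/
theorem no_bhook_N {D : Design} (hD : D.OnAlphabet 14) (hR : Ring2 D) (hdisj : Disj D) (hrule : RuleD D) :
    ∀ y ∈ D.suppN, ¬ IsBHook y := by
  intro y hy hB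
  have hc := fun f => memR2_of_supp hD hR (mem_supp_of_memN D hy) f
  have hk := (okLawN_spec _ _ _ _ (nanat_of_suppN hD hR hdisj hrule hy)).2.1
  rw [(ind_bridge hc).1, indB, if_pos hB] at hk
  exact one_ne_zero hk

/-- **`m_P(H,u,u,D) = 4·m_P(H,H,D,D)`.** -/
theorem huuD_law {D : Design} (hD : D.OnAlphabet 14) (hR : Ring2 D) (hdisj : Disj D) (hrule : RuleD D) (h1 : D.A1) :
    mPHuuD D = 4 * mPHHDD D := by
  obtain ⟨-, -, hN, hP, -, -⟩ := law_sums hD hR hdisj hrule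
  have hv := G_vanishes D h1 Γ2
  rw [hN, hP] at hv
  linarith

/-- **THE unit⁴ BALANCE LAW `6·(m_N(u⁴) − m_P(u⁴)) = 12·m_P(A-hooks) − m_P(H,u,u,D)`.** -/
theorem unit4_balance {D : Design} (hD : D.OnAlphabet 14) (hR : Ring2 D) (hdisj : Disj D) (hrule : RuleD D) (h1 : D.A1) :
    6 * (massU4 D - mPU4 D) = 12 * mPA D - mPHuuD D := by
  obtain ⟨-, -, -, -, hN, hP⟩ := law_sums hD hR hdisj hrule
  have hv := G_vanishes D h1 Γ3
  rw [hN, hP] at hv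
  linarith

/-- the balance law with `huuD_law` substituted: `3·(m_N(u⁴) − m_P(u⁴)) = 6·m_P(A-hooks) − 2·m_P(H,H,D,D)`. -/
theorem unit4_balance' {D : Design} (hD : D.OnAlphabet 14) (hR : Ring2 D) (hdisj : Disj D) (hrule : RuleD D) (h1 : D.A1) :
    3 * (massU4 D - mPU4 D) = 6 * mPA D - 2 * mPHHDD D := by
  have h := unit4_balance hD hR hdisj hrule h1
  have h' := huuD_law hD hR hdisj hrule h1
  linarith

/-- divisibility digits: `3 ∣ m_P(H,H,D,D)`, `12 ∣ m_P(H,u,u,D)`, `2 ∣ m_N(u⁴) − m_P(u⁴)`. -/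
theorem divisibility {D : Design} (hD : D.OnAlphabet 14) (hR : Ring2 D) (hdisj : Disj D) (hrule : RuleD D) (h1 : D.A1) :
    (3 : ℤ) ∣ mPHHDD D ∧ (12 : ℤ) ∣ mPHuuD D ∧ (2 : ℤ) ∣ massU4 D - mPU4 D := by
  have h := unit4_balance' hD hR hdisj hrule h1
  have h' := huuD_law hD hR hdisj hrule h1
  refine ⟨?_, ?_, ?_⟩ <;> omega

/-! ### §9b  every height -/

theorem colevel_shiftL (t : ℤ) (ℓ : Letter) : (shiftL t ℓ).colevel = ℓ.colevel := rfl
-- the shapes are co-level data: the shift `a ↦ a + t` does not touch them (all `rfl`)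
theorem cntDiagC_shift (t : ℤ) (c : Cell) : cntDiagC (shiftCell t c) = cntDiagC c := rfl
theorem cntAxFlC_shift (t : ℤ) (c : Cell) : cntAxFlC (shiftCell t c) = cntAxFlC c := rfl
theorem cntUnitC_shift (t : ℤ) (c : Cell) : cntUnitC (shiftCell t c) = cntUnitC c := rfl
theorem cntHubC_shift (t : ℤ) (c : Cell) : cntHubC (shiftCell t c) = cntHubC c := rfl

theorem isBHook_shift (t : ℤ) (c : Cell) : IsBHook (shiftCell t c) ↔ IsBHook c := Iff.rfl
theorem indB_shift (t : ℤ) (c : Cell) : indB (shiftCell t c) = indB c := rfl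
theorem indA_shift (t : ℤ) (c : Cell) : indA (shiftCell t c) = indA c := rfl
theorem indHuuD_shift (t : ℤ) (c : Cell) : indHuuD (shiftCell t c) = indHuuD c := rfl
theorem indHHDD_shift (t : ℤ) (c : Cell) : indHHDD (shiftCell t c) = indHHDD c := rfl

theorem massP_shiftD (t : ℤ) (D : Design) (ψ : Cell → ℤ) (hψ : ∀ c, ψ (shiftCell t c) = ψ c) :
    linZ (shiftD t D).P ψ = linZ D.P ψ := by
  show linZ ((D.P.map fun cm => (shiftCell t cm.1, cm.2))) ψ = linZ D.P ψ
  rw [linZ_map]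
  simp [hψ]

theorem mPB_shiftD (t : ℤ) (D : Design) : mPB (shiftD t D) = mPB D := massP_shiftD t D indB (indB_shift t)
theorem mPA_shiftD (t : ℤ) (D : Design) : mPA (shiftD t D) = mPA D := massP_shiftD t D indA (indA_shift t)
theorem mPHuuD_shiftD (t : ℤ) (D : Design) : mPHuuD (shiftD t D) = mPHuuD D := massP_shiftD t D indHuuD (indHuuD_shift t)
theorem mPHHDD_shiftD (t : ℤ) (D : Design) : mPHHDD (shiftD t D) = mPHHDD D := massP_shiftD t D indHHDD (indHHDD_shift t)
theorem mPU4_shiftD (t : ℤ) (D : Design) : mPU4 (shiftD t D) = mPU4 D := massP_shiftD t D u4Ind (u4Ind_shiftCell t)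

/-- **B-HOOK EXCLUSION AT EVERY HEIGHT.** -/
theorem no_bhook_allHeights {h : ℤ} {D : Design} (hD : D.OnAlphabet h) (hR : Ring2 D) (hdisj : Disj D) (hrule : RuleD D)
    (h1 : D.A1) : (∀ x ∈ D.suppP, ¬ IsBHook x) ∧ (∀ y ∈ D.suppN, ¬ IsBHook y) := by
  have hA := onAlphabet14_of_shift hD hR
  have hP := no_bhook_P hA (ring2_shift _ hR) (disj_shift _ hdisj) (ruleD_shift _ hrule) (a1_shiftD _ D h1)
  have hN := no_bhook_N hA (ring2_shift _ hR) (disj_shift _ hdisj) (ruleD_shift _ hrule)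
  rw [suppP_shift] at hP
  rw [suppN_shift] at hN
  refine ⟨fun x hx => ?_, fun y hy => ?_⟩
  · have := hP (shiftCell (14 - h) x) (List.mem_map.mpr ⟨x, hx, rfl⟩)
    rwa [isBHook_shift] at this
  · have := hN (shiftCell (14 - h) y) (List.mem_map.mpr ⟨y, hy, rfl⟩)
    rwa [isBHook_shift] at this

/-- the two mass equations and the divisibility digits at every height -/
theorem massLaws_allHeights {h : ℤ} {D : Design} (hD : D.OnAlphabet h) (hR : Ring2 D) (hdisj : Disj D) (hrule : RuleD D)
    (h1 : D.A1) : mPB D = 0 ∧ mPHuuD D = 4 * mPHHDD D ∧ 6 * (massU4 D - mPU4 D) = 12 * mPA D - mPHuuD D ∧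
      (3 : ℤ) ∣ mPHHDD D ∧ (12 : ℤ) ∣ mPHuuD D ∧ (2 : ℤ) ∣ massU4 D - mPU4 D := by
  have hA := onAlphabet14_of_shift hD hR
  have hR' := ring2_shift (14 - h) hR
  have hd' := disj_shift (14 - h) hdisj
  have hr' := ruleD_shift (14 - h) hrule
  have h1' := a1_shiftD (14 - h) D h1
  have e0 := mPB_eq_zero hA hR' hd' hr' h1'
  have e1 := huuD_law hA hR' hd' hr' h1'
  have e2 := unit4_balance hA hR' hd' hr' h1'
  have e3 := divisibility hA hR' hd' hr' h1'
  rw [mPB_shiftD] at e0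
  rw [mPHuuD_shiftD, mPHHDD_shiftD] at e1
  rw [massU4_shiftD, mPU4_shiftD, mPA_shiftD, mPHuuD_shiftD] at e2
  rw [mPHHDD_shiftD, mPHuuD_shiftD, massU4_shiftD, mPU4_shiftD] at e3
  exact ⟨e0, e1, e2, e3⟩

/-! ## §10 THE COMPLETE E-FREE CONTENT OF (A1) ON THE LAW-F ROOM: five integer identities (v4)

Signed shape masses `s(h,u,a,d) := m_N − m_P` summed over the cells with `h` hubs, `u` units, `a` axis floors, `d` diagonal floors
(`sMass h u a d`).  The six e-free rows have rank 5 on the 16 room types, and the SATURATED integer lattice `Λ⊥ = rowspace ∩ ℤ¹⁶`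
(`work/congr2.py`: `ker_ℤ ker_ℤ`) has the ℤ-basis I1–I5; every exact linear law and every congruence law of the room's type masses that
follows from the e-free part of (A1) is an integer combination of these five (`Λ⊥` is a direct summand of `ℤ¹⁶`, so the laws mod `p` are
`Λ⊥ mod p`):
* I1: `−2·s(HHuD) − 4·s(HHAD) + 3·s(Huuu) + 6·s(HuuA) + 12·s(u⁴) + 21·s(uuuA) = 0`
* I2: `s(HuuD) − 6·s(u⁴) − 12·s(uuuA) = 0`  (= `unit4_balance`)
* I3: `−3·s(HHHD) + s(HHuu) + 2·s(HHuA) − s(HHuD) + 4·s(HHAA) + s(HHAD) + 3·s(Huuu) + 5·s(HuuA) + 15·s(u⁴) + 27·s(uuuA) = 0`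
* I4: `−2·s(HHDD) + 3·s(u⁴) + 6·s(uuuA) = 0`  (= `unit4_balance'`)
* I5: `s(uuuD) = 0`  (with `no_bhook_N`: B-hook exclusion)
(P-only shapes have `s = −m_P`: HHAA, HHAD, HHDD, HuuA, HuuD, uuuA, uuuD.)  Readable congruences (`efree_congruences`): mod 2 —
`s(Huuu) ≡ m_P(A-hooks)`, `s(HHHD) + s(HHuu) + s(HHuD) + m_P(HHAD) + m_P(HuuA) ≡ 0`, `m_N(u⁴) ≡ m_P(u⁴)`; `4 ∣ m_P(HuuD)`; mod 3 —
`3 ∣ m_P(HHDD)`, `s(HHuD) ≡ 2·m_P(HHAD)`, `s(HHuu) + 2·s(HHuA) ≡ m_P(HHAA) + 2·m_P(HuuA)`.  Multipliers (`work/basis5.py`, verified over the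
ordered tuples and below by `decide`): `Γ_I1 = (−8596, 1818, −84, −44, 3, 0)` (`G = 2·I1`), `Γ_I2 = (8036, −1736, 83, 42, −3, 0)` (`2·I2`),
`Γ_I3 = (−32534, 7000, −333, −169, 12, 0)` (`4·I3`), `Γ_I4 = (−10584, 2296, −111, −55, 4, 0)` (`4·I4`), `Γ_I5 = (2744, −588, 28, 14, −1, 0)` (`6·I5`).
Every height. -/

/-- shape indicator `(#hubs, #units, #axis floors, #diagonal floors)` of a cell, and the same on class tuples -/
def shapeC (h u a d : ℕ) (c : Cell) : ℤ :=
  if cntHubC c = h ∧ cntUnitC c = u ∧ cntAxFlC c = a ∧ cntDiagC c = d then 1 else 0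
def shapeK (h u a d : ℕ) (k0 k1 k2 k3 : LC) : ℤ :=
  if cntH k0 k1 k2 k3 = h ∧ cntU k0 k1 k2 k3 = u ∧ cntAx k0 k1 k2 k3 = a ∧ cntDg k0 k1 k2 k3 = d then 1 else 0

theorem shapeK_cell {c : Cell} (hc : ∀ f : Fin 4, c f ∈ R2) (h u a d : ℕ) :
    shapeK h u a d (K c 0) (K c 1) (K c 2) (K c 3) = shapeC h u a d c := by
  obtain ⟨h1, h2, h3, h4⟩ := cnt_bridge hc
  simp only [shapeK, shapeC, h1, h2, h3, h4]

theorem shapeC_shift (t : ℤ) (h u a d : ℕ) (c : Cell) : shapeC h u a d (shiftCell t c) = shapeC h u a d c := rfl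

/-- **signed shape mass** `s(h,u,a,d) = m_N − m_P` over the cells of that shape -/
def sMass (h u a d : ℕ) (D : Design) : ℤ := linZ D.N (shapeC h u a d) - linZ D.P (shapeC h u a d)

/-- a linear form in the shape indicators: a list of `(coefficient, h, u, a, d)` -/
abbrev Form := List (ℤ × ℕ × ℕ × ℕ × ℕ)

def formC (L : Form) (c : Cell) : ℤ := (L.map fun e => e.1 * shapeC e.2.1 e.2.2.1 e.2.2.2.1 e.2.2.2.2 c).sum
def formK (L : Form) (k0 k1 k2 k3 : LC) : ℤ := (L.map fun e => e.1 * shapeK e.2.1 e.2.2.1 e.2.2.2.1 e.2.2.2.2 k0 k1 k2 k3).sum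
/-- the value of the form on a design: `Σ coefficient · s(h,u,a,d)` -/
def formMass (L : Form) (D : Design) : ℤ := (L.map fun e => e.1 * sMass e.2.1 e.2.2.1 e.2.2.2.1 e.2.2.2.2 D).sum

theorem formK_cell {c : Cell} (hc : ∀ f : Fin 4, c f ∈ R2) (L : Form) :
    formK L (K c 0) (K c 1) (K c 2) (K c 3) = formC L c := by
  unfold formK formC
  simp only [shapeK_cell hc]

theorem linZ_zero (X : List (Cell × ℕ)) : linZ X (fun _ => (0 : ℤ)) = 0 := by
  induction X with
  | nil => simp [linZ]
  | cons a t ih => rw [linZ_cons, ih]; ring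

theorem linZ_formC (X : List (Cell × ℕ)) (L : Form) :
    linZ X (formC L) = (L.map fun e => e.1 * linZ X (shapeC e.2.1 e.2.2.1 e.2.2.2.1 e.2.2.2.2)).sum := by
  induction L with
  | nil =>
    have hf : formC [] = fun _ => (0 : ℤ) := by funext c; simp [formC]
    rw [hf, linZ_zero]; simp
  | cons e L ih =>
    have hf : formC (e :: L) = fun c => e.1 * shapeC e.2.1 e.2.2.1 e.2.2.2.1 e.2.2.2.2 c + formC L c := by
      funext c; simp [formC]
    rw [hf, linZ_add, linZ_smul, ih, List.map_cons, List.sum_cons]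

theorem formMass_eq (L : Form) (D : Design) : formMass L D = linZ D.N (formC L) - linZ D.P (formC L) := by
  rw [linZ_formC, linZ_formC]
  unfold formMass sMass
  induction L with
  | nil => simp
  | cons e L ih => simp only [List.map_cons, List.sum_cons]; rw [ih]; ring

theorem panatW_of_nanat {k0 k1 k2 k3 : LC} (h : NAnat k0 k1 k2 k3) : PAnatW k0 k1 k2 k3 :=
  ⟨by have := h.1; omega, fun h2 => by have := h.1; omega⟩

/-- **THE GENERIC E-FREE LAW**: a multiplier whose class value is `c·form` on the weak P-anatomy (⊇ N-anatomy) forces `form = 0`. -/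
theorem efree_law (Γ : Coefs) (cΓ : ℤ) (hcΓ : cΓ ≠ 0) (L : Form)
    (hk : ∀ k0 k1 k2 k3 : LC, PAnatW k0 k1 k2 k3 → GP Γ k0 k1 k2 k3 = cΓ * formK L k0 k1 k2 k3)
    {D : Design} (hD : D.OnAlphabet 14) (hR : Ring2 D) (hdisj : Disj D) (hrule : RuleD D) (h1 : D.A1) : formMass L D = 0 := by
  have hN : ∀ cm ∈ D.N, 0 < cm.2 → Gcell Γ cm.1 = cΓ * formC L cm.1 := by
    intro cm hcm hpos
    have hmem : cm.1 ∈ D.suppN := (mem_suppN_iff D cm.1).mpr ⟨cm.2, hcm, hpos⟩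
    have hc := fun f => memR2_of_supp hD hR (mem_supp_of_memN D hmem) f
    rw [Gcell_eq_GP Γ hc, ← formK_cell hc]
    exact hk _ _ _ _ (panatW_of_nanat (nanat_of_suppN hD hR hdisj hrule hmem))
  have hP : ∀ cm ∈ D.P, 0 < cm.2 → Gcell Γ cm.1 = cΓ * formC L cm.1 := by
    intro cm hcm hpos
    have hmem : cm.1 ∈ D.suppP := (mem_suppP_iff D cm.1).mpr ⟨cm.2, hcm, hpos⟩
    have hc := fun f => memR2_of_supp hD hR (mem_supp_of_memP D hmem) f
    rw [Gcell_eq_GP Γ hc, ← formK_cell hc]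
    exact hk _ _ _ _ (panatW_of_suppP hD hR hdisj hrule hmem)
  have eN := linZ_congr' D.N (Gcell Γ) (fun c => cΓ * formC L c) hN
  have eP := linZ_congr' D.P (Gcell Γ) (fun c => cΓ * formC L c) hP
  rw [linZ_smul] at eN eP
  have hv := G_vanishes D h1 Γ
  rw [eN, eP] at hv
  rw [formMass_eq]
  have hm : cΓ * (linZ D.N (formC L) - linZ D.P (formC L)) = 0 := by linarith
  rcases mul_eq_zero.mp hm with h | h
  · exact absurd h hcΓ
  · exact h

/-- the five basis forms and their multipliers -/
def FI1 : Form := [(-2, 2, 1, 0, 1), (-4, 2, 0, 1, 1), (3, 1, 3, 0, 0), (6, 1, 2, 1, 0), (12, 0, 4, 0, 0), (21, 0, 3, 1, 0)]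
def FI2 : Form := [(1, 1, 2, 0, 1), (-6, 0, 4, 0, 0), (-12, 0, 3, 1, 0)]
def FI3 : Form := [(-3, 3, 0, 0, 1), (1, 2, 2, 0, 0), (2, 2, 1, 1, 0), (-1, 2, 1, 0, 1), (4, 2, 0, 2, 0), (1, 2, 0, 1, 1), (3, 1, 3, 0, 0),
  (5, 1, 2, 1, 0), (15, 0, 4, 0, 0), (27, 0, 3, 1, 0)]
def FI4 : Form := [(-2, 2, 0, 0, 2), (3, 0, 4, 0, 0), (6, 0, 3, 1, 0)]
def FI5 : Form := [(1, 0, 3, 0, 1)]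
def ΓI1 : Coefs := ⟨-8596, 1818, -84, -44, 3, 0⟩
def ΓI2 : Coefs := ⟨8036, -1736, 83, 42, -3, 0⟩
def ΓI3 : Coefs := ⟨-32534, 7000, -333, -169, 12, 0⟩
def ΓI4 : Coefs := ⟨-10584, 2296, -111, -55, 4, 0⟩
def ΓI5 : Coefs := ⟨2744, -588, 28, 14, -1, 0⟩

def okBasis : Bool :=
  allLC fun k0 => allLC fun k1 => allLC fun k2 => allLC fun k3 =>
    decide (PAnatW k0 k1 k2 k3 → GP ΓI1 k0 k1 k2 k3 = 2 * formK FI1 k0 k1 k2 k3 ∧ GP ΓI2 k0 k1 k2 k3 = 2 * formK FI2 k0 k1 k2 k3 ∧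
      GP ΓI3 k0 k1 k2 k3 = 4 * formK FI3 k0 k1 k2 k3 ∧ GP ΓI4 k0 k1 k2 k3 = 4 * formK FI4 k0 k1 k2 k3 ∧
      GP ΓI5 k0 k1 k2 k3 = 6 * formK FI5 k0 k1 k2 k3)

theorem okBasis_true : okBasis = true := by decide

theorem okBasis_spec (k0 k1 k2 k3 : LC) (hk : PAnatW k0 k1 k2 k3) :
    GP ΓI1 k0 k1 k2 k3 = 2 * formK FI1 k0 k1 k2 k3 ∧ GP ΓI2 k0 k1 k2 k3 = 2 * formK FI2 k0 k1 k2 k3 ∧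
      GP ΓI3 k0 k1 k2 k3 = 4 * formK FI3 k0 k1 k2 k3 ∧ GP ΓI4 k0 k1 k2 k3 = 4 * formK FI4 k0 k1 k2 k3 ∧
      GP ΓI5 k0 k1 k2 k3 = 6 * formK FI5 k0 k1 k2 k3 :=
  of_decide_eq_true (allLC_spec _ (allLC_spec _ (allLC_spec _ (allLC_spec _ okBasis_true k0) k1) k2) k3) hk

/-- **THE FIVE BASIS IDENTITIES I1–I5** (as forms). -/
theorem efree_basis {D : Design} (hD : D.OnAlphabet 14) (hR : Ring2 D) (hdisj : Disj D) (hrule : RuleD D) (h1 : D.A1) :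
    formMass FI1 D = 0 ∧ formMass FI2 D = 0 ∧ formMass FI3 D = 0 ∧ formMass FI4 D = 0 ∧ formMass FI5 D = 0 :=
  ⟨efree_law ΓI1 2 (by norm_num) FI1 (fun _ _ _ _ hk => (okBasis_spec _ _ _ _ hk).1) hD hR hdisj hrule h1,
   efree_law ΓI2 2 (by norm_num) FI2 (fun _ _ _ _ hk => (okBasis_spec _ _ _ _ hk).2.1) hD hR hdisj hrule h1,
   efree_law ΓI3 4 (by norm_num) FI3 (fun _ _ _ _ hk => (okBasis_spec _ _ _ _ hk).2.2.1) hD hR hdisj hrule h1,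
   efree_law ΓI4 4 (by norm_num) FI4 (fun _ _ _ _ hk => (okBasis_spec _ _ _ _ hk).2.2.2.1) hD hR hdisj hrule h1,
   efree_law ΓI5 6 (by norm_num) FI5 (fun _ _ _ _ hk => (okBasis_spec _ _ _ _ hk).2.2.2.2) hD hR hdisj hrule h1⟩

/-- **I1–I5 WRITTEN OUT** in the signed shape masses `s(h,u,a,d) = sMass h u a d`. -/
theorem efree_identities {D : Design} (hD : D.OnAlphabet 14) (hR : Ring2 D) (hdisj : Disj D) (hrule : RuleD D) (h1 : D.A1) :
    (-2 * sMass 2 1 0 1 D + -4 * sMass 2 0 1 1 D + 3 * sMass 1 3 0 0 D + 6 * sMass 1 2 1 0 D + 12 * sMass 0 4 0 0 D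
        + 21 * sMass 0 3 1 0 D = 0) ∧
    (1 * sMass 1 2 0 1 D + -6 * sMass 0 4 0 0 D + -12 * sMass 0 3 1 0 D = 0) ∧
    (-3 * sMass 3 0 0 1 D + 1 * sMass 2 2 0 0 D + 2 * sMass 2 1 1 0 D + -1 * sMass 2 1 0 1 D + 4 * sMass 2 0 2 0 D
        + 1 * sMass 2 0 1 1 D + 3 * sMass 1 3 0 0 D + 5 * sMass 1 2 1 0 D + 15 * sMass 0 4 0 0 D + 27 * sMass 0 3 1 0 D = 0) ∧
    (-2 * sMass 2 0 0 2 D + 3 * sMass 0 4 0 0 D + 6 * sMass 0 3 1 0 D = 0) ∧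
    (1 * sMass 0 3 0 1 D = 0) := by
  obtain ⟨e1, e2, e3, e4, e5⟩ := efree_basis hD hR hdisj hrule h1
  simp only [formMass, FI1, FI2, FI3, FI4, FI5, List.map_cons, List.map_nil, List.sum_cons, List.sum_nil, add_zero] at e1 e2 e3 e4 e5
  refine ⟨?_, ?_, ?_, ?_, ?_⟩ <;> linarith

/-- **THE CONGRUENCE LAWS** (all of `Λ⊥ mod 2, 3, 4` in readable form). -/
theorem efree_congruences {D : Design} (hD : D.OnAlphabet 14) (hR : Ring2 D) (hdisj : Disj D) (hrule : RuleD D) (h1 : D.A1) :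
    (2 : ℤ) ∣ sMass 1 3 0 0 D + sMass 0 3 1 0 D ∧
    (2 : ℤ) ∣ sMass 3 0 0 1 D + sMass 2 2 0 0 D + sMass 2 1 0 1 D + sMass 2 0 1 1 D + sMass 1 2 1 0 D ∧
    (2 : ℤ) ∣ sMass 0 4 0 0 D ∧ (4 : ℤ) ∣ sMass 1 2 0 1 D ∧ (3 : ℤ) ∣ sMass 2 0 0 2 D ∧
    (3 : ℤ) ∣ sMass 2 1 0 1 D + 2 * sMass 2 0 1 1 D ∧
    (3 : ℤ) ∣ sMass 2 2 0 0 D + 2 * sMass 2 1 1 0 D + sMass 2 0 2 0 D + 2 * sMass 1 2 1 0 D ∧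
    sMass 0 3 0 1 D = 0 := by
  obtain ⟨e1, e2, e3, e4, e5⟩ := efree_identities hD hR hdisj hrule h1
  refine ⟨?_, ?_, ?_, ?_, ?_, ?_, ?_, ?_⟩ <;> omega

/-! ### §10b  every height -/

theorem massN_shiftD (t : ℤ) (D : Design) (ψ : Cell → ℤ) (hψ : ∀ c, ψ (shiftCell t c) = ψ c) :
    linZ (shiftD t D).N ψ = linZ D.N ψ := by
  show linZ ((D.N.map fun cm => (shiftCell t cm.1, cm.2))) ψ = linZ D.N ψ
  rw [linZ_map]
  simp [hψ]

theorem sMass_shiftD (t : ℤ) (h u a d : ℕ) (D : Design) : sMass h u a d (shiftD t D) = sMass h u a d D := by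
  unfold sMass
  rw [massN_shiftD t D _ (shapeC_shift t h u a d), massP_shiftD t D _ (shapeC_shift t h u a d)]

theorem formMass_shiftD (t : ℤ) (L : Form) (D : Design) : formMass L (shiftD t D) = formMass L D := by
  unfold formMass
  simp only [sMass_shiftD]

theorem efree_basis_allHeights {h : ℤ} {D : Design} (hD : D.OnAlphabet h) (hR : Ring2 D) (hdisj : Disj D) (hrule : RuleD D)
    (h1 : D.A1) : formMass FI1 D = 0 ∧ formMass FI2 D = 0 ∧ formMass FI3 D = 0 ∧ formMass FI4 D = 0 ∧ formMass FI5 D = 0 := by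
  have e := efree_basis (onAlphabet14_of_shift hD hR) (ring2_shift (14 - h) hR) (disj_shift (14 - h) hdisj)
    (ruleD_shift (14 - h) hrule) (a1_shiftD (14 - h) D h1)
  simp only [formMass_shiftD] at e
  exact e

theorem efree_congruences_allHeights {h : ℤ} {D : Design} (hD : D.OnAlphabet h) (hR : Ring2 D) (hdisj : Disj D)
    (hrule : RuleD D) (h1 : D.A1) :
    (2 : ℤ) ∣ sMass 1 3 0 0 D + sMass 0 3 1 0 D ∧
    (2 : ℤ) ∣ sMass 3 0 0 1 D + sMass 2 2 0 0 D + sMass 2 1 0 1 D + sMass 2 0 1 1 D + sMass 1 2 1 0 D ∧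
    (2 : ℤ) ∣ sMass 0 4 0 0 D ∧ (4 : ℤ) ∣ sMass 1 2 0 1 D ∧ (3 : ℤ) ∣ sMass 2 0 0 2 D ∧
    (3 : ℤ) ∣ sMass 2 1 0 1 D + 2 * sMass 2 0 1 1 D ∧
    (3 : ℤ) ∣ sMass 2 2 0 0 D + 2 * sMass 2 1 1 0 D + sMass 2 0 2 0 D + 2 * sMass 1 2 1 0 D ∧
    sMass 0 3 0 1 D = 0 := by
  have e := efree_congruences (onAlphabet14_of_shift hD hR) (ring2_shift (14 - h) hR) (disj_shift (14 - h) hdisj)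
    (ruleD_shift (14 - h) hrule) (a1_shiftD (14 - h) D h1)
  simp only [sMass_shiftD] at e
  exact e

/-! ## §11 APPENDIX CI — monad-1's CHARGE IDEAL LAW, inlined (v5)

VERBATIM COPY of §0–§6 of hsemireg-monad-1 g14's KERNEL file `Cruxes/BlochSeedDiscOne/ChargeIdealLaw.lean` (tree sha16 `9863862320777d61`;
`charge_ideal_law (h) (D) : D.OnAlphabet h → A1e D → 16 ∣ Re μ ∧ 16 ∣ Im μ ∧ 32 ∣ Re μ + Im μ`, pen proof, imports `DepthBoundA4` only),
placed in the sub-namespace `CI` because `ChargeIdealLaw` is not yet importable on the farm (unbuilt at the time of writing; director-hodge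
R19.660 (1b) asked for the import).  Credit: monad-1 g14 (and anomaly g15 THEOREM D8 for the ring-2 computation).  DELETE this appendix and
`import …ChargeIdealLaw` instead as soon as it builds; nothing below depends on the copy except `parityCoupled_of_A1`. -/

namespace CI
open Summit.HodgeConjecture.HodgeConjecture.Cruxes.BlochSeedDiscOne.DepthBoundA4

/-! ## §0 Clause 1 of (A1) -/

/-- CLAUSE 1 of the tree's `Design.A1`: every e-mixed word other than `eeee` ∕ `ēēēē` has tensor coefficient `0`. -/
def A1e (D : Design) : Prop :=
  ∀ w : Word, ¬ w.efree → w ≠ Word.eeee → w ≠ Word.EEEE → D.T w = 0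

theorem a1e_of_a1 (D : Design) (h : D.A1) : A1e D := h.1

/-! ## §1 Weight tables and the multilinear expansion -/

/-- A weight table: one Gaussian weight per (factor, symbol). -/
abbrev Tab := Fin 4 → Sym → GaussianInt

/-- Word weight `λ_w = ∏_f L f (w f)`. -/
def lamW (L : Tab) (w : Word) : GaussianInt := ∏ f : Fin 4, L f (w f)

/-- Letter functional `G_f(ℓ) = Σ_s L f s · coef s ℓ`. -/
def G (L : Tab) (f : Fin 4) (ℓ : Letter) : GaussianInt := ∑ s : Sym, L f s * s.coef ℓ

/-- Per-cell expansion: `Σ_w λ_w · cellCoef c w = ∏_f G_f(c_f)`. -/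
theorem cell_expand (L : Tab) (c : Cell) :
    ∑ w : Word, lamW L w * cellCoef c w = ∏ f : Fin 4, G L f (c f) := by
  unfold G
  rw [Finset.prod_univ_sum, Fintype.piFinset_univ]
  refine Finset.sum_congr rfl fun w _ => ?_
  unfold lamW cellCoef
  rw [← Finset.prod_mul_distrib]

/-- Weighted list sum `Σ m · φ(cell)`. -/
def wsum (Lst : List (Cell × ℕ)) (φ : Cell → GaussianInt) : GaussianInt :=
  (Lst.map fun cm => (cm.2 : GaussianInt) * φ cm.1).sum

theorem wsum_nil (φ : Cell → GaussianInt) : wsum [] φ = 0 := by simp [wsum]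

theorem wsum_cons (a : Cell × ℕ) (t : List (Cell × ℕ)) (φ : Cell → GaussianInt) :
    wsum (a :: t) φ = (a.2 : GaussianInt) * φ a.1 + wsum t φ := by simp [wsum]

theorem T_eq_wsum (D : Design) (w : Word) :
    D.T w = wsum D.N (fun c => cellCoef c w) - wsum D.P (fun c => cellCoef c w) := rfl

theorem sum_mul_wsum (Lst : List (Cell × ℕ)) (a : Word → GaussianInt) (φ : Word → Cell → GaussianInt) :
    ∑ w : Word, a w * wsum Lst (φ w) = wsum Lst (fun c => ∑ w : Word, a w * φ w c) := by
  induction Lst with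
  | nil => simp [wsum_nil]
  | cons hd tl ih =>
    simp only [wsum_cons, mul_add, Finset.sum_add_distrib, ih, Finset.mul_sum]
    congr 1
    exact Finset.sum_congr rfl fun w _ => by ring

/-- THE EXPANSION: `Σ_w λ_w T(D)(w) = Σ_N m ∏_f G_f − Σ_P m ∏_f G_f`. -/
theorem expand (L : Tab) (D : Design) :
    ∑ w : Word, lamW L w * D.T w
      = wsum D.N (fun c => ∏ f : Fin 4, G L f (c f)) - wsum D.P (fun c => ∏ f : Fin 4, G L f (c f)) := by
  simp only [T_eq_wsum, mul_sub, Finset.sum_sub_distrib]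
  rw [sum_mul_wsum, sum_mul_wsum]
  simp only [cell_expand]

/-! ## §2 Collapse of the word side under clause 1 -/

/-- A table kills the e-free words. -/
def KillsEfree (L : Tab) : Prop := ∀ w : Word, w.efree → lamW L w = 0

theorem eeee_ne_EEEE : Word.eeee ≠ Word.EEEE := by decide

theorem collapse (L : Tab) (D : Design) (hK : KillsEfree L) (hA : A1e D) :
    ∑ w : Word, lamW L w * D.T w
      = lamW L Word.eeee * D.T Word.eeee + lamW L Word.EEEE * D.T Word.EEEE := by
  have key : ∀ w : Word, lamW L w * D.T w =
      (if w = Word.eeee then lamW L Word.eeee * D.T Word.eeee else 0) +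
      (if w = Word.EEEE then lamW L Word.EEEE * D.T Word.EEEE else 0) := by
    intro w
    by_cases h1 : w = Word.eeee
    · subst h1
      simp [eeee_ne_EEEE]
    by_cases h2 : w = Word.EEEE
    · subst h2
      simp [eeee_ne_EEEE.symm]
    by_cases he : w.efree
    · simp [h1, h2, hK w he]
    · simp [h1, h2, hA w he h1 h2]
  rw [Finset.sum_congr rfl fun w _ => key w, Finset.sum_add_distrib, Finset.sum_ite_eq', Finset.sum_ite_eq']
  simp

/-! ## §3 The three letter functionals -/

/-- `g`: `one ↦ 2h`, `h ↦ 2`, `e ↦ 1+i`, `ē ↦ 1−i`, `pt ↦ 0` — reads `2(h + a + x + y)`. -/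
def tg (h : ℤ) : Sym → GaussianInt
  | Sym.one => 2 * (h : GaussianInt)
  | Sym.h => 2
  | Sym.e => ⟨1, 1⟩
  | Sym.ebar => ⟨1, -1⟩
  | Sym.pt => 0

/-- `X₂`: `e ↦ 1`, `ē ↦ 1` — reads `2x`. -/
def tX : Sym → GaussianInt
  | Sym.e => 1
  | Sym.ebar => 1
  | Sym.one => 0
  | Sym.h => 0
  | Sym.pt => 0

/-- `Y₂`: `e ↦ i`, `ē ↦ −i` — reads `2y`. -/
def tY : Sym → GaussianInt
  | Sym.e => ⟨0, 1⟩
  | Sym.ebar => ⟨0, -1⟩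
  | Sym.one => 0
  | Sym.h => 0
  | Sym.pt => 0

theorem univ_sym : (Finset.univ : Finset Sym) = {Sym.one, Sym.h, Sym.e, Sym.ebar, Sym.pt} := by decide

theorem sum_sym (φ : Sym → GaussianInt) :
    ∑ s : Sym, φ s = φ Sym.one + φ Sym.h + φ Sym.e + φ Sym.ebar + φ Sym.pt := by
  rw [univ_sym, Finset.sum_insert (by decide), Finset.sum_insert (by decide), Finset.sum_insert (by decide),
    Finset.sum_insert (by decide), Finset.sum_singleton]
  ring

theorem read_tg (h : ℤ) (ℓ : Letter) :
    ∑ s : Sym, tg h s * s.coef ℓ = ((2 * (h + ℓ.a + ℓ.x + ℓ.y) : ℤ) : GaussianInt) := by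
  rw [sum_sym]
  ext <;> simp [tg, Sym.coef, Letter.beta, Zsqrtd.re_mul, Zsqrtd.im_mul] <;> ring

theorem read_tX (ℓ : Letter) : ∑ s : Sym, tX s * s.coef ℓ = ((2 * ℓ.x : ℤ) : GaussianInt) := by
  rw [sum_sym]
  ext
  · simp [tX, Sym.coef, Letter.beta]; ring
  · simp [tX, Sym.coef, Letter.beta]

theorem read_tY (ℓ : Letter) : ∑ s : Sym, tY s * s.coef ℓ = ((2 * ℓ.y : ℤ) : GaussianInt) := by
  rw [sum_sym]
  ext
  · simp [tY, Sym.coef, Letter.beta, Zsqrtd.re_mul]; ring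
  · simp [tY, Sym.coef, Letter.beta, Zsqrtd.im_mul]

/-- Parity on the height-`h` alphabet: `h + a + x + y` is even. -/
theorem even_of_onAlphabet {h : ℤ} {ℓ : Letter} (hℓ : ℓ.OnAlphabet h) : (2 : ℤ) ∣ h + ℓ.a + ℓ.x + ℓ.y := by
  obtain ⟨hh, _⟩ := hℓ
  unfold Letter.height at hh
  rcases abs_cases ℓ.x with ⟨hx, _⟩ | ⟨hx, _⟩ <;> rcases abs_cases ℓ.y with ⟨hy, _⟩ | ⟨hy, _⟩ <;>
    · rw [hx, hy] at hh; omega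

theorem four_dvd_tg {h : ℤ} {ℓ : Letter} (hℓ : ℓ.OnAlphabet h) :
    ((4 : ℤ) : GaussianInt) ∣ ∑ s : Sym, tg h s * s.coef ℓ := by
  rw [read_tg]
  obtain ⟨k, hk⟩ := even_of_onAlphabet hℓ
  exact ⟨(k : GaussianInt), by rw [hk]; push_cast; ring⟩

theorem two_dvd_tX (ℓ : Letter) : ((2 : ℤ) : GaussianInt) ∣ ∑ s : Sym, tX s * s.coef ℓ := by
  rw [read_tX]
  exact ⟨(ℓ.x : GaussianInt), by push_cast; ring⟩

theorem two_dvd_tY (ℓ : Letter) : ((2 : ℤ) : GaussianInt) ∣ ∑ s : Sym, tY s * s.coef ℓ := by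
  rw [read_tY]
  exact ⟨(ℓ.y : GaussianInt), by push_cast; ring⟩

/-! ## §4 The three tables -/

/-- `(g, g, X₂, X₂)`. -/
def L1 (h : ℤ) : Tab := fun f => if f = 0 ∨ f = 1 then tg h else tX
/-- `(g, g, X₂, Y₂)`. -/
def L2 (h : ℤ) : Tab := fun f => if f = 0 ∨ f = 1 then tg h else if f = 2 then tX else tY
/-- `(g, g, g, X₂)`. -/
def L3 (h : ℤ) : Tab := fun f => if f = 3 then tX else tg h

theorem tX_efree (s : Sym) (hs : s.efree = true) : tX s = 0 := by
  cases s <;> simp [Sym.efree] at hs <;> rfl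

theorem kills_of_three (L : Tab) (h3 : L 3 = tX) : KillsEfree L := by
  intro w hw
  unfold lamW
  apply Finset.prod_eq_zero (Finset.mem_univ (3 : Fin 4))
  rw [h3]
  exact tX_efree (w 3) (hw 3)

theorem kills_L1 (h : ℤ) : KillsEfree (L1 h) := kills_of_three _ (by simp [L1])
theorem kills_L2' (h : ℤ) : (L2 h) 3 = tY := by simp [L2]
theorem kills_L3 (h : ℤ) : KillsEfree (L3 h) := kills_of_three _ (by simp [L3])

theorem tY_efree (s : Sym) (hs : s.efree = true) : tY s = 0 := by
  cases s <;> simp [Sym.efree] at hs <;> rfl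

theorem kills_L2 (h : ℤ) : KillsEfree (L2 h) := by
  intro w hw
  unfold lamW
  apply Finset.prod_eq_zero (Finset.mem_univ (3 : Fin 4))
  rw [kills_L2']
  exact tY_efree (w 3) (hw 3)

/-- word weights at `eeee` ∕ `ēēēē`. -/
theorem lamW_L1_eeee (h : ℤ) : lamW (L1 h) Word.eeee = ⟨0, 2⟩ := by
  ext <;> simp [lamW, Fin.prod_univ_four, L1, tg, tX, Word.eeee, Zsqrtd.re_mul, Zsqrtd.im_mul]
theorem lamW_L1_EEEE (h : ℤ) : lamW (L1 h) Word.EEEE = ⟨0, -2⟩ := by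
  ext <;> simp [lamW, Fin.prod_univ_four, L1, tg, tX, Word.EEEE, Zsqrtd.re_mul, Zsqrtd.im_mul]
theorem lamW_L2_eeee (h : ℤ) : lamW (L2 h) Word.eeee = ⟨-2, 0⟩ := by
  ext <;> simp [lamW, Fin.prod_univ_four, L2, tg, tX, tY, Word.eeee, Zsqrtd.re_mul, Zsqrtd.im_mul]
theorem lamW_L2_EEEE (h : ℤ) : lamW (L2 h) Word.EEEE = ⟨-2, 0⟩ := by
  ext <;> simp [lamW, Fin.prod_univ_four, L2, tg, tX, tY, Word.EEEE, Zsqrtd.re_mul, Zsqrtd.im_mul]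
theorem lamW_L3_eeee (h : ℤ) : lamW (L3 h) Word.eeee = ⟨-2, 2⟩ := by
  ext <;> simp [lamW, Fin.prod_univ_four, L3, tg, tX, Word.eeee, Zsqrtd.re_mul, Zsqrtd.im_mul]
theorem lamW_L3_EEEE (h : ℤ) : lamW (L3 h) Word.EEEE = ⟨-2, -2⟩ := by
  ext <;> simp [lamW, Fin.prod_univ_four, L3, tg, tX, Word.EEEE, Zsqrtd.re_mul, Zsqrtd.im_mul]

/-! ## §5 Divisibility of the cell side -/

theorem dvd_wsum (d : GaussianInt) (Lst : List (Cell × ℕ)) (φ : Cell → GaussianInt)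
    (hφ : ∀ cm ∈ Lst, 0 < cm.2 → d ∣ φ cm.1) : d ∣ wsum Lst φ := by
  unfold wsum
  apply List.dvd_sum
  intro x hx
  obtain ⟨cm, hcm, rfl⟩ := List.mem_map.mp hx
  rcases Nat.eq_zero_or_pos cm.2 with h0 | hpos
  · simp [h0]
  · exact Dvd.dvd.mul_left (hφ cm hcm hpos) _

/-- letters of positive-multiplicity N-entries are on the alphabet. -/
theorem onAlpha_N {h : ℤ} {D : Design} (hD : D.OnAlphabet h) {cm : Cell × ℕ} (hcm : cm ∈ D.N) (hpos : 0 < cm.2)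
    (f : Fin 4) : (cm.1 f).OnAlphabet h :=
  hD cm.1 (List.mem_append.mpr (Or.inl ((mem_suppN_iff D cm.1).mpr ⟨cm.2, hcm, hpos⟩))) f

theorem onAlpha_P {h : ℤ} {D : Design} (hD : D.OnAlphabet h) {cm : Cell × ℕ} (hcm : cm ∈ D.P) (hpos : 0 < cm.2)
    (f : Fin 4) : (cm.1 f).OnAlphabet h :=
  hD cm.1 (List.mem_append.mpr (Or.inr ((mem_suppP_iff D cm.1).mpr ⟨cm.2, hcm, hpos⟩))) f

theorem prod_G (L : Tab) (c : Cell) :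
    ∏ f : Fin 4, G L f (c f) = G L 0 (c 0) * G L 1 (c 1) * G L 2 (c 2) * G L 3 (c 3) := by
  rw [Fin.prod_univ_four]

theorem cell_dvd_L1 {h : ℤ} (c : Cell) (hc : ∀ f : Fin 4, (c f).OnAlphabet h) :
    ((64 : ℤ) : GaussianInt) ∣ ∏ f : Fin 4, G (L1 h) f (c f) := by
  rw [prod_G]
  have e : ((64 : ℤ) : GaussianInt) = ((4 : ℤ) : GaussianInt) * ((4 : ℤ) : GaussianInt) * ((2 : ℤ) : GaussianInt) * ((2 : ℤ) : GaussianInt) := by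
    push_cast; norm_num
  rw [e]
  refine mul_dvd_mul (mul_dvd_mul (mul_dvd_mul ?_ ?_) ?_) ?_
  · simpa [G, L1] using four_dvd_tg (hc 0)
  · simpa [G, L1] using four_dvd_tg (hc 1)
  · simpa [G, L1] using two_dvd_tX (c 2)
  · simpa [G, L1] using two_dvd_tX (c 3)

theorem cell_dvd_L2 {h : ℤ} (c : Cell) (hc : ∀ f : Fin 4, (c f).OnAlphabet h) :
    ((64 : ℤ) : GaussianInt) ∣ ∏ f : Fin 4, G (L2 h) f (c f) := by
  rw [prod_G]
  have e : ((64 : ℤ) : GaussianInt) = ((4 : ℤ) : GaussianInt) * ((4 : ℤ) : GaussianInt) * ((2 : ℤ) : GaussianInt) * ((2 : ℤ) : GaussianInt) := by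
    push_cast; norm_num
  rw [e]
  refine mul_dvd_mul (mul_dvd_mul (mul_dvd_mul ?_ ?_) ?_) ?_
  · simpa [G, L2] using four_dvd_tg (hc 0)
  · simpa [G, L2] using four_dvd_tg (hc 1)
  · simpa [G, L2] using two_dvd_tX (c 2)
  · simpa [G, L2] using two_dvd_tY (c 3)

theorem cell_dvd_L3 {h : ℤ} (c : Cell) (hc : ∀ f : Fin 4, (c f).OnAlphabet h) :
    ((128 : ℤ) : GaussianInt) ∣ ∏ f : Fin 4, G (L3 h) f (c f) := by
  rw [prod_G]
  have e : ((128 : ℤ) : GaussianInt) = ((4 : ℤ) : GaussianInt) * ((4 : ℤ) : GaussianInt) * ((4 : ℤ) : GaussianInt) * ((2 : ℤ) : GaussianInt) := by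
    push_cast; norm_num
  rw [e]
  refine mul_dvd_mul (mul_dvd_mul (mul_dvd_mul ?_ ?_) ?_) ?_
  · simpa [G, L3] using four_dvd_tg (hc 0)
  · simpa [G, L3] using four_dvd_tg (hc 1)
  · simpa [G, L3] using four_dvd_tg (hc 2)
  · simpa [G, L3] using two_dvd_tX (c 3)

/-- the design-level divisibility of `Σ_w λ_w T(w)` for a table whose cell products are all divisible by `d`. -/
theorem design_dvd {h : ℤ} (L : Tab) (d : GaussianInt) (D : Design) (hD : D.OnAlphabet h)
    (hcell : ∀ c : Cell, (∀ f : Fin 4, (c f).OnAlphabet h) → d ∣ ∏ f : Fin 4, G L f (c f)) :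
    d ∣ ∑ w : Word, lamW L w * D.T w := by
  rw [expand]
  refine dvd_sub ?_ ?_
  · exact dvd_wsum d D.N _ fun cm hcm hpos => hcell cm.1 (onAlpha_N hD hcm hpos)
  · exact dvd_wsum d D.P _ fun cm hcm hpos => hcell cm.1 (onAlpha_P hD hcm hpos)

/-! ## §6 THE LAW -/

/-- **CHARGE IDEAL LAW.**  On any height-`h` alphabet, clause 1 of (A1) forces `16 ∣ Re μ`, `16 ∣ Im μ`, `32 ∣ Re μ + Im μ`. -/
theorem charge_ideal_law (h : ℤ) (D : Design) (hD : D.OnAlphabet h) (hA : A1e D) :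
    (16 : ℤ) ∣ D.mu.re ∧ (16 : ℤ) ∣ D.mu.im ∧ (32 : ℤ) ∣ D.mu.re + D.mu.im := by
  have h1 := design_dvd (L1 h) _ D hD (fun c hc => cell_dvd_L1 c hc)
  have h2 := design_dvd (L2 h) _ D hD (fun c hc => cell_dvd_L2 c hc)
  have h3 := design_dvd (L3 h) _ D hD (fun c hc => cell_dvd_L3 c hc)
  rw [collapse _ D (kills_L1 h) hA, lamW_L1_eeee, lamW_L1_EEEE] at h1
  rw [collapse _ D (kills_L2 h) hA, lamW_L2_eeee, lamW_L2_EEEE] at h2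
  rw [collapse _ D (kills_L3 h) hA, lamW_L3_eeee, lamW_L3_EEEE] at h3
  rw [Zsqrtd.intCast_dvd] at h1 h2 h3
  obtain ⟨h1r, h1i⟩ := h1
  obtain ⟨h2r, h2i⟩ := h2
  obtain ⟨h3r, h3i⟩ := h3
  simp only [Zsqrtd.re_add, Zsqrtd.im_add, Zsqrtd.re_mul, Zsqrtd.im_mul] at h1r h1i h2r h2i h3r h3i
  unfold Design.mu
  omega

/-- The same law from the tree's full (A1). -/
theorem charge_ideal_law_of_A1 (h : ℤ) (D : Design) (hD : D.OnAlphabet h) (hA : D.A1) :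
    (16 : ℤ) ∣ D.mu.re ∧ (16 : ℤ) ∣ D.mu.im ∧ (32 : ℤ) ∣ D.mu.re + D.mu.im :=
  charge_ideal_law h D hD (a1e_of_a1 D hA)
end CI

/-! ## §12 THE CERTIFICATE FAMILY, UNCONDITIONAL (v5): `ParityCoupled` discharged by the charge ideal law, every height

`16 ∣ Re μ`, `16 ∣ Im μ`, `32 ∣ Re μ + Im μ` ⇒ `Re μ = 16t − 32·0`, `Im μ = 16t − 32b` (`parityCoupled_of_A1`).  Hence every theorem of §6–§8
holds for EVERY `OnAlphabet h ∧ Ring2 ∧ Disj ∧ RuleD ∧ (A1)` design with `μ ≠ 0` (suffix `U`): `copies ≥ 29`; `copies + 24·m_N(unit⁴) ≥ 400`;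
N ∌ unit⁴ ⇒ `copies ≥ 400`; with `HallUp`: `copies + 31·m_N(unit⁴) ≥ 512`; with `HallPlusUp 8`: `≥ 520`, N ∌ unit⁴ ⇒ `copies ≥ 520`,
`Σ_P m ≥ 8`, and THE RING-2 DOOR: `copies + rank ≤ 116 ⇒ rank ≥ 8 ∧ copies ≤ 108 ∧ Σ_N m ≤ 58 ∧ 8 ≤ Σ_P m ≤ 50 ∧ m_N(unit⁴) ≥ 14`.
And the task-line answer in kernel form: `μ ≠ 0 ⇒` one of the eight directions carries `≥ 32` (`exists_dirU`); `|Re μ| = 16 ⇒ Im μ ≡ 16 (mod 32)`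
(`im_at_re16`: Im μ is never 0 at the book's normalisation). -/

/-- **PARITY COUPLING IS A THEOREM** (charge ideal law, any height). -/
theorem parityCoupled_of_A1 {h : ℤ} {D : Design} (hD : D.OnAlphabet h) (h1 : D.A1) : ParityCoupled D := by
  obtain ⟨⟨r, hr⟩, ⟨s, hs⟩, ⟨t, ht⟩⟩ := CI.charge_ideal_law_of_A1 h D hD h1
  exact ⟨r, 0, t - s, by omega, by omega⟩

theorem exists_dirU {h : ℤ} {D : Design} (hD : D.OnAlphabet h) (h1 : D.A1) (hμ : D.mu ≠ 0) : ∃ d : Dir, 32 ≤ d.ev D.mu :=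
  exists_dir (parityCoupled_of_A1 hD h1) hμ

/-- at `|Re μ| = 16` the charge is diagonal: `Im μ ≡ 16 (mod 32)`, in particular `Im μ ≠ 0`. -/
theorem im_at_re16 {h : ℤ} {D : Design} (hD : D.OnAlphabet h) (h1 : D.A1) (hre : D.mu.re = 16 ∨ D.mu.re = -16) :
    D.mu.im % 32 = 16 := by
  obtain ⟨t, a, b, ha, hb⟩ := parityCoupled_of_A1 hD h1
  omega

theorem re_at_im16 {h : ℤ} {D : Design} (hD : D.OnAlphabet h) (h1 : D.A1) (him : D.mu.im = 16 ∨ D.mu.im = -16) :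
    D.mu.re % 32 = 16 := by
  obtain ⟨t, a, b, ha, hb⟩ := parityCoupled_of_A1 hD h1
  omega

theorem copies_ge_29U {h : ℤ} {D : Design} (hD : D.OnAlphabet h) (hR : Ring2 D) (hdisj : Disj D) (hrule : RuleD D) (h1 : D.A1)
    (hμ : D.mu ≠ 0) : 29 ≤ D.copies :=
  copies_ge_29_allHeights hD hR hdisj hrule h1 (parityCoupled_of_A1 hD h1) hμ

theorem massLawU {h : ℤ} {D : Design} (hD : D.OnAlphabet h) (hR : Ring2 D) (hdisj : Disj D) (hrule : RuleD D) (h1 : D.A1)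
    (hμ : D.mu ≠ 0) : 400 ≤ (D.copies : ℤ) + 24 * massU4 D :=
  massLaw_allHeights hD hR hdisj hrule h1 (parityCoupled_of_A1 hD h1) hμ

theorem regime_noNunit4U {h : ℤ} {D : Design} (hD : D.OnAlphabet h) (hR : Ring2 D) (hdisj : Disj D) (hrule : RuleD D) (h1 : D.A1)
    (hμ : D.mu ≠ 0) (hreg : NoNUnit4 D) : 400 ≤ D.copies :=
  regime_noNunit4_allHeights hD hR hdisj hrule h1 (parityCoupled_of_A1 hD h1) hμ hreg

theorem massLawHallU {h : ℤ} {D : Design} (hD : D.OnAlphabet h) (hR : Ring2 D) (hdisj : Disj D) (hrule : RuleD D) (h1 : D.A1)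
    (hμ : D.mu ≠ 0) (hU : HallUp D) : 512 ≤ (D.copies : ℤ) + 31 * massU4 D :=
  massLawHall_allHeights hD hR hdisj hrule h1 (parityCoupled_of_A1 hD h1) hμ hU

/-- **`copies + 31·m_N(unit⁴) ≥ 520`, UNCONDITIONAL** (every `OnAlphabet h ∧ Ring2 ∧ Disj ∧ RuleD ∧ (A1)` design with `μ ≠ 0` and PortHall₈). -/
theorem massLawHall8U {h : ℤ} {D : Design} (hD : D.OnAlphabet h) (hR : Ring2 D) (hdisj : Disj D) (hrule : RuleD D) (h1 : D.A1)
    (hμ : D.mu ≠ 0) (hU8 : HallPlusUp D 8) : 520 ≤ (D.copies : ℤ) + 31 * massU4 D :=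
  massLawHall8_allHeights hD hR hdisj hrule h1 (parityCoupled_of_A1 hD h1) hμ hU8

/-- **RING 2, REGIME N ∌ unit⁴: `copies ≥ 520`, UNCONDITIONAL.** -/
theorem regime_noNunit4_hall8U {h : ℤ} {D : Design} (hD : D.OnAlphabet h) (hR : Ring2 D) (hdisj : Disj D) (hrule : RuleD D)
    (h1 : D.A1) (hμ : D.mu ≠ 0) (hU8 : HallPlusUp D 8) (hreg : NoNUnit4 D) : 520 ≤ D.copies :=
  regime_noNunit4_hall8_allHeights hD hR hdisj hrule h1 (parityCoupled_of_A1 hD h1) hμ hU8 hreg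

theorem massU4_ge_14U {h : ℤ} {D : Design} (hD : D.OnAlphabet h) (hR : Ring2 D) (hdisj : Disj D) (hrule : RuleD D) (h1 : D.A1)
    (hμ : D.mu ≠ 0) (hU8 : HallPlusUp D 8) (hB : D.copies ≤ 116) : 14 ≤ massU4 D :=
  massU4_ge_14_allHeights hD hR hdisj hrule h1 (parityCoupled_of_A1 hD h1) hμ hU8 hB

theorem Nmass_shiftD (t : ℤ) (D : Design) : Nmass (shiftD t D) = Nmass D := by
  have c1 := copies_eq (shiftD t D)
  have r1 := rank_eq (shiftD t D)
  rw [copies_shift] at c1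
  rw [rank_shift] at r1
  have c0 := copies_eq D
  have r0 := rank_eq D
  linarith

theorem Pmass_shiftD (t : ℤ) (D : Design) : Pmass (shiftD t D) = Pmass D := by
  have c1 := copies_eq (shiftD t D)
  have r1 := rank_eq (shiftD t D)
  rw [copies_shift] at c1
  rw [rank_shift] at r1
  have c0 := copies_eq D
  have r0 := rank_eq D
  linarith

theorem pmass_ge_8_allHeights {h : ℤ} {D : Design} (hD : D.OnAlphabet h) (hR : Ring2 D) (hdisj : Disj D) (hrule : RuleD D)
    (h1 : D.A1) (hpc : ParityCoupled D) (hμ : D.mu ≠ 0) : 8 ≤ Pmass D := by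
  rw [← Pmass_shiftD (14 - h) D]
  exact pmass_ge_8 (onAlphabet14_of_shift hD hR) (ring2_shift _ hR) (disj_shift _ hdisj) (ruleD_shift _ hrule)
    (a1_shiftD _ D h1) (parityCoupled_shift _ hpc) (by rw [mu_shiftD]; exact hμ)

/-- **`Σ_P m ≥ 8`, UNCONDITIONAL.** -/
theorem pmass_ge_8U {h : ℤ} {D : Design} (hD : D.OnAlphabet h) (hR : Ring2 D) (hdisj : Disj D) (hrule : RuleD D) (h1 : D.A1)
    (hμ : D.mu ≠ 0) : 8 ≤ Pmass D :=
  pmass_ge_8_allHeights hD hR hdisj hrule h1 (parityCoupled_of_A1 hD h1) hμ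

theorem ring2_door_allHeights {h : ℤ} {D : Design} (hD : D.OnAlphabet h) (hR : Ring2 D) (hdisj : Disj D) (hrule : RuleD D)
    (h1 : D.A1) (hpc : ParityCoupled D) (hμ : D.mu ≠ 0) (hU8 : HallPlusUp D 8) (hdoor : (D.copies : ℤ) + D.rank ≤ 116) :
    8 ≤ D.rank ∧ D.copies ≤ 108 ∧ Nmass D ≤ 58 ∧ 8 ≤ Pmass D ∧ Pmass D ≤ 50 ∧ 14 ≤ massU4 D := by
  have e := ring2_door (onAlphabet14_of_shift hD hR) (ring2_shift (14 - h) hR) (disj_shift _ hdisj) (ruleD_shift _ hrule)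
    (a1_shiftD _ D h1) (parityCoupled_shift _ hpc) (by rw [mu_shiftD]; exact hμ) ((hallPlusUp_shiftD _ D 8).mpr hU8)
    (by rw [copies_shift, rank_shift]; exact hdoor)
  rw [copies_shift, rank_shift, massU4_shiftD, Nmass_shiftD, Pmass_shiftD] at e
  exact e

/-- **THE RING-2 DOOR, UNCONDITIONAL, EVERY HEIGHT**: `copies + rank ≤ 116` (the v4.2 budget, `SigmaH.copies_add_rank_le_of_budget`) and
PortHall₈ force `rank ≥ 8`, `copies ≤ 108`, `Σ_N m ≤ 58`, `8 ≤ Σ_P m ≤ 50`, `m_N(unit⁴) ≥ 14` — for every `OnAlphabet h ∧ Ring2 ∧ Disj ∧ RuleD ∧ (A1)`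
design with `μ ≠ 0`. -/
theorem ring2_doorU {h : ℤ} {D : Design} (hD : D.OnAlphabet h) (hR : Ring2 D) (hdisj : Disj D) (hrule : RuleD D) (h1 : D.A1)
    (hμ : D.mu ≠ 0) (hU8 : HallPlusUp D 8) (hdoor : (D.copies : ℤ) + D.rank ≤ 116) :
    8 ≤ D.rank ∧ D.copies ≤ 108 ∧ Nmass D ≤ 58 ∧ 8 ≤ Pmass D ∧ Pmass D ≤ 50 ∧ 14 ≤ massU4 D :=
  ring2_door_allHeights hD hR hdisj hrule h1 (parityCoupled_of_A1 hD h1) hμ hU8 hdoor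

/-- the budget functional on ring 2 is `2·Σ_N m`: `copies + rank = 2·Nmass` (so the door reads `Σ_N m ≤ 58`). -/
theorem budget_eq_two_Nmass (D : Design) : (D.copies : ℤ) + D.rank = 2 * Nmass D := by
  rw [copies_eq, rank_eq]; ring

/-! ## §13 THE DISTANCE DIGIT (v5): on every charged ring-2 design the v4.2 budget functional is `copies + rank = 2·Σ_N m ≥ 40`, and `copies ≥ 31`
— all regimes, UNCONDITIONAL, every height (type LP with the rank row: min Σ_N m = 136∕7, min copies = 216∕7; certificates `Cn`, `Cc`,
`work/certs3.py`; the LP optimum is the pseudo-design N: 16 × unit⁴ + 12∕7 (H,H,H,B) + 12∕7 (H,H,u,B), P: 8 A-hooks + 24∕7 (H,u,u,A)).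
So at TYPE level the door `copies + rank ≤ 116` is open by the factor 116∕40 in the regime N ∋ unit⁴ (and closed, `≥ 528`, in the regime N ∌ unit⁴). -/

/-- **Cn** (min `Σ_N m` with the rank row): `1613472·Σ_N m ≥ 32·662676 + 8·1267728`, i.e. `Σ_N m ≥ 136/7`. -/
def Cn : CertR := ⟨⟨0, 41722520, -5831539, -3245907, 657496, -15857⟩, 662676, 1267728, 1613472, 1613472, 0⟩

/-- **Cc** (min `copies` with the rank row): `806736·copies ≥ 32·662676 + 8·460992`, i.e. `copies ≥ 216/7`. -/
def Cc : CertR := ⟨⟨0, 41722520, -5831539, -3245907, 657496, -15857⟩, 662676, 460992, 806736, 806736, 806736⟩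

theorem okNR_Cn : okNR Cn = true := by decide
theorem okPR_Cn : okPR Cn = true := by decide
theorem okNR_Cc : okNR Cc = true := by decide
theorem okPR_Cc : okPR Cc = true := by decide

/-- `Σ_N m ≥ 20` (height 14, parity-coupled form). -/
theorem nmass_ge_20 {D : Design} (hD : D.OnAlphabet 14) (hR : Ring2 D) (hdisj : Disj D) (hrule : RuleD D) (h1 : D.A1)
    (hpc : ParityCoupled D) (hμ : D.mu ≠ 0) (hU8 : HallPlusUp D 8) : 20 ≤ Nmass D := by
  obtain ⟨d, hd⟩ := exists_dir hpc hμ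
  have hb := certR_bound Cn okNR_Cn okPR_Cn (by decide) hD hR hdisj hrule h1 d
  simp only [Cn] at hb
  have hr := eight_le_rank hD hR hdisj hrule h1 hpc hμ hU8
  linarith [massU4_nonneg D, pmass_nonneg D]

/-- `copies ≥ 31` (height 14, parity-coupled form; all regimes, with PortHall₈). -/
theorem copies_ge_31 {D : Design} (hD : D.OnAlphabet 14) (hR : Ring2 D) (hdisj : Disj D) (hrule : RuleD D) (h1 : D.A1)
    (hpc : ParityCoupled D) (hμ : D.mu ≠ 0) (hU8 : HallPlusUp D 8) : 31 ≤ D.copies := by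
  obtain ⟨d, hd⟩ := exists_dir hpc hμ
  have hb := certR_bound Cc okNR_Cc okPR_Cc (by decide) hD hR hdisj hrule h1 d
  simp only [Cc] at hb
  have hr := eight_le_rank hD hR hdisj hrule h1 hpc hμ hU8
  have hc := copies_eq D
  have : (31 : ℤ) ≤ (D.copies : ℤ) := by linarith [massU4_nonneg D]
  exact_mod_cast this

theorem nmass_ge_20_allHeights {h : ℤ} {D : Design} (hD : D.OnAlphabet h) (hR : Ring2 D) (hdisj : Disj D) (hrule : RuleD D)
    (h1 : D.A1) (hpc : ParityCoupled D) (hμ : D.mu ≠ 0) (hU8 : HallPlusUp D 8) : 20 ≤ Nmass D := by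
  rw [← Nmass_shiftD (14 - h) D]
  exact nmass_ge_20 (onAlphabet14_of_shift hD hR) (ring2_shift _ hR) (disj_shift _ hdisj) (ruleD_shift _ hrule)
    (a1_shiftD _ D h1) (parityCoupled_shift _ hpc) (by rw [mu_shiftD]; exact hμ) ((hallPlusUp_shiftD _ D 8).mpr hU8)

theorem copies_ge_31_allHeights {h : ℤ} {D : Design} (hD : D.OnAlphabet h) (hR : Ring2 D) (hdisj : Disj D) (hrule : RuleD D)
    (h1 : D.A1) (hpc : ParityCoupled D) (hμ : D.mu ≠ 0) (hU8 : HallPlusUp D 8) : 31 ≤ D.copies := by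
  rw [← copies_shift D (14 - h)]
  exact copies_ge_31 (onAlphabet14_of_shift hD hR) (ring2_shift _ hR) (disj_shift _ hdisj) (ruleD_shift _ hrule)
    (a1_shiftD _ D h1) (parityCoupled_shift _ hpc) (by rw [mu_shiftD]; exact hμ) ((hallPlusUp_shiftD _ D 8).mpr hU8)

/-- **`Σ_N m ≥ 20`, UNCONDITIONAL, every height.** -/
theorem nmass_ge_20U {h : ℤ} {D : Design} (hD : D.OnAlphabet h) (hR : Ring2 D) (hdisj : Disj D) (hrule : RuleD D) (h1 : D.A1)
    (hμ : D.mu ≠ 0) (hU8 : HallPlusUp D 8) : 20 ≤ Nmass D :=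
  nmass_ge_20_allHeights hD hR hdisj hrule h1 (parityCoupled_of_A1 hD h1) hμ hU8

/-- **`copies ≥ 31`, UNCONDITIONAL, every height** (all regimes). -/
theorem copies_ge_31U {h : ℤ} {D : Design} (hD : D.OnAlphabet h) (hR : Ring2 D) (hdisj : Disj D) (hrule : RuleD D) (h1 : D.A1)
    (hμ : D.mu ≠ 0) (hU8 : HallPlusUp D 8) : 31 ≤ D.copies :=
  copies_ge_31_allHeights hD hR hdisj hrule h1 (parityCoupled_of_A1 hD h1) hμ hU8

/-- **THE DISTANCE DIGIT: `copies + rank ≥ 40`, UNCONDITIONAL, every height** — the v4.2 budget functional of any charged ring-2 weak-arrow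
design is at least 40 (door: 116). -/
theorem budget_ge_40U {h : ℤ} {D : Design} (hD : D.OnAlphabet h) (hR : Ring2 D) (hdisj : Disj D) (hrule : RuleD D) (h1 : D.A1)
    (hμ : D.mu ≠ 0) (hU8 : HallPlusUp D 8) : 40 ≤ (D.copies : ℤ) + D.rank := by
  rw [budget_eq_two_Nmass]
  have := nmass_ge_20U hD hR hdisj hrule h1 hμ hU8
  linarith


/-! ## §14 THE CLASS LAW, THE CUBE LAW, THE LATTICE DIGITS AND THE DOOR LAW (dual g15, v6)

# RING 2 — THE CLASS LAW, THE CUBE LAW, AND THE LATTICE DIGITS OF THE B-FREE SKELETON (dual g15)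

Token: `line stmt-HodgeConjecture-18881 Cruxes/BlochSeedDiscOne/Lines/birth.lean 814a6a70c14e831a stub_rung_pad4_seedAt`.
Evidence ∕ typed file for the v4.2 ledger (Leg A, ring 2); **nothing here is proved toward HC ∕ HC_CM ∕ HC_AV ∕ №4 ∕ 26512 ∕ 18881 ∕ H2**.

THE DUAL SIDE OF (A1) CLAUSE 1, LOCALISED.  Write the sixteen fully charged words `w ∈ {e, ē}⁴` as the characters of the
position torus: for a cell all of whose letters have `β ≠ 0` the coefficient of `w_ξ` is `∏ β_f^{(±)}`.  Summing the sixteen words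
against the weight table `(X₂ or Y₂ per slot)` (monad-1's letter functionals `X₂ : e,ē ↦ 1,1` reading `2x`, `Y₂ : e,ē ↦ i,−i` reading `2y`)
collapses, under clause 1 of (A1), to `phase·μ + conj` on the word side and to the CLASS FUNCTIONAL
`16·W_p(D) = 16·(Σ_N − Σ_P) m·∏_f (x_f or y_f)` on the cell side (§2, `class_law`):

  **CLASS LAW.**  `8·W_p(D) = Re(i^{|p|}·μ)` for each of the 16 parity patterns `p : Fin 4 → Bool` (`y` read on the slots in `p`, `x` elsewhere).

Only cells whose four letters all have a non-zero class coordinate contribute: on ring 2 these are the H-free cells `unit⁴` (weight ±1),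
the A-hooks (±2) and the B-hooks (excluded by `RingTwoMassLaw.no_bhook_P`), and a unit∕axis letter contributes on pattern `p` only if its
position `k_f` has parity `p f`.  Hence (§3, `class_mass_law`) **every one of the 8 parity classes of the parity of `|p|` carries weighted
H-free mass `≥ |Re μ|∕8` (even classes) resp. `≥ |Im μ|∕8` (odd classes)** — the polytope-level law saying WHERE the charge can sit.

THE CUBE LAW (§4).  The table `(2h − 2a) ⊕ (1+i)i^{k_f} e ⊕ (1−i)i^{−k_f} ē` per slot reads `2(h − a_f) + 2(Re + Im)(i^{−k_f}β_f)`, i.e. twice the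
weight with which the letter sits in the unit cube at corner `k`; its e-free part is the k-independent DEPTH functional `∏_f (h − a_f)`.  Under clause 1:

  **CUBE LAW.**  `2·CS_k(D) = 2·E(D) − Re(i^{Σ k}·μ)` for every corner `k : Fin 4 → Fin 4`, where `CS_k = (Σ_N − Σ_P) m ∏_f gq_{k_f}` and
  `E = (Σ_N − Σ_P) m ∏_f (h − a_f)`.

On any `OnAlphabet h` design every factor `gq` is even, so `16 ∣ CS_k`, whence the LATTICE DIGITS (§5): `8 ∣ E`, `Re μ ≡ Im μ ≡ 2E (mod 32)`.
On the ring-2 LAW-F room (`Ring2 ∧ RuleD ∧ Disj`, height 14) `E = m_N(u⁴) − m_P(u⁴) − 2·m_P(A-hooks) − 2·m_P(B-hooks) = −m_P(H,u,u,D)∕6`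
(`unit4_balance`, `mPB_eq_zero`), so (§5, `lattice_law`):

  **`48 ∣ m_P(H,u,u,D)`, `12 ∣ m_P(H,H,D,D)`, `96 ∣ 3·Re μ + m_P(H,u,u,D)`, `96 ∣ 3·Im μ + m_P(H,u,u,D)`.**

In particular the book's normalisation `|μ|_∞ = 16` costs `m_P(H,u,u,D) ≡ 48 (mod 96)`, i.e. at least 48 + 12 D-cells on the P side.

UNDER THE v4.2 DOOR (§6; `RingTwoMassLaw.ring2_doorU`: `Σ_P m ≤ 50`): `m_P(H,u,u,D) = m_P(H,H,D,D) = 0`, `32 ∣ Re μ`, `32 ∣ Im μ`,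
`m_N(u⁴) = m_P(u⁴) + 2·m_P(A-hooks)` exactly, `m_N(u⁴) ≥ 16`, and `m_N(u⁴) ≥ 32` if `Re μ · Im μ ≠ 0` (the ℓ¹ charge bound
`|Re μ| + |Im μ| ≤ m_N(u⁴) + m_P(u⁴) + 2·m_P(A) + 2·m_P(B)` on the room, `l1_charge_bound`).

Continuation §15 (same namespace, below): RULE D at the unit⁴ positions (≥ 3 A-hooks under every supported N-unit⁴ cell) + the CUBE LAW on one
residue class of corners + a covering count close the ring-2 door outright (`ring2_door_shut`, `sPlus_ring2`).

Build: Lean 4 ∕ Mathlib; appended to `RingTwoMassLaw` (self-contained; uses monad-1's charge-ideal machinery `RingTwoMassLaw.CI`); 0 sorry, no new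
axioms, no `native_decide`; the finite checks are `decide` over monad-3's letter-class alphabet `HeightTower.LC`, the ring-2 alphabet `R2` and `Fin 4`.
-/

namespace ClassLaw
open CI

/-! ## §1 Bookkeeping: casts, conjugation, the unit `i` -/

theorem absSub (a b : ℤ) : |a - b| ≤ |a| + |b| := by
  have h := abs_add_le a (-b)
  rwa [abs_neg, ← sub_eq_add_neg] at h

/-- `i ∈ ℤ[i]`. -/
def zI : GaussianInt := ⟨0, 1⟩

theorem zI_mul_re (z : GaussianInt) : (zI * z).re = -z.im := by simp [zI, Zsqrtd.re_mul]
theorem zI_mul_im (z : GaussianInt) : (zI * z).im = z.re := by simp [zI, Zsqrtd.im_mul]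
theorem neg_zI_mul_re (z : GaussianInt) : (-zI * z).re = z.im := by simp [zI, Zsqrtd.re_mul]
theorem star_zI : star zI = -zI := by decide

theorem wsum_cast (L : List (Cell × ℕ)) (φ : Cell → ℤ) :
    CI.wsum L (fun c => ((φ c : ℤ) : GaussianInt)) = ((linZ L φ : ℤ) : GaussianInt) := by
  rw [linZ_cast]; rfl

theorem wsum_star (L : List (Cell × ℕ)) (φ : Cell → GaussianInt) :
    CI.wsum L (fun c => star (φ c)) = star (CI.wsum L φ) := by
  induction L with
  | nil => simp [CI.wsum_nil]
  | cons a t ih => rw [CI.wsum_cons, CI.wsum_cons, ih, star_add, star_mul', star_natCast]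

theorem cellCoef_EEEE (c : Cell) : cellCoef c Word.EEEE = star (cellCoef c Word.eeee) := by
  unfold cellCoef Word.EEEE Word.eeee
  simp only [Sym.coef, star_prod, star_star]

/-- `T(ēēēē) = conj μ`. -/
theorem T_EEEE (D : Design) : D.T Word.EEEE = star D.mu := by
  unfold Design.mu
  rw [T_eq_wsum, T_eq_wsum, star_sub, ← wsum_star, ← wsum_star]
  simp only [cellCoef_EEEE]

theorem re_add_star (z : GaussianInt) : (z + star z).re = 2 * z.re := by
  simp [Zsqrtd.re_add, Zsqrtd.re_star]; ring

/-! ## §2 THE CLASS LAW -/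

/-- a parity pattern: `p f = true` ↔ slot `f` is read through `y` (odd unit positions). -/
abbrev Pat := Fin 4 → Bool

/-- class coordinate of a letter. -/
def crd (q : Bool) (ℓ : Letter) : ℤ := if q = true then ℓ.y else ℓ.x

/-- the class functional of a cell `∏_f crd`. -/
def classZ (p : Pat) (c : Cell) : ℤ := ∏ f : Fin 4, crd (p f) (c f)

/-- `W_p(D) = Σ_N m·classZ_p − Σ_P m·classZ_p`. -/
def W (p : Pat) (D : Design) : ℤ := linZ D.N (classZ p) - linZ D.P (classZ p)

/-- the class table: `Y₂` on the slots of `p`, `X₂` elsewhere. -/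
def Lp (p : Pat) : Tab := fun f => if p f = true then tY else tX

/-- its Bloch-word weight `∏_{f ∈ p} i`. -/
def phase (p : Pat) : GaussianInt := ∏ f : Fin 4, (if p f = true then zI else 1)

theorem kills_Lp (p : Pat) : KillsEfree (Lp p) := by
  intro w hw
  unfold lamW
  apply Finset.prod_eq_zero (Finset.mem_univ (3 : Fin 4))
  unfold Lp
  by_cases h : p 3 = true
  · rw [if_pos h]; exact tY_efree (w 3) (hw 3)
  · rw [if_neg h]; exact tX_efree (w 3) (hw 3)

theorem G_Lp (p : Pat) (f : Fin 4) (ℓ : Letter) : G (Lp p) f ℓ = ((2 * crd (p f) ℓ : ℤ) : GaussianInt) := by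
  unfold G Lp crd
  by_cases h : p f = true
  · simp only [if_pos h]; exact read_tY ℓ
  · simp only [if_neg h]; exact read_tX ℓ

theorem prod_G_Lp (p : Pat) (c : Cell) :
    ∏ f : Fin 4, G (Lp p) f (c f) = (((16 : ℤ) * classZ p c : ℤ) : GaussianInt) := by
  simp only [G_Lp]
  rw [← Int.cast_prod, Finset.prod_mul_distrib]
  simp [classZ]

theorem Lp_e (p : Pat) (f : Fin 4) : Lp p f Sym.e = if p f = true then zI else 1 := by
  unfold Lp; by_cases h : p f = true <;> simp [h] <;> rfl

theorem Lp_ebar (p : Pat) (f : Fin 4) : Lp p f Sym.ebar = star (if p f = true then zI else 1) := by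
  unfold Lp; by_cases h : p f = true <;> simp [h, star_zI] <;> rfl

theorem lamW_Lp_eeee (p : Pat) : lamW (Lp p) Word.eeee = phase p := by
  unfold lamW phase Word.eeee
  exact Finset.prod_congr rfl fun f _ => Lp_e p f

theorem lamW_Lp_EEEE (p : Pat) : lamW (Lp p) Word.EEEE = star (phase p) := by
  unfold lamW phase Word.EEEE
  rw [star_prod]
  exact Finset.prod_congr rfl fun f _ => Lp_ebar p f

theorem cellside (p : Pat) (L : List (Cell × ℕ)) :
    CI.wsum L (fun c => ∏ f : Fin 4, G (Lp p) f (c f)) = (((16 : ℤ) * linZ L (classZ p) : ℤ) : GaussianInt) := by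
  simp only [prod_G_Lp]
  rw [wsum_cast, linZ_smul]

/-- **THE CLASS LAW** (clause 1 of (A1) only; any alphabet): `16·W_p = phase·μ + conj(phase·μ)`. -/
theorem class_law (D : Design) (hA : A1e D) (p : Pat) :
    ((((16 : ℤ) * W p D : ℤ)) : GaussianInt) = phase p * D.mu + star (phase p * D.mu) := by
  have h := collapse (Lp p) D (kills_Lp p) hA
  rw [expand, lamW_Lp_eeee, lamW_Lp_EEEE, T_EEEE, cellside, cellside] at h
  unfold W Design.mu
  rw [star_mul']
  unfold Design.mu at h
  rw [← h]
  push_cast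
  ring

/-- **THE CLASS LAW, integer form**: `8·W_p(D) = Re(phase_p · μ)`. -/
theorem class_law_re (D : Design) (hA : A1e D) (p : Pat) : 8 * W p D = (phase p * D.mu).re := by
  have h := congrArg Zsqrtd.re (class_law D hA p)
  rw [re_add_star, Zsqrtd.re_intCast] at h
  linarith

/-- the phase is a fourth root of unity … -/
theorem phase_cases (p : Pat) : phase p = 1 ∨ phase p = -1 ∨ phase p = zI ∨ phase p = -zI := by
  unfold phase
  rw [Fin.prod_univ_four]
  cases p 0 <;> cases p 1 <;> cases p 2 <;> cases p 3 <;> simp [zI] <;> decide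

/-- … so `Re(phase·μ) ∈ {±Re μ, ±Im μ}`. -/
theorem phase_re_cases (p : Pat) (z : GaussianInt) :
    (phase p * z).re = z.re ∨ (phase p * z).re = -z.re ∨ (phase p * z).re = -z.im ∨ (phase p * z).re = z.im := by
  rcases phase_cases p with h | h | h | h <;> rw [h]
  · left; simp
  · right; left; simp
  · right; right; left; exact zI_mul_re z
  · right; right; right; exact neg_zI_mul_re z

/-- even patterns read `±Re μ`, odd patterns read `±Im μ` (the parity of the number of `y`-slots). -/
def Pat.odd (p : Pat) : Bool := xor (xor (p 0) (p 1)) (xor (p 2) (p 3))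

theorem phase_re_even (p : Pat) (hp : p.odd = false) (z : GaussianInt) :
    (phase p * z).re = z.re ∨ (phase p * z).re = -z.re := by
  have h : phase p = 1 ∨ phase p = -1 := by
    unfold phase; rw [Fin.prod_univ_four]; unfold Pat.odd at hp
    revert hp; cases p 0 <;> cases p 1 <;> cases p 2 <;> cases p 3 <;> simp [zI] <;> decide
  rcases h with h | h <;> rw [h] <;> simp

theorem phase_re_odd (p : Pat) (hp : p.odd = true) (z : GaussianInt) :
    (phase p * z).re = -z.im ∨ (phase p * z).re = z.im := by
  have h : phase p = zI ∨ phase p = -zI := by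
    unfold phase; rw [Fin.prod_univ_four]; unfold Pat.odd at hp
    revert hp; cases p 0 <;> cases p 1 <;> cases p 2 <;> cases p 3 <;> simp [zI] <;> decide
  rcases h with h | h <;> rw [h]
  · left; exact zI_mul_re z
  · right; exact neg_zI_mul_re z

/-! ## §3 THE CLASS MASS LAW: every parity class carries `|Re μ|∕8` (even) or `|Im μ|∕8` (odd) -/

/-- absolute class functional `∏_f |crd|` — it vanishes unless every letter has a non-zero class-`p` coordinate, and is `≤ ∏_f colevel`. -/
def classAbs (p : Pat) (c : Cell) : ℤ := ∏ f : Fin 4, |crd (p f) (c f)|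

theorem classAbs_eq_abs (p : Pat) (c : Cell) : classAbs p c = |classZ p c| := by
  unfold classAbs classZ; rw [Finset.abs_prod]

theorem classAbs_nonneg (p : Pat) (c : Cell) : 0 ≤ classAbs p c := by
  rw [classAbs_eq_abs]; exact abs_nonneg _

/-- co-level weight `∏_f colevel` (`= 1` on unit⁴, `2` on A∕B-hooks, `0` on any cell with a hub letter). -/
def cw (c : Cell) : ℤ := ∏ f : Fin 4, (c f).colevel

theorem abs_crd_le (q : Bool) (ℓ : Letter) : |crd q ℓ| ≤ ℓ.colevel := by
  unfold crd Letter.colevel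
  by_cases h : q = true
  · rw [if_pos h]; linarith [abs_nonneg ℓ.x]
  · rw [if_neg h]; linarith [abs_nonneg ℓ.y]

theorem classAbs_le_cw (p : Pat) (c : Cell) : classAbs p c ≤ cw c := by
  unfold classAbs cw
  exact Finset.prod_le_prod (fun f _ => abs_nonneg _) fun f _ => abs_crd_le (p f) (c f)

/-- a slot with class coordinate `0` (a hub, or a unit∕axis letter of the other parity) kills the class functional. -/
theorem classAbs_eq_zero (p : Pat) (c : Cell) (f : Fin 4) (hf : crd (p f) (c f) = 0) : classAbs p c = 0 := by
  unfold classAbs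
  exact Finset.prod_eq_zero (Finset.mem_univ f) (by rw [hf, abs_zero])

theorem abs_linZ_le (L : List (Cell × ℕ)) (φ ψ : Cell → ℤ) (h : ∀ c, |φ c| ≤ ψ c) : |linZ L φ| ≤ linZ L ψ := by
  induction L with
  | nil => simp [linZ]
  | cons a t ih =>
    rw [linZ_cons, linZ_cons]
    have ha : |(a.2 : ℤ) * φ a.1| ≤ (a.2 : ℤ) * ψ a.1 := by
      rw [abs_mul, Nat.abs_cast]
      exact mul_le_mul_of_nonneg_left (h a.1) (Nat.cast_nonneg _)
    exact (abs_add_le _ _).trans (add_le_add ha ih)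

/-- **CLASS MASS LAW**: `|Re(phase_p·μ)| ≤ 8·(Σ_N + Σ_P) m·|classZ_p|` — the class-`p` cells carry one eighth of `|Re μ|` resp. `|Im μ|`. -/
theorem class_mass_law (D : Design) (hA : A1e D) (p : Pat) :
    |(phase p * D.mu).re| ≤ 8 * (linZ D.N (classAbs p) + linZ D.P (classAbs p)) := by
  rw [← class_law_re D hA p, abs_mul]
  have hN := abs_linZ_le D.N (classZ p) (classAbs p) fun c => by rw [classAbs_eq_abs]
  have hP := abs_linZ_le D.P (classZ p) (classAbs p) fun c => by rw [classAbs_eq_abs]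
  have h8 : |(8 : ℤ)| = 8 := by norm_num
  rw [h8]
  unfold W
  have := absSub (linZ D.N (classZ p)) (linZ D.P (classZ p))
  linarith

/-- the same from the tree's full (A1). -/
theorem class_mass_law_of_A1 (D : Design) (h1 : D.A1) (p : Pat) :
    |(phase p * D.mu).re| ≤ 8 * (linZ D.N (classAbs p) + linZ D.P (classAbs p)) :=
  class_mass_law D (a1e_of_a1 D h1) p


/-! ## §4 THE CUBE LAW -/

/-- corner-`r` cube coordinate `(Re + Im)(i^{−r} β)`: `x + y`, `y − x`, `−x − y`, `x − y`. -/
def cubeCrd (r : Fin 4) (ℓ : Letter) : ℤ :=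
  if r.val = 0 then ℓ.x + ℓ.y else if r.val = 1 then ℓ.y - ℓ.x else if r.val = 2 then -ℓ.x - ℓ.y else ℓ.x - ℓ.y

/-- doubled cube weight of a letter for the corner coordinate `r`: `(h − a) + cubeCrd r` — on ring 2 at height 14:
`H ↦ 0`, `u_k ↦ 2·[k ∈ {r, r+1}]`, `A_k ↦ 4·[k ∈ {r, r+1}]`, `D_k ↦ 4, 2, 0, 2` (`k − r = 0, 1, 2, 3`). -/
def gq (h : ℤ) (r : Fin 4) (ℓ : Letter) : ℤ := (h - ℓ.a) + cubeCrd r ℓ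

/-- the cube functional at corner `k` and its class sum `CS_k = (Σ_N − Σ_P) m ∏_f gq`. -/
def cubeZ (h : ℤ) (k : Fin 4 → Fin 4) (c : Cell) : ℤ := ∏ f : Fin 4, gq h (k f) (c f)
def CS (h : ℤ) (k : Fin 4 → Fin 4) (D : Design) : ℤ := linZ D.N (cubeZ h k) - linZ D.P (cubeZ h k)

/-- the depth functional `∏_f (h − a_f)` (on the height-`h` alphabet `= ∏_f colevel`, `cw`) and `E = (Σ_N − Σ_P) m·dep`. -/
def dep (h : ℤ) (c : Cell) : ℤ := ∏ f : Fin 4, (h - (c f).a)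
def E (h : ℤ) (D : Design) : ℤ := linZ D.N (dep h) - linZ D.P (dep h)

/-- `Σ_f k_f` (the corner's Bloch phase is `i^{Σ k}`). -/
def sk (k : Fin 4 → Fin 4) : ℕ := ∑ f : Fin 4, (k f : ℕ)

/-- `(1+i)·i^r`. -/
def eC (r : Fin 4) : GaussianInt := (1 + zI) * zI ^ (r : ℕ)

/-- the cube table for corner coordinate `r`: `one ↦ 2h`, `h ↦ −2`, `e ↦ (1+i)i^r`, `ē ↦ conj`, `pt ↦ 0` — reads `2·gq`. -/
def tq (h : ℤ) (r : Fin 4) : Sym → GaussianInt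
  | Sym.one => 2 * (h : GaussianInt)
  | Sym.h => -2
  | Sym.e => eC r
  | Sym.ebar => star (eC r)
  | Sym.pt => 0

/-- its e-free truncation (independent of `r`) — reads `2(h − a)`. -/
def tq0 (h : ℤ) : Sym → GaussianInt
  | Sym.one => 2 * (h : GaussianInt)
  | Sym.h => -2
  | Sym.e => 0
  | Sym.ebar => 0
  | Sym.pt => 0

/-- the corner-`k` table and the truncated table. -/
def Lk (h : ℤ) (k : Fin 4 → Fin 4) : Tab := fun f => tq h (k f)
def L0 (h : ℤ) : Tab := fun _ => tq0 h

theorem zI_sq : zI ^ 2 = -1 := by decide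
theorem zI_pow_four : zI ^ 4 = 1 := by decide
theorem one_add_zI_pow_four : (1 + zI) ^ 4 = -4 := by decide

theorem zI_pow_cases (n : ℕ) : zI ^ n = 1 ∨ zI ^ n = zI ∨ zI ^ n = -1 ∨ zI ^ n = -zI := by
  induction n with
  | zero => left; rfl
  | succ n ih =>
    rw [pow_succ]
    rcases ih with h | h | h | h <;> rw [h]
    · right; left; simp
    · right; right; left; rw [← sq, zI_sq]
    · right; right; right; simp
    · left; rw [neg_mul, ← sq, zI_sq, neg_neg]

theorem eC_val (r : Fin 4) :
    eC r = if r.val = 0 then ⟨1, 1⟩ else if r.val = 1 then ⟨-1, 1⟩ else if r.val = 2 then ⟨-1, -1⟩ else ⟨1, -1⟩ := by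
  unfold eC; fin_cases r <;> decide

theorem read_tq (h : ℤ) (r : Fin 4) (ℓ : Letter) :
    ∑ s : Sym, tq h r s * s.coef ℓ = ((2 * gq h r ℓ : ℤ) : GaussianInt) := by
  rw [sum_sym]
  simp only [tq, eC_val, gq, cubeCrd]
  fin_cases r <;>
    · ext <;> simp [Sym.coef, Letter.beta, Zsqrtd.re_mul, Zsqrtd.im_mul] <;> ring

theorem read_tq0 (h : ℤ) (ℓ : Letter) : ∑ s : Sym, tq0 h s * s.coef ℓ = ((2 * (h - ℓ.a) : ℤ) : GaussianInt) := by
  rw [sum_sym]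
  ext
  · simp [tq0, Sym.coef, Zsqrtd.re_mul]; ring
  · simp [tq0, Sym.coef, Zsqrtd.im_mul]

theorem prod_G_Lk (h : ℤ) (k : Fin 4 → Fin 4) (c : Cell) :
    ∏ f : Fin 4, G (Lk h k) f (c f) = (((16 : ℤ) * cubeZ h k c : ℤ) : GaussianInt) := by
  have hG : ∀ f : Fin 4, G (Lk h k) f (c f) = ((2 * gq h (k f) (c f) : ℤ) : GaussianInt) := fun f => read_tq h (k f) (c f)
  simp only [hG]
  rw [← Int.cast_prod, Finset.prod_mul_distrib]
  simp [cubeZ]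

theorem prod_G_L0 (h : ℤ) (c : Cell) :
    ∏ f : Fin 4, G (L0 h) f (c f) = (((16 : ℤ) * dep h c : ℤ) : GaussianInt) := by
  have hG : ∀ f : Fin 4, G (L0 h) f (c f) = ((2 * (h - (c f).a) : ℤ) : GaussianInt) := fun f => read_tq0 h (c f)
  simp only [hG]
  rw [← Int.cast_prod, Finset.prod_mul_distrib]
  simp [dep]

theorem cellside_Lk (h : ℤ) (k : Fin 4 → Fin 4) (L : List (Cell × ℕ)) :
    CI.wsum L (fun c => ∏ f : Fin 4, G (Lk h k) f (c f)) = (((16 : ℤ) * linZ L (cubeZ h k) : ℤ) : GaussianInt) := by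
  simp only [prod_G_Lk]
  rw [wsum_cast, linZ_smul]

theorem cellside_L0 (h : ℤ) (L : List (Cell × ℕ)) :
    CI.wsum L (fun c => ∏ f : Fin 4, G (L0 h) f (c f)) = (((16 : ℤ) * linZ L (dep h) : ℤ) : GaussianInt) := by
  simp only [prod_G_L0]
  rw [wsum_cast, linZ_smul]

theorem lamW_Lk_eeee (h : ℤ) (k : Fin 4 → Fin 4) : lamW (Lk h k) Word.eeee = -4 * zI ^ sk k := by
  unfold lamW Lk Word.eeee sk
  simp only [tq, eC]
  rw [Finset.prod_mul_distrib, Finset.prod_const, Finset.card_univ, Fintype.card_fin, one_add_zI_pow_four,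
    Finset.prod_pow_eq_pow_sum]

theorem lamW_Lk_EEEE (h : ℤ) (k : Fin 4 → Fin 4) : lamW (Lk h k) Word.EEEE = star (lamW (Lk h k) Word.eeee) := by
  unfold lamW Lk Word.EEEE Word.eeee
  simp only [tq]
  rw [star_prod]

theorem lamW_L0_not_efree (h : ℤ) (w : Word) (hw : ¬ w.efree) : lamW (L0 h) w = 0 := by
  unfold Word.efree at hw
  push Not at hw
  obtain ⟨f, hf⟩ := hw
  unfold lamW
  apply Finset.prod_eq_zero (Finset.mem_univ f)
  unfold L0
  revert hf
  cases w f <;> simp [Sym.efree, tq0]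

theorem lamW_Lk_efree (h : ℤ) (k : Fin 4 → Fin 4) (w : Word) (hw : w.efree) : lamW (Lk h k) w = lamW (L0 h) w := by
  unfold lamW Lk L0
  refine Finset.prod_congr rfl fun f _ => ?_
  have hf := hw f
  revert hf
  cases w f <;> simp [Sym.efree, tq, tq0]

theorem eeee_not_efree : ¬ Word.eeee.efree := fun h => by have := h 0; revert this; decide
theorem EEEE_not_efree : ¬ Word.EEEE.efree := fun h => by have := h 0; revert this; decide

/-- word-side split under clause 1: the corner table = its e-free truncation + the two Bloch words. -/
theorem split_Lk (h : ℤ) (k : Fin 4 → Fin 4) (D : Design) (hA : A1e D) :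
    ∑ w : Word, lamW (Lk h k) w * D.T w
      = ∑ w : Word, lamW (L0 h) w * D.T w
        + lamW (Lk h k) Word.eeee * D.T Word.eeee + lamW (Lk h k) Word.EEEE * D.T Word.EEEE := by
  have key : ∀ w : Word, lamW (Lk h k) w * D.T w = lamW (L0 h) w * D.T w +
      ((if w = Word.eeee then lamW (Lk h k) Word.eeee * D.T Word.eeee else 0) +
      (if w = Word.EEEE then lamW (Lk h k) Word.EEEE * D.T Word.EEEE else 0)) := by
    intro w
    by_cases h1 : w = Word.eeee
    · subst h1
      simp [eeee_ne_EEEE, lamW_L0_not_efree h _ eeee_not_efree]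
    by_cases h2 : w = Word.EEEE
    · subst h2
      simp [eeee_ne_EEEE.symm, lamW_L0_not_efree h _ EEEE_not_efree]
    by_cases he : w.efree
    · simp [h1, h2, lamW_Lk_efree h k w he]
    · simp [h1, h2, hA w he h1 h2, lamW_L0_not_efree h w he]
  rw [Finset.sum_congr rfl fun w _ => key w, Finset.sum_add_distrib, Finset.sum_add_distrib, Finset.sum_ite_eq',
    Finset.sum_ite_eq']
  simp [add_assoc]

/-- **THE CUBE LAW** (clause 1 only; any design, any parameter `h`): `16·CS_k = 16·E − 4·i^{Σk}·μ − conj`. -/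
theorem cube_law_gauss (h : ℤ) (D : Design) (hA : A1e D) (k : Fin 4 → Fin 4) :
    ((((16 : ℤ) * CS h k D : ℤ)) : GaussianInt)
      = (((16 : ℤ) * E h D : ℤ) : GaussianInt) + (-4 * zI ^ sk k * D.mu + star (-4 * zI ^ sk k * D.mu)) := by
  have hs := split_Lk h k D hA
  rw [expand, expand, cellside_Lk, cellside_Lk, cellside_L0, cellside_L0, lamW_Lk_EEEE, lamW_Lk_eeee, T_EEEE] at hs
  unfold CS E Design.mu
  unfold Design.mu at hs
  rw [star_mul']
  push_cast at hs ⊢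
  linear_combination hs

/-- **THE CUBE LAW, integer form**: `2·CS_k(D) = 2·E(D) − Re(i^{Σ k}·μ)`. -/
theorem cube_law (h : ℤ) (D : Design) (hA : A1e D) (k : Fin 4 → Fin 4) :
    2 * CS h k D = 2 * E h D - (zI ^ sk k * D.mu).re := by
  have e := congrArg Zsqrtd.re (cube_law_gauss h D hA k)
  rw [Zsqrtd.re_add, re_add_star, Zsqrtd.re_intCast, Zsqrtd.re_intCast] at e
  have e4 : (-4 * zI ^ sk k * D.mu).re = -4 * (zI ^ sk k * D.mu).re := by
    rw [mul_assoc, Zsqrtd.re_mul]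
    simp
  rw [e4] at e
  linarith

/-! ## §5 THE LATTICE DIGITS -/

theorem two_dvd_gq {h : ℤ} {ℓ : Letter} (hℓ : ℓ.OnAlphabet h) (r : Fin 4) : (2 : ℤ) ∣ gq h r ℓ := by
  have he := even_of_onAlphabet hℓ
  unfold gq cubeCrd
  fin_cases r <;> simp <;> omega

theorem sixteen_dvd_cubeZ {h : ℤ} {c : Cell} (hc : ∀ f : Fin 4, (c f).OnAlphabet h) (k : Fin 4 → Fin 4) :
    (16 : ℤ) ∣ cubeZ h k c := by
  unfold cubeZ
  rw [Fin.prod_univ_four]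
  obtain ⟨a0, h0⟩ := two_dvd_gq (hc 0) (k 0)
  obtain ⟨a1, h1⟩ := two_dvd_gq (hc 1) (k 1)
  obtain ⟨a2, h2⟩ := two_dvd_gq (hc 2) (k 2)
  obtain ⟨a3, h3⟩ := two_dvd_gq (hc 3) (k 3)
  rw [h0, h1, h2, h3]
  exact ⟨a0 * a1 * a2 * a3, by ring⟩

theorem dvd_linZ (n : ℤ) (L : List (Cell × ℕ)) (φ : Cell → ℤ) (h : ∀ cm ∈ L, 0 < cm.2 → n ∣ φ cm.1) : n ∣ linZ L φ := by
  induction L with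
  | nil => simp [linZ]
  | cons a t ih =>
    rw [linZ_cons]
    refine dvd_add ?_ (ih fun cm hm hp => h cm (List.mem_cons_of_mem _ hm) hp)
    rcases Nat.eq_zero_or_pos a.2 with h0 | hp
    · rw [h0]; simp
    · exact Dvd.dvd.mul_left (h a List.mem_cons_self hp) _

theorem sixteen_dvd_CS {h : ℤ} {D : Design} (hD : D.OnAlphabet h) (k : Fin 4 → Fin 4) : (16 : ℤ) ∣ CS h k D := by
  unfold CS
  refine dvd_sub (dvd_linZ 16 D.N _ fun cm hm hp => ?_) (dvd_linZ 16 D.P _ fun cm hm hp => ?_)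
  · exact sixteen_dvd_cubeZ (fun f => hD cm.1 (mem_supp_of_memN D ((mem_suppN_iff D cm.1).mpr ⟨cm.2, hm, hp⟩)) f) k
  · exact sixteen_dvd_cubeZ (fun f => hD cm.1 (mem_supp_of_memP D ((mem_suppP_iff D cm.1).mpr ⟨cm.2, hm, hp⟩)) f) k

/-- the three corners used: `Σk = 0, 1, 2`. -/
def kc (j : ℕ) : Fin 4 → Fin 4 := fun f => if f.val < j then 1 else 0

theorem sk_kc : sk (kc 0) = 0 ∧ sk (kc 1) = 1 ∧ sk (kc 2) = 2 := by
  refine ⟨?_, ?_, ?_⟩ <;> simp [sk, kc, Fin.sum_univ_four]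

/-- **LATTICE DIGITS** (clause 1 + the alphabet parity, every height): `8 ∣ E`, `Re μ ≡ 2E ≡ Im μ (mod 32)`. -/
theorem lattice_digits {h : ℤ} {D : Design} (hD : D.OnAlphabet h) (hA : A1e D) :
    (8 : ℤ) ∣ E h D ∧ (32 : ℤ) ∣ D.mu.re - 2 * E h D ∧ (32 : ℤ) ∣ D.mu.im - 2 * E h D := by
  have c0 := cube_law h D hA (kc 0)
  have c1 := cube_law h D hA (kc 1)
  have c2 := cube_law h D hA (kc 2)
  rw [sk_kc.1, pow_zero, one_mul] at c0
  rw [sk_kc.2.1, pow_one, zI_mul_re] at c1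
  rw [sk_kc.2.2, zI_sq, neg_one_mul, Zsqrtd.re_neg] at c2
  obtain ⟨q0, h0⟩ := sixteen_dvd_CS hD (kc 0)
  obtain ⟨q1, h1⟩ := sixteen_dvd_CS hD (kc 1)
  obtain ⟨q2, h2⟩ := sixteen_dvd_CS hD (kc 2)
  refine ⟨?_, ?_, ?_⟩ <;> omega

/-- corollary: monad-1's CHARGE IDEAL LAW re-derived from the cube law (`16 ∣ Re μ`, `16 ∣ Im μ`, `32 ∣ Re μ − Im μ`),
with the extra digit that `Re μ ∕ 16 ≡ E ∕ 8 (mod 2)`. -/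
theorem charge_ideal_again {h : ℤ} {D : Design} (hD : D.OnAlphabet h) (hA : A1e D) :
    (16 : ℤ) ∣ D.mu.re ∧ (16 : ℤ) ∣ D.mu.im ∧ (32 : ℤ) ∣ D.mu.re - D.mu.im := by
  obtain ⟨h8, hre, him⟩ := lattice_digits hD hA
  refine ⟨?_, ?_, ?_⟩ <;> omega

/-! ### §5b The depth functional on the ring-2 LAW-F room -/

/-- class depth weight `∏ (14 − a)`: `H ↦ 0`, `X ↦ 1`, `A, D ↦ 2`. -/
def depK (k0 k1 k2 k3 : LC) : ℤ := (14 - k0.av) * (14 - k1.av) * (14 - k2.av) * (14 - k3.av)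

theorem dep_eq_depK {c : Cell} (hc : ∀ f : Fin 4, c f ∈ R2) : dep 14 c = depK (K c 0) (K c 1) (K c 2) (K c 3) := by
  have e := fun f => (R2_class (c f) (hc f)).1
  unfold dep depK K
  rw [Fin.prod_univ_four, e 0, e 1, e 2, e 3]

def okDepN : Bool :=
  allLC fun k0 => allLC fun k1 => allLC fun k2 => allLC fun k3 =>
    decide (NAnat k0 k1 k2 k3 → depK k0 k1 k2 k3 = indX4K k0 k1 k2 k3)

def okDepP : Bool :=
  allLC fun k0 => allLC fun k1 => allLC fun k2 => allLC fun k3 =>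
    decide (PAnatW k0 k1 k2 k3 → depK k0 k1 k2 k3 = indX4K k0 k1 k2 k3 + 2 * indAK k0 k1 k2 k3 + 2 * indBK k0 k1 k2 k3)

theorem okDepN_true : okDepN = true := by decide
theorem okDepP_true : okDepP = true := by decide

theorem okDepN_spec (k0 k1 k2 k3 : LC) (hk : NAnat k0 k1 k2 k3) : depK k0 k1 k2 k3 = indX4K k0 k1 k2 k3 :=
  of_decide_eq_true (allLC_spec _ (allLC_spec _ (allLC_spec _ (allLC_spec _ okDepN_true k0) k1) k2) k3) hk

theorem okDepP_spec (k0 k1 k2 k3 : LC) (hk : PAnatW k0 k1 k2 k3) :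
    depK k0 k1 k2 k3 = indX4K k0 k1 k2 k3 + 2 * indAK k0 k1 k2 k3 + 2 * indBK k0 k1 k2 k3 :=
  of_decide_eq_true (allLC_spec _ (allLC_spec _ (allLC_spec _ (allLC_spec _ okDepP_true k0) k1) k2) k3) hk

/-- `Σ_N m·dep = m_N(u⁴)` on the LAW-F room. -/
theorem depN_room {D : Design} (hD : D.OnAlphabet 14) (hR : Ring2 D) (hdisj : Disj D) (hrule : RuleD D) :
    linZ D.N (dep 14) = massU4 D := by
  have hN : ∀ cm ∈ D.N, 0 < cm.2 → dep 14 cm.1 = u4Ind cm.1 := by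
    intro cm hcm hpos
    have hmem : cm.1 ∈ D.suppN := (mem_suppN_iff D cm.1).mpr ⟨cm.2, hcm, hpos⟩
    have hc := fun f => memR2_of_supp hD hR (mem_supp_of_memN D hmem) f
    rw [dep_eq_depK hc, okDepN_spec _ _ _ _ (nanat_of_suppN hD hR hdisj hrule hmem), indX4K_cell hc]
  unfold massU4
  rw [linZ_congr' D.N (dep 14) u4Ind hN]

/-- `Σ_P m·dep = m_P(u⁴) + 2·m_P(A-hooks) + 2·m_P(B-hooks)` on the LAW-F room. -/
theorem depP_room {D : Design} (hD : D.OnAlphabet 14) (hR : Ring2 D) (hdisj : Disj D) (hrule : RuleD D) :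
    linZ D.P (dep 14) = mPU4 D + 2 * mPA D + 2 * mPB D := by
  have hP : ∀ cm ∈ D.P, 0 < cm.2 → dep 14 cm.1 = (1 * u4Ind cm.1 + 2 * indA cm.1) + 2 * indB cm.1 := by
    intro cm hcm hpos
    have hmem : cm.1 ∈ D.suppP := (mem_suppP_iff D cm.1).mpr ⟨cm.2, hcm, hpos⟩
    have hc := fun f => memR2_of_supp hD hR (mem_supp_of_memP D hmem) f
    obtain ⟨b1, b2, -, -⟩ := ind_bridge hc
    rw [dep_eq_depK hc, okDepP_spec _ _ _ _ (panatW_of_suppP hD hR hdisj hrule hmem), indX4K_cell hc, b1, b2]; ring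
  unfold mPU4 mPA mPB
  rw [linZ_congr' D.P (dep 14) (fun c => (1 * u4Ind c + 2 * indA c) + 2 * indB c) hP, linZ_add, linZ_lin, linZ_smul]
  ring

/-- **Room identification of `E`**: on the LAW-F room (`OnAlphabet 14`, `Ring2`, `Disj`, `RuleD`),
`E = m_N(u⁴) − m_P(u⁴) − 2·m_P(A-hooks) − 2·m_P(B-hooks)` (= `Σ_k F(k)` of the memo). -/
theorem E_room {D : Design} (hD : D.OnAlphabet 14) (hR : Ring2 D) (hdisj : Disj D) (hrule : RuleD D) :
    E 14 D = massU4 D - (mPU4 D + 2 * mPA D + 2 * mPB D) := by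
  unfold E
  rw [depN_room hD hR hdisj hrule, depP_room hD hR hdisj hrule]

/-- **`6·E = −m_P(H,u,u,D)`** on the room, under (A1). -/
theorem six_E {D : Design} (hD : D.OnAlphabet 14) (hR : Ring2 D) (hdisj : Disj D) (hrule : RuleD D) (h1 : D.A1) :
    6 * E 14 D = -mPHuuD D := by
  rw [E_room hD hR hdisj hrule, mPB_eq_zero hD hR hdisj hrule h1]
  have hb := unit4_balance hD hR hdisj hrule h1
  linarith

/-- **THE LATTICE LAW of the B-free skeleton** (ring 2, height 14, `RuleD ∧ Disj ∧ (A1)`):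
`48 ∣ m_P(H,u,u,D)`, `12 ∣ m_P(H,H,D,D)`, `96 ∣ 3·Re μ + m_P(H,u,u,D)`, `96 ∣ 3·Im μ + m_P(H,u,u,D)`. -/
theorem lattice_law {D : Design} (hD : D.OnAlphabet 14) (hR : Ring2 D) (hdisj : Disj D) (hrule : RuleD D) (h1 : D.A1) :
    (48 : ℤ) ∣ mPHuuD D ∧ (12 : ℤ) ∣ mPHHDD D ∧ (96 : ℤ) ∣ 3 * D.mu.re + mPHuuD D ∧ (96 : ℤ) ∣ 3 * D.mu.im + mPHuuD D := by
  obtain ⟨h8, hre, him⟩ := lattice_digits hD (a1e_of_a1 D h1)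
  have h6 := six_E hD hR hdisj hrule h1
  have h4 := huuD_law hD hR hdisj hrule h1
  refine ⟨?_, ?_, ?_, ?_⟩ <;> omega

/-- the book's normalisation `|μ|_∞ = 16` (more generally `¬ 32 ∣ Re μ`) costs `m_P(H,u,u,D) ≡ 48 (mod 96)`: at least 48 cells `(H,u,u,D)`
and 12 cells `(H,H,D,D)` on the P side. -/
theorem sixteen_class_cost {D : Design} (hD : D.OnAlphabet 14) (hR : Ring2 D) (hdisj : Disj D) (hrule : RuleD D) (h1 : D.A1)
    (h16 : ¬ (32 : ℤ) ∣ D.mu.re) : 48 ≤ mPHuuD D ∧ 12 ≤ mPHHDD D := by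
  obtain ⟨h48, -, hre, -⟩ := lattice_law hD hR hdisj hrule h1
  have h4 := huuD_law hD hR hdisj hrule h1
  have h0 := mPHuuD_nonneg D
  constructor <;> omega

/-! ## §6 THE ℓ¹ CHARGE BOUND AND THE DOOR COROLLARIES -/

/-- `ℓ¹` size of a Gaussian integer. -/
def n1 (z : GaussianInt) : ℤ := |z.re| + |z.im|

theorem n1_nonneg (z : GaussianInt) : 0 ≤ n1 z := add_nonneg (abs_nonneg _) (abs_nonneg _)

theorem n1_mul_le (z w : GaussianInt) : n1 (z * w) ≤ n1 z * n1 w := by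
  unfold n1
  rw [Zsqrtd.re_mul, Zsqrtd.im_mul]
  have h1 : |z.re * w.re + -1 * z.im * w.im| ≤ |z.re| * |w.re| + |z.im| * |w.im| := by
    calc |z.re * w.re + -1 * z.im * w.im| ≤ |z.re * w.re| + |-1 * z.im * w.im| := abs_add_le _ _
      _ = |z.re| * |w.re| + |z.im| * |w.im| := by rw [abs_mul, abs_mul, abs_mul]; norm_num
  have h2 : |z.re * w.im + z.im * w.re| ≤ |z.re| * |w.im| + |z.im| * |w.re| := by
    calc |z.re * w.im + z.im * w.re| ≤ |z.re * w.im| + |z.im * w.re| := abs_add_le _ _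
      _ = |z.re| * |w.im| + |z.im| * |w.re| := by rw [abs_mul, abs_mul]
  nlinarith [abs_nonneg z.re, abs_nonneg z.im, abs_nonneg w.re, abs_nonneg w.im]

theorem n1_sub_le (z w : GaussianInt) : n1 (z - w) ≤ n1 z + n1 w := by
  unfold n1
  rw [Zsqrtd.re_sub, Zsqrtd.im_sub]
  have := absSub z.re w.re
  have := absSub z.im w.im
  linarith

theorem n1_add_le (z w : GaussianInt) : n1 (z + w) ≤ n1 z + n1 w := by
  unfold n1
  rw [Zsqrtd.re_add, Zsqrtd.im_add]
  have := abs_add_le z.re w.re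
  have := abs_add_le z.im w.im
  linarith

theorem n1_natCast_mul (m : ℕ) (z : GaussianInt) : n1 ((m : GaussianInt) * z) = (m : ℤ) * n1 z := by
  unfold n1
  simp only [Zsqrtd.re_mul, Zsqrtd.im_mul, Zsqrtd.re_natCast, Zsqrtd.im_natCast, mul_zero, zero_mul, add_zero]
  rw [abs_mul, abs_mul, Nat.abs_cast]
  ring

theorem n1_star_beta (ℓ : Letter) : n1 (star ℓ.beta) = ℓ.colevel := by
  unfold n1 Letter.beta Letter.colevel
  simp [abs_neg]

theorem n1_cellCoef_le (c : Cell) : n1 (cellCoef c Word.eeee) ≤ cw c := by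
  unfold cellCoef Word.eeee cw
  simp only [Sym.coef]
  rw [Fin.prod_univ_four, Fin.prod_univ_four, ← n1_star_beta, ← n1_star_beta, ← n1_star_beta, ← n1_star_beta]
  have g0 := n1_nonneg (star (c 0).beta)
  have g1 := n1_nonneg (star (c 1).beta)
  have g2 := n1_nonneg (star (c 2).beta)
  have g3 := n1_nonneg (star (c 3).beta)
  calc n1 (star (c 0).beta * star (c 1).beta * star (c 2).beta * star (c 3).beta)
      ≤ n1 (star (c 0).beta * star (c 1).beta * star (c 2).beta) * n1 (star (c 3).beta) := n1_mul_le _ _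
    _ ≤ n1 (star (c 0).beta * star (c 1).beta) * n1 (star (c 2).beta) * n1 (star (c 3).beta) :=
        mul_le_mul_of_nonneg_right (n1_mul_le _ _) g3
    _ ≤ n1 (star (c 0).beta) * n1 (star (c 1).beta) * n1 (star (c 2).beta) * n1 (star (c 3).beta) :=
        mul_le_mul_of_nonneg_right (mul_le_mul_of_nonneg_right (n1_mul_le _ _) g2) g3

theorem n1_wsum_le (L : List (Cell × ℕ)) (φ : Cell → GaussianInt) (ψ : Cell → ℤ) (h : ∀ c, n1 (φ c) ≤ ψ c) :
    n1 (CI.wsum L φ) ≤ linZ L ψ := by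
  induction L with
  | nil => simp [CI.wsum_nil, linZ, n1]
  | cons a t ih =>
    rw [CI.wsum_cons, linZ_cons]
    calc n1 ((a.2 : GaussianInt) * φ a.1 + CI.wsum t φ) ≤ n1 ((a.2 : GaussianInt) * φ a.1) + n1 (CI.wsum t φ) := n1_add_le _ _
      _ ≤ (a.2 : ℤ) * ψ a.1 + linZ t ψ := by
          rw [n1_natCast_mul]; exact add_le_add (mul_le_mul_of_nonneg_left (h a.1) (Nat.cast_nonneg _)) ih

/-- **THE ℓ¹ CHARGE BOUND** (any design): `|Re μ| + |Im μ| ≤ (Σ_N + Σ_P) m·∏_f colevel`. -/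
theorem l1_charge_bound_cw (D : Design) : |D.mu.re| + |D.mu.im| ≤ linZ D.N cw + linZ D.P cw := by
  have hμ : D.mu = CI.wsum D.N (fun c => cellCoef c Word.eeee) - CI.wsum D.P (fun c => cellCoef c Word.eeee) := by
    unfold Design.mu; rw [T_eq_wsum]
  have hN := n1_wsum_le D.N _ cw n1_cellCoef_le
  have hP := n1_wsum_le D.P _ cw n1_cellCoef_le
  have := n1_sub_le (CI.wsum D.N fun c => cellCoef c Word.eeee) (CI.wsum D.P fun c => cellCoef c Word.eeee)
  rw [← hμ] at this
  unfold n1 at this hN hP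
  linarith

theorem cw_eq_dep {h : ℤ} {c : Cell} (hc : ∀ f : Fin 4, (c f).OnAlphabet h) : cw c = dep h c := by
  unfold cw dep
  refine Finset.prod_congr rfl fun f _ => ?_
  have e := (hc f).1
  unfold Letter.height at e
  unfold Letter.colevel
  linarith

/-- on the LAW-F room: `|Re μ| + |Im μ| ≤ m_N(u⁴) + m_P(u⁴) + 2·m_P(A-hooks) + 2·m_P(B-hooks)`. -/
theorem l1_charge_bound {D : Design} (hD : D.OnAlphabet 14) (hR : Ring2 D) (hdisj : Disj D) (hrule : RuleD D) :
    |D.mu.re| + |D.mu.im| ≤ massU4 D + (mPU4 D + 2 * mPA D + 2 * mPB D) := by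
  have h := l1_charge_bound_cw D
  have hN : linZ D.N cw = linZ D.N (dep 14) := linZ_congr' _ _ _ fun cm hm hp =>
    cw_eq_dep fun f => hD cm.1 (mem_supp_of_memN D ((mem_suppN_iff D cm.1).mpr ⟨cm.2, hm, hp⟩)) f
  have hP : linZ D.P cw = linZ D.P (dep 14) := linZ_congr' _ _ _ fun cm hm hp =>
    cw_eq_dep fun f => hD cm.1 (mem_supp_of_memP D ((mem_suppP_iff D cm.1).mpr ⟨cm.2, hm, hp⟩)) f
  rw [hN, hP, depN_room hD hR hdisj hrule, depP_room hD hR hdisj hrule] at h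
  exact h

theorem linZ_one_eq (L : List (Cell × ℕ)) : linZ L (fun _ => 1) = (((L.map Prod.snd).sum : ℕ) : ℤ) := by
  induction L with
  | nil => simp [linZ]
  | cons a t ih => rw [linZ_cons, List.map_cons, List.sum_cons, ih]; push_cast; ring

theorem ind_D_le_one (c : Cell) : indHuuD c + indHHDD c ≤ 1 := by
  unfold indHuuD indHHDD IsHuuD IsHHDD
  split <;> split <;> simp_all

/-- `m_P(H,u,u,D) + m_P(H,H,D,D) ≤ Σ_P m`. -/
theorem dmass_le_pmass (D : Design) : mPHuuD D + mPHHDD D ≤ Pmass D := by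
  unfold mPHuuD mPHHDD Pmass
  rw [← linZ_add, ← linZ_one_eq]
  exact linZ_mono _ _ _ fun cm _ _ => ind_D_le_one cm.1

/-- **UNDER THE v4.2 DOOR** (`copies + rank ≤ 116`, PortHall₈, `μ ≠ 0`; height 14): the D-shapes vanish, the charge digits are `32`, and
`m_N(u⁴) = m_P(u⁴) + 2·m_P(A-hooks) ≥ 16` (`≥ 32` when both `Re μ` and `Im μ` are non-zero). -/
theorem door_law {D : Design} (hD : D.OnAlphabet 14) (hR : Ring2 D) (hdisj : Disj D) (hrule : RuleD D) (h1 : D.A1)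
    (hμ : D.mu ≠ 0) (hU8 : HallPlusUp D 8) (hdoor : (D.copies : ℤ) + D.rank ≤ 116) :
    mPHuuD D = 0 ∧ mPHHDD D = 0 ∧ (32 : ℤ) ∣ D.mu.re ∧ (32 : ℤ) ∣ D.mu.im ∧ massU4 D = mPU4 D + 2 * mPA D ∧
      16 ≤ massU4 D ∧ (D.mu.re ≠ 0 → D.mu.im ≠ 0 → 32 ≤ massU4 D) := by
  obtain ⟨-, -, -, -, hP50, -⟩ := ring2_doorU hD hR hdisj hrule h1 hμ hU8 hdoor
  obtain ⟨h48, h12, hre, him⟩ := lattice_law hD hR hdisj hrule h1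
  have h4 := huuD_law hD hR hdisj hrule h1
  have hdm := dmass_le_pmass D
  have hu0 := mPHuuD_nonneg D
  have hd0 := mPHHDD_nonneg D
  have hHuuD : mPHuuD D = 0 := by omega
  have hHHDD : mPHHDD D = 0 := by omega
  have h32re : (32 : ℤ) ∣ D.mu.re := by omega
  have h32im : (32 : ℤ) ∣ D.mu.im := by omega
  have hE : massU4 D = mPU4 D + 2 * mPA D := by
    have h6 := six_E hD hR hdisj hrule h1
    rw [E_room hD hR hdisj hrule, mPB_eq_zero hD hR hdisj hrule h1] at h6
    omega
  have hl1 := l1_charge_bound hD hR hdisj hrule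
  rw [mPB_eq_zero hD hR hdisj hrule h1] at hl1
  have hne : D.mu.re ≠ 0 ∨ D.mu.im ≠ 0 := by
    by_contra hc
    push Not at hc
    exact hμ (Zsqrtd.ext hc.1 hc.2)
  refine ⟨hHuuD, hHHDD, h32re, h32im, hE, ?_, fun hre0 him0 => ?_⟩
  · rcases hne with hne | hne
    · rcases abs_cases D.mu.re with ⟨ha, _⟩ | ⟨ha, _⟩ <;> · have := abs_nonneg D.mu.im; omega
    · rcases abs_cases D.mu.im with ⟨ha, _⟩ | ⟨ha, _⟩ <;> · have := abs_nonneg D.mu.re; omega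
  · rcases abs_cases D.mu.re with ⟨ha, _⟩ | ⟨ha, _⟩ <;> rcases abs_cases D.mu.im with ⟨hb, _⟩ | ⟨hb, _⟩ <;> omega

/-- **THE DOOR LAW AT EVERY HEIGHT.** -/
theorem door_lawU {h : ℤ} {D : Design} (hD : D.OnAlphabet h) (hR : Ring2 D) (hdisj : Disj D) (hrule : RuleD D) (h1 : D.A1)
    (hμ : D.mu ≠ 0) (hU8 : HallPlusUp D 8) (hdoor : (D.copies : ℤ) + D.rank ≤ 116) :
    mPHuuD D = 0 ∧ mPHHDD D = 0 ∧ (32 : ℤ) ∣ D.mu.re ∧ (32 : ℤ) ∣ D.mu.im ∧ massU4 D = mPU4 D + 2 * mPA D ∧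
      16 ≤ massU4 D ∧ (D.mu.re ≠ 0 → D.mu.im ≠ 0 → 32 ≤ massU4 D) := by
  have e := door_law (onAlphabet14_of_shift hD hR) (ring2_shift (14 - h) hR) (disj_shift _ hdisj) (ruleD_shift _ hrule)
    (a1_shiftD _ D h1) (by rw [mu_shiftD]; exact hμ) ((hallPlusUp_shiftD _ D 8).mpr hU8)
    (by rw [copies_shift, rank_shift]; exact hdoor)
  rw [mPHuuD_shiftD, mPHHDD_shiftD, mu_shiftD, massU4_shiftD, mPU4_shiftD, mPA_shiftD] at e
  exact e

/-- **THE LATTICE LAW AT EVERY HEIGHT.** -/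
theorem lattice_lawU {h : ℤ} {D : Design} (hD : D.OnAlphabet h) (hR : Ring2 D) (hdisj : Disj D) (hrule : RuleD D) (h1 : D.A1) :
    (48 : ℤ) ∣ mPHuuD D ∧ (12 : ℤ) ∣ mPHHDD D ∧ (96 : ℤ) ∣ 3 * D.mu.re + mPHuuD D ∧ (96 : ℤ) ∣ 3 * D.mu.im + mPHuuD D := by
  have e := lattice_law (onAlphabet14_of_shift hD hR) (ring2_shift (14 - h) hR) (disj_shift _ hdisj) (ruleD_shift _ hrule)
    (a1_shiftD _ D h1)
  rw [mPHuuD_shiftD, mPHHDD_shiftD, mu_shiftD] at e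
  exact e



/-! ## §15 THE CUBE COVERING — the ring-2 door is shut (dual g15)

Under the door (`copies + rank ≤ 116`, i.e. `Σ_N m ≤ 58`) the DOOR LAW gives `E = 0`, so the CUBE LAW reads
`2·CS_k = −Re(i^{Σk} μ)`: on a whole residue class `Σk ≡ s (mod 4)` (64 corners) the cube functional equals
`CS_k = M/2 ≥ 16` (`M = max(±Re μ, ±Im μ) ≥ 32`).  On the LAW-F room `CS_k = 16·Σ_{q ∈ k+{0,1}⁴} F(q)`,
`F(q) = n_q − p_q − 2·a_q` (N-unit⁴ mass, P-unit⁴ mass, A-hook mass at position `q`): so every one of these 64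
unit cubes contains a position `q` with `n_q ≥ 1 + p_q + 2·a_q`; RULE D (+ `Disj`, LAW F2, B-hook exclusion) hooks
every supported N-unit⁴ position in at least three slots (`a_q ≥ 3`), so `n_q ≥ 7`.  A position lies in at most
6 unit cubes of one residue class, hence `6·m_N(u⁴) ≥ 7·64 = 448`, `m_N(u⁴) ≥ 75 > 58 ≥ Σ_N m` — contradiction:
**no charged ring-2 design closed under Rule D (with `Disj`, (A1), `HallPlusUp 8`) satisfies `copies + rank ≤ 116`.**
-/

/-! ### positions, unit cells, A-hooks -/

/-- positions / cube corners `(ℤ/4)⁴` -/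
abbrev K4 := Fin 4 → Fin 4

/-- the unit letter `u_t = (13; i^t)` and the axis floor letter `A_t = (12; 2i^t)`. -/
def uL (t : Fin 4) : Letter := ![⟨13, 1, 0⟩, ⟨13, 0, 1⟩, ⟨13, -1, 0⟩, ⟨13, 0, -1⟩] t
def aL (t : Fin 4) : Letter := ![⟨12, 2, 0⟩, ⟨12, 0, 2⟩, ⟨12, -2, 0⟩, ⟨12, 0, -2⟩] t

/-- the N-unit⁴ cell at position `q`, and the A-hook at position `q` hooked in slot `g`. -/
def ucell (q : K4) : Cell := fun f => uL (q f)
def hookCell (q : K4) (g : Fin 4) : Cell := fun f => if f = g then aL (q g) else uL (q f)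

/-- the index of a unit letter -/
def udx (ℓ : Letter) : Fin 4 := if ℓ.x = 1 then 0 else if ℓ.y = 1 then 1 else if ℓ.x = -1 then 2 else 3

theorem uL_inj : ∀ t t' : Fin 4, uL t = uL t' → t = t' := by decide
theorem aL_inj : ∀ t t' : Fin 4, aL t = aL t' → t = t' := by decide
theorem aL_ne_uL : ∀ t t' : Fin 4, aL t ≠ uL t' := by decide
theorem uL_udx : ∀ ℓ ∈ R2, ℓ.colevel = 1 → uL (udx ℓ) = ℓ := by decide
theorem uL_colevel : ∀ t : Fin 4, (uL t).colevel = 1 := by decide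
theorem uL_a : ∀ t : Fin 4, (uL t).a = 13 := by decide
theorem uL_not_diag : ∀ t : Fin 4, ¬ IsDiagL (uL t) := by decide
theorem uL_mem_R2 : ∀ t : Fin 4, uL t ∈ R2 := by decide

theorem ucell_inj {q q' : K4} (h : ucell q = ucell q') : q = q' :=
  funext fun f => uL_inj _ _ (congrFun h f)

theorem hookCell_self (q : K4) (g : Fin 4) : hookCell q g g = aL (q g) := by
  simp [hookCell]

theorem hookCell_ne (q : K4) {g f : Fin 4} (h : f ≠ g) : hookCell q g f = uL (q f) := by
  simp [hookCell, h]

theorem hookCell_ne_ucell (q q' : K4) (g : Fin 4) : hookCell q g ≠ ucell q' := by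
  intro h
  have e := congrFun h g
  rw [hookCell_self] at e
  exact aL_ne_uL _ _ e

theorem hookCell_inj {q q' : K4} {g g' : Fin 4} (h : hookCell q g = hookCell q' g') : q = q' ∧ g = g' := by
  have hg : g = g' := by
    by_contra hne
    have e := congrFun h g
    rw [hookCell_self, hookCell_ne q' hne] at e
    exact aL_ne_uL _ _ e
  subst hg
  refine ⟨funext fun f => ?_, rfl⟩
  have e := congrFun h f
  by_cases hf : f = g
  · subst hf
    rw [hookCell_self, hookCell_self] at e
    exact aL_inj _ _ e
  · rw [hookCell_ne q hf, hookCell_ne q' hf] at e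
    exact uL_inj _ _ e

/-! ### per-letter cube weights on ring 2 -/

theorem gq_uL (r t : Fin 4) : gq 14 r (uL t) = if (t = r ∨ t = r + 1) then 2 else 0 := by
  revert r t; decide

theorem gq_aL (r t : Fin 4) : gq 14 r (aL t) = if (t = r ∨ t = r + 1) then 4 else 0 := by
  revert r t; decide

theorem gq_nonneg_R2 : ∀ ℓ ∈ R2, ∀ r : Fin 4, 0 ≤ gq 14 r ℓ := by decide

theorem gq_hub : ∀ ℓ ∈ R2, ℓ.a = 14 → ∀ r : Fin 4, gq 14 r ℓ = 0 := by decide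

/-- the null-predecessors of a unit inside ring 2: the axis floor below it, or a diagonal floor. -/
theorem nullpred_unit : ∀ ℓ ∈ R2, ∀ t : Fin 4, NullStep ℓ (uL t) → ℓ = aL t ∨ IsDiagL ℓ := by
  unfold NullStep; decide

/-! ### the unit cube `k + {0,1}⁴` -/

/-- `q ∈ k + {0,1}⁴` -/
def inCubeB (k q : K4) : Bool := (List.finRange 4).all fun f => decide (q f = k f) || decide (q f = k f + 1)

theorem inCubeB_iff (k q : K4) : inCubeB k q = true ↔ ∀ f, q f = k f ∨ q f = k f + 1 := by
  simp [inCubeB, List.all_eq_true]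

/-- the unit cube as a Finset of positions -/
def cube (k : K4) : Finset K4 := Finset.univ.filter fun q => inCubeB k q = true

theorem mem_cube {k q : K4} : q ∈ cube k ↔ inCubeB k q = true := by
  simp [cube]

/-- `cubeZ` of a unit⁴ cell: `16·[q ∈ cube k]`. -/
theorem cubeZ_ucell (k q : K4) : cubeZ 14 k (ucell q) = if inCubeB k q = true then 16 else 0 := by
  unfold cubeZ ucell
  simp only [gq_uL]
  by_cases h : inCubeB k q = true
  · rw [if_pos h]
    have h' := (inCubeB_iff k q).mp h
    rw [Finset.prod_congr rfl (fun f _ => if_pos (h' f))]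
    norm_num
  · rw [if_neg h]
    have hex : ∃ f, ¬ (q f = k f ∨ q f = k f + 1) := by
      by_contra hc
      push Not at hc
      exact h ((inCubeB_iff k q).mpr fun f => by have := hc f; tauto)
    obtain ⟨f, hf⟩ := hex
    exact Finset.prod_eq_zero (Finset.mem_univ f) (if_neg hf)

/-- `cubeZ` of an A-hook: `32·[q ∈ cube k]`. -/
theorem cubeZ_hook (k q : K4) (g : Fin 4) : cubeZ 14 k (hookCell q g) = if inCubeB k q = true then 32 else 0 := by
  unfold cubeZ
  have hf : ∀ f : Fin 4, gq 14 (k f) (hookCell q g f) =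
      if (q f = k f ∨ q f = k f + 1) then (if f = g then 4 else 2) else 0 := by
    intro f
    by_cases hfg : f = g
    · subst hfg
      rw [hookCell_self, gq_aL, if_pos rfl]
    · rw [hookCell_ne q hfg, gq_uL, if_neg hfg]
  simp only [hf]
  by_cases h : inCubeB k q = true
  · rw [if_pos h]
    have h' := (inCubeB_iff k q).mp h
    rw [Finset.prod_congr rfl (fun f _ => if_pos (h' f)), Fin.prod_univ_four]
    fin_cases g <;> simp
  · rw [if_neg h]
    have hex : ∃ f, ¬ (q f = k f ∨ q f = k f + 1) := by
      by_contra hc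
      push Not at hc
      exact h ((inCubeB_iff k q).mpr fun f => by have := hc f; tauto)
    obtain ⟨f, hf0⟩ := hex
    exact Finset.prod_eq_zero (Finset.mem_univ f) (if_neg hf0)

/-! ### position masses `n_q`, `p_q`, `a_q` -/

/-- indicator of one cell -/
def indC (x c : Cell) : ℤ := if c = x then 1 else 0

/-- `n_q` = N-mass of the unit⁴ cell at `q`; `p_q` = its P-mass; `a_q` = P-mass of the A-hooks at `q`. -/
def nAt (q : K4) (D : Design) : ℤ := linZ D.N (indC (ucell q))
def pAt (q : K4) (D : Design) : ℤ := linZ D.P (indC (ucell q))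
def aAt (q : K4) (D : Design) : ℤ := linZ D.P (fun c => ∑ g : Fin 4, indC (hookCell q g) c)

theorem indC_nonneg (x c : Cell) : 0 ≤ indC x c := by
  unfold indC; split <;> norm_num

theorem nAt_nonneg (q : K4) (D : Design) : 0 ≤ nAt q D := linZ_nonneg _ _ fun cm _ _ => indC_nonneg _ cm.1
theorem pAt_nonneg (q : K4) (D : Design) : 0 ≤ pAt q D := linZ_nonneg _ _ fun cm _ _ => indC_nonneg _ cm.1
theorem aAt_nonneg (q : K4) (D : Design) : 0 ≤ aAt q D :=
  linZ_nonneg _ _ fun cm _ _ => Finset.sum_nonneg fun _ _ => indC_nonneg _ cm.1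

theorem linZ_finset_sum {ι : Type} [DecidableEq ι] (L : List (Cell × ℕ)) (s : Finset ι) (φ : ι → Cell → ℤ) :
    linZ L (fun c => ∑ i ∈ s, φ i c) = ∑ i ∈ s, linZ L (φ i) := by
  refine Finset.induction_on s ?_ ?_
  · simp only [Finset.sum_empty]
    exact linZ_zero L
  · intro a s ha ih
    rw [Finset.sum_insert ha, ← ih, ← linZ_add]
    exact linZ_congr' _ _ _ fun cm _ _ => Finset.sum_insert ha

/-- a supported cell has mass `≥ 1`. -/
theorem one_le_linZ_indC {L : List (Cell × ℕ)} {x : Cell} {m : ℕ} (hm : (x, m) ∈ L) (hpos : 0 < m) :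
    1 ≤ linZ L (indC x) := by
  have h := linZ_pos L (indC x) (fun cm _ _ => indC_nonneg x cm.1) hm hpos (by show 0 < indC x x; simp [indC])
  omega

theorem mem_suppN_of_nAt_pos {D : Design} {q : K4} (h : 0 < nAt q D) : ucell q ∈ D.suppN := by
  by_contra hn
  have h0 : nAt q D = 0 := by
    unfold nAt
    rw [linZ_congr' D.N (indC (ucell q)) (fun _ => 0) ?_, linZ_zero]
    intro cm hcm hp
    unfold indC
    rw [if_neg]
    intro e
    exact hn ((mem_suppN_iff D (ucell q)).mpr ⟨cm.2, by rw [← e]; exact hcm, hp⟩)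
  omega

/-- `Σ_{q ∈ S} [ucell q = ucell q₀] = [q₀ ∈ S]`. -/
theorem sum_indC_self (q₀ : K4) (S : Finset K4) :
    ∑ q ∈ S, indC (ucell q) (ucell q₀) = if q₀ ∈ S then 1 else 0 := by
  have e : ∀ q, indC (ucell q) (ucell q₀) = if q₀ = q then 1 else 0 := by
    intro q
    unfold indC
    by_cases h : q₀ = q
    · subst h; simp
    · rw [if_neg (fun e => h (ucell_inj e)), if_neg h]
  simp only [e]
  exact Finset.sum_ite_eq S q₀ fun _ => (1 : ℤ)

/-! ### the cube functional, N side and P side -/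

theorem hub_of_not_u4 : ∀ k0 k1 k2 k3 : LC, NAnat k0 k1 k2 k3 → isX4 k0 k1 k2 k3 = false →
    (k0.isH || k1.isH || k2.isH || k3.isH) = true := by
  decide

/-- on an N-cell (N-anatomy): `cubeZ ≤ 16·Σ_{q ∈ cube} [c = ucell q]` (equality in fact). -/
theorem cubeZ_N_le {c : Cell} (hc : ∀ f : Fin 4, c f ∈ R2) (hN : NAnat (K c 0) (K c 1) (K c 2) (K c 3)) (k : K4) :
    cubeZ 14 k c ≤ 16 * ∑ q ∈ cube k, indC (ucell q) c := by
  by_cases hu : u4B c = true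
  · have hq : c = ucell (fun f => udx (c f)) := by
      funext f
      have h1 : (c f).colevel = 1 := by
        have := List.all_eq_true.mp hu f (List.mem_finRange f)
        exact of_decide_eq_true this
      exact (uL_udx (c f) (hc f) h1).symm
    rw [hq, cubeZ_ucell, sum_indC_self]
    by_cases hin : inCubeB k (fun f => udx (c f)) = true
    · rw [if_pos hin, if_pos (mem_cube.mpr hin)]; norm_num
    · rw [if_neg hin, if_neg (fun h => hin (mem_cube.mp h))]; norm_num
  · have hx : isX4 (K c 0) (K c 1) (K c 2) (K c 3) = false := by
      cases h : isX4 (K c 0) (K c 1) (K c 2) (K c 3)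
      · rfl
      · exact absurd ((isX4_iff_u4B hc).mp h) hu
    have hh := hub_of_not_u4 _ _ _ _ hN hx
    have hz : ∀ f : Fin 4, (K c f).isH = true → cubeZ 14 k c = 0 := fun f hf =>
      Finset.prod_eq_zero (Finset.mem_univ f) (gq_hub _ (hc f) ((isH_iff (hc f)).mp hf) _)
    have h0 : cubeZ 14 k c = 0 := by
      simp only [Bool.or_eq_true] at hh
      rcases hh with ((h0 | h1) | h2) | h3
      · exact hz 0 h0
      · exact hz 1 h1
      · exact hz 2 h2
      · exact hz 3 h3
    rw [h0]
    exact mul_nonneg (by norm_num) (Finset.sum_nonneg fun q _ => indC_nonneg _ _)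

/-- on any ring-2 cell: `16·Σ_{q ∈ cube} ([c = ucell q] + 2·Σ_g [c = hookCell q g]) ≤ cubeZ` (equality on units and hooks,
`0 ≤ cubeZ` otherwise). -/
theorem cubeZ_P_ge {c : Cell} (hc : ∀ f : Fin 4, c f ∈ R2) (k : K4) :
    16 * ∑ q ∈ cube k, (indC (ucell q) c + 2 * ∑ g : Fin 4, indC (hookCell q g) c) ≤ cubeZ 14 k c := by
  by_cases h1 : ∃ q₀, c = ucell q₀
  · obtain ⟨q₀, rfl⟩ := h1
    have hh : ∀ q g, indC (hookCell q g) (ucell q₀) = 0 := fun q g => by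
      unfold indC; rw [if_neg]; exact fun e => hookCell_ne_ucell q q₀ g e.symm
    simp only [hh, Finset.sum_const_zero, mul_zero, add_zero]
    rw [sum_indC_self, cubeZ_ucell]
    by_cases hin : inCubeB k q₀ = true
    · rw [if_pos hin, if_pos (mem_cube.mpr hin)]; norm_num
    · rw [if_neg hin, if_neg (fun h => hin (mem_cube.mp h))]; norm_num
  by_cases h2 : ∃ q₀ g₀, c = hookCell q₀ g₀
  · obtain ⟨q₀, g₀, rfl⟩ := h2
    have hu : ∀ q, indC (ucell q) (hookCell q₀ g₀) = 0 := fun q => by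
      unfold indC; rw [if_neg]; exact hookCell_ne_ucell q₀ q g₀
    have hh : ∀ q g, indC (hookCell q g) (hookCell q₀ g₀) =
        (if q₀ = q then 1 else 0) * (if g₀ = g then 1 else 0) := fun q g => by
      unfold indC
      by_cases hq : q₀ = q
      · by_cases hg : g₀ = g
        · subst hq; subst hg; simp
        · rw [if_neg, if_pos hq, if_neg hg]
          · norm_num
          · exact fun e => hg (hookCell_inj e).2
      · rw [if_neg, if_neg hq, zero_mul]
        exact fun e => hq (hookCell_inj e).1
    have inner : ∀ q, ∑ g : Fin 4, (if q₀ = q then (1 : ℤ) else 0) * (if g₀ = g then 1 else 0) =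
        if q₀ = q then 1 else 0 := by
      intro q
      by_cases hq : q₀ = q
      · simp [hq, Finset.sum_ite_eq]
      · simp [hq]
    simp only [hu, hh, zero_add, inner]
    rw [← Finset.mul_sum, Finset.sum_ite_eq, cubeZ_hook]
    by_cases hin : inCubeB k q₀ = true
    · rw [if_pos hin, if_pos (mem_cube.mpr hin)]; norm_num
    · rw [if_neg hin, if_neg (fun h => hin (mem_cube.mp h))]; norm_num
  · push Not at h1 h2
    have h0 : ∀ q ∈ cube k, indC (ucell q) c + 2 * ∑ g : Fin 4, indC (hookCell q g) c = 0 := by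
      intro q _
      have e1 : indC (ucell q) c = 0 := if_neg (h1 q)
      rw [e1, Finset.sum_eq_zero (fun g _ => show indC (hookCell q g) c = 0 from if_neg (h2 q g))]
      ring
    rw [Finset.sum_congr rfl h0, Finset.sum_const_zero, mul_zero]
    unfold cubeZ
    exact Finset.prod_nonneg fun f _ => gq_nonneg_R2 _ (hc f) _

/-! ### RULE D hooks every supported N-unit⁴ in at least three slots -/

theorem bhook_of_diag (q : K4) (j : Fin 4) {ℓ : Letter} (hℓ : IsDiagL ℓ) :
    IsBHook (fun f => if f = j then ℓ else uL (q f)) := by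
  have hdu := uL_not_diag
  have huu := uL_colevel
  fin_cases j <;> simp [IsBHook, cntDiagC, cntUnitC, IsUnitL, hℓ, hdu, huu]

theorem hook_or_hook {D : Design} (hD : D.OnAlphabet 14) (hR : Ring2 D) (hdisj : Disj D) (hrule : RuleD D)
    (h1 : D.A1) {q : K4} (hq : ucell q ∈ D.suppN) {g j : Fin 4} (hgj : g ≠ j) :
    hookCell q g ∈ D.suppP ∨ hookCell q j ∈ D.suppP := by
  have hyS := mem_supp_of_memN D hq
  have hdet : Detects (ucell q) g j :=
    detects_of_ne_14 (memR2_of_supp hD hR hyS g) (by show (uL (q g)).a ≠ 14; rw [uL_a]; norm_num) j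
  obtain ⟨x, hx, hsup⟩ := supplier_of_N hrule hq hgj hdet
  have hxS := mem_supp_of_memP D hx
  have hxR := fun f => memR2_of_supp hD hR hxS f
  -- a one-sided null step produces the hook (or a B-hook, excluded)
  have one_sided : ∀ {s t : Fin 4}, s ≠ t → Supplies x (ucell q) s t → x t = ucell q t →
      NullStep (x s) (ucell q s) → hookCell q s ∈ D.suppP := by
    intro s t hst hs het hns
    have hoff : ∀ f, f ≠ s → x f = uL (q f) := by
      intro f hfs
      by_cases hft : f = t
      · rw [hft]; exact het
      · exact hs.1 f hfs hft
    rcases nullpred_unit (x s) (hxR s) (q s) hns with ha | hd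
    · have e : x = hookCell q s := by
        funext f
        by_cases hfs : f = s
        · rw [hfs, hookCell_self]; exact ha
        · rw [hookCell_ne q hfs]; exact hoff f hfs
      rw [← e]; exact hx
    · exfalso
      have e : x = fun f => if f = s then x s else uL (q f) := by
        funext f
        by_cases hfs : f = s
        · rw [hfs, if_pos rfl]
        · rw [if_neg hfs]; exact hoff f hfs
      have hB : IsBHook x := by rw [e]; exact bhook_of_diag q s hd
      exact no_bhook_P hD hR hdisj hrule h1 x hx hB
  rcases hsup.2.1 with eg | ng <;> rcases hsup.2.2 with ej | nj
  · exact (hdisj _ hq ((cell_eq_of_supplies hsup eg ej) ▸ hx)).elim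
  · right; exact one_sided (Ne.symm hgj) (supplies_symm hsup) eg nj
  · left; exact one_sided hgj hsup ej ng
  · exfalso
    have hg12 : (x g).a = 12 := null_to_13 (hxR g) ng (by show (uL (q g)).a = 13; exact uL_a _)
    have hj12 : (x j).a = 12 := null_to_13 (hxR j) nj (by show (uL (q j)).a = 13; exact uL_a _)
    obtain ⟨u, hug, huj, -⟩ := exists_fourth g j g
    have h14 := F2 hD hR hdisj hrule hx hgj hg12 hj12 u hug huj
    rw [hsup.1 u hug huj, show (ucell q u).a = 13 from uL_a _] at h14
    norm_num at h14

theorem cover3 : ∀ b0 b1 b2 b3 : Bool,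
    (b0 || b1) = true → (b0 || b2) = true → (b0 || b3) = true → (b1 || b2) = true → (b1 || b3) = true →
    (b2 || b3) = true → 3 ≤ b0.toNat + b1.toNat + b2.toNat + b3.toNat := by
  decide

/-- `a_q ≥ 3` at every supported N-unit⁴ position. -/
theorem three_le_aAt {D : Design} (hD : D.OnAlphabet 14) (hR : Ring2 D) (hdisj : Disj D) (hrule : RuleD D)
    (h1 : D.A1) {q : K4} (hq : ucell q ∈ D.suppN) : 3 ≤ aAt q D := by
  have hb : ∀ g : Fin 4, ((decide (hookCell q g ∈ D.suppP)).toNat : ℤ) ≤ linZ D.P (indC (hookCell q g)) := by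
    intro g
    by_cases h : hookCell q g ∈ D.suppP
    · obtain ⟨m, hm, hp⟩ := (mem_suppP_iff D _).mp h
      rw [decide_eq_true h]
      exact_mod_cast one_le_linZ_indC hm hp
    · rw [decide_eq_false h]
      exact_mod_cast linZ_nonneg _ _ fun cm _ _ => indC_nonneg _ cm.1
  have hor : ∀ g j : Fin 4, g ≠ j → (decide (hookCell q g ∈ D.suppP) || decide (hookCell q j ∈ D.suppP)) = true := by
    intro g j hgj
    rcases hook_or_hook hD hR hdisj hrule h1 hq hgj with h | h <;> simp [h]
  have h3 := cover3 _ _ _ _ (hor 0 1 (by decide)) (hor 0 2 (by decide)) (hor 0 3 (by decide)) (hor 1 2 (by decide))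
    (hor 1 3 (by decide)) (hor 2 3 (by decide))
  unfold aAt
  rw [linZ_finset_sum, Fin.sum_univ_four]
  have := hb 0; have := hb 1; have := hb 2; have := hb 3
  omega

/-! ### every class cube carries an N-unit⁴ position of mass ≥ 7 -/

theorem heavy_point {D : Design} (hD : D.OnAlphabet 14) (hR : Ring2 D) (hdisj : Disj D) (hrule : RuleD D)
    (h1 : D.A1) (k : K4) (hCS : 16 ≤ CS 14 k D) : ∃ q, inCubeB k q = true ∧ 7 ≤ nAt q D := by
  have hN : linZ D.N (cubeZ 14 k) ≤ 16 * ∑ q ∈ cube k, nAt q D := by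
    have h := linZ_mono D.N (cubeZ 14 k) (fun c => 16 * ∑ q ∈ cube k, indC (ucell q) c) fun cm hm hp => by
      have hmem : cm.1 ∈ D.suppN := (mem_suppN_iff D cm.1).mpr ⟨cm.2, hm, hp⟩
      have hc := fun f => memR2_of_supp hD hR (mem_supp_of_memN D hmem) f
      exact cubeZ_N_le hc (nanat_of_suppN hD hR hdisj hrule hmem) k
    rw [linZ_smul, linZ_finset_sum] at h
    exact h
  have hP : 16 * ∑ q ∈ cube k, (pAt q D + 2 * aAt q D) ≤ linZ D.P (cubeZ 14 k) := by
    have h := linZ_mono D.P (fun c => 16 * ∑ q ∈ cube k, (indC (ucell q) c + 2 * ∑ g : Fin 4, indC (hookCell q g) c))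
      (cubeZ 14 k) fun cm hm hp => by
      have hmem : cm.1 ∈ D.suppP := (mem_suppP_iff D cm.1).mpr ⟨cm.2, hm, hp⟩
      have hc := fun f => memR2_of_supp hD hR (mem_supp_of_memP D hmem) f
      exact cubeZ_P_ge hc k
    rw [linZ_smul, linZ_finset_sum] at h
    have e : ∀ q, linZ D.P (fun c => indC (ucell q) c + 2 * ∑ g : Fin 4, indC (hookCell q g) c) = pAt q D + 2 * aAt q D := by
      intro q
      unfold pAt aAt
      rw [linZ_add, linZ_smul]
    simp only [e] at h
    exact h
  have hpos : ∃ q ∈ cube k, pAt q D + 2 * aAt q D < nAt q D := by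
    by_contra hc
    push Not at hc
    have := Finset.sum_le_sum hc
    unfold CS at hCS
    linarith
  obtain ⟨q, hqc, hlt⟩ := hpos
  have hp0 := pAt_nonneg q D
  have ha0 := aAt_nonneg q D
  have hmem : ucell q ∈ D.suppN := mem_suppN_of_nAt_pos (by linarith)
  have h3 := three_le_aAt hD hR hdisj hrule h1 hmem
  exact ⟨q, mem_cube.mp hqc, by linarith⟩

/-! ### the corners of one residue class, and the covering count -/

/-- `Σ_f k_f` computed by recursion-free arithmetic -/
def skL (k : K4) : ℕ := (k 0 : ℕ) + k 1 + k 2 + k 3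

theorem sk_eq_skL (k : K4) : sk k = skL k := by
  simp [sk, skL, Fin.sum_univ_four]

def bases0 : List K4 :=
  [![0, 0, 0, 0], ![0, 0, 1, 3], ![0, 0, 2, 2], ![0, 0, 3, 1], ![0, 1, 0, 3], ![0, 1, 1, 2], ![0, 1, 2, 1], ![0, 1, 3, 0],
   ![0, 2, 0, 2], ![0, 2, 1, 1], ![0, 2, 2, 0], ![0, 2, 3, 3], ![0, 3, 0, 1], ![0, 3, 1, 0], ![0, 3, 2, 3], ![0, 3, 3, 2],
   ![1, 0, 0, 3], ![1, 0, 1, 2], ![1, 0, 2, 1], ![1, 0, 3, 0], ![1, 1, 0, 2], ![1, 1, 1, 1], ![1, 1, 2, 0], ![1, 1, 3, 3],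
   ![1, 2, 0, 1], ![1, 2, 1, 0], ![1, 2, 2, 3], ![1, 2, 3, 2], ![1, 3, 0, 0], ![1, 3, 1, 3], ![1, 3, 2, 2], ![1, 3, 3, 1],
   ![2, 0, 0, 2], ![2, 0, 1, 1], ![2, 0, 2, 0], ![2, 0, 3, 3], ![2, 1, 0, 1], ![2, 1, 1, 0], ![2, 1, 2, 3], ![2, 1, 3, 2],
   ![2, 2, 0, 0], ![2, 2, 1, 3], ![2, 2, 2, 2], ![2, 2, 3, 1], ![2, 3, 0, 3], ![2, 3, 1, 2], ![2, 3, 2, 1], ![2, 3, 3, 0],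
   ![3, 0, 0, 1], ![3, 0, 1, 0], ![3, 0, 2, 3], ![3, 0, 3, 2], ![3, 1, 0, 0], ![3, 1, 1, 3], ![3, 1, 2, 2], ![3, 1, 3, 1],
   ![3, 2, 0, 3], ![3, 2, 1, 2], ![3, 2, 2, 1], ![3, 2, 3, 0], ![3, 3, 0, 2], ![3, 3, 1, 1], ![3, 3, 2, 0], ![3, 3, 3, 3]]

def bases1 : List K4 :=
  [![0, 0, 0, 1], ![0, 0, 1, 0], ![0, 0, 2, 3], ![0, 0, 3, 2], ![0, 1, 0, 0], ![0, 1, 1, 3], ![0, 1, 2, 2], ![0, 1, 3, 1],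
   ![0, 2, 0, 3], ![0, 2, 1, 2], ![0, 2, 2, 1], ![0, 2, 3, 0], ![0, 3, 0, 2], ![0, 3, 1, 1], ![0, 3, 2, 0], ![0, 3, 3, 3],
   ![1, 0, 0, 0], ![1, 0, 1, 3], ![1, 0, 2, 2], ![1, 0, 3, 1], ![1, 1, 0, 3], ![1, 1, 1, 2], ![1, 1, 2, 1], ![1, 1, 3, 0],
   ![1, 2, 0, 2], ![1, 2, 1, 1], ![1, 2, 2, 0], ![1, 2, 3, 3], ![1, 3, 0, 1], ![1, 3, 1, 0], ![1, 3, 2, 3], ![1, 3, 3, 2],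
   ![2, 0, 0, 3], ![2, 0, 1, 2], ![2, 0, 2, 1], ![2, 0, 3, 0], ![2, 1, 0, 2], ![2, 1, 1, 1], ![2, 1, 2, 0], ![2, 1, 3, 3],
   ![2, 2, 0, 1], ![2, 2, 1, 0], ![2, 2, 2, 3], ![2, 2, 3, 2], ![2, 3, 0, 0], ![2, 3, 1, 3], ![2, 3, 2, 2], ![2, 3, 3, 1],
   ![3, 0, 0, 2], ![3, 0, 1, 1], ![3, 0, 2, 0], ![3, 0, 3, 3], ![3, 1, 0, 1], ![3, 1, 1, 0], ![3, 1, 2, 3], ![3, 1, 3, 2],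
   ![3, 2, 0, 0], ![3, 2, 1, 3], ![3, 2, 2, 2], ![3, 2, 3, 1], ![3, 3, 0, 3], ![3, 3, 1, 2], ![3, 3, 2, 1], ![3, 3, 3, 0]]

def bases2 : List K4 :=
  [![0, 0, 0, 2], ![0, 0, 1, 1], ![0, 0, 2, 0], ![0, 0, 3, 3], ![0, 1, 0, 1], ![0, 1, 1, 0], ![0, 1, 2, 3], ![0, 1, 3, 2],
   ![0, 2, 0, 0], ![0, 2, 1, 3], ![0, 2, 2, 2], ![0, 2, 3, 1], ![0, 3, 0, 3], ![0, 3, 1, 2], ![0, 3, 2, 1], ![0, 3, 3, 0],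
   ![1, 0, 0, 1], ![1, 0, 1, 0], ![1, 0, 2, 3], ![1, 0, 3, 2], ![1, 1, 0, 0], ![1, 1, 1, 3], ![1, 1, 2, 2], ![1, 1, 3, 1],
   ![1, 2, 0, 3], ![1, 2, 1, 2], ![1, 2, 2, 1], ![1, 2, 3, 0], ![1, 3, 0, 2], ![1, 3, 1, 1], ![1, 3, 2, 0], ![1, 3, 3, 3],
   ![2, 0, 0, 0], ![2, 0, 1, 3], ![2, 0, 2, 2], ![2, 0, 3, 1], ![2, 1, 0, 3], ![2, 1, 1, 2], ![2, 1, 2, 1], ![2, 1, 3, 0],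
   ![2, 2, 0, 2], ![2, 2, 1, 1], ![2, 2, 2, 0], ![2, 2, 3, 3], ![2, 3, 0, 1], ![2, 3, 1, 0], ![2, 3, 2, 3], ![2, 3, 3, 2],
   ![3, 0, 0, 3], ![3, 0, 1, 2], ![3, 0, 2, 1], ![3, 0, 3, 0], ![3, 1, 0, 2], ![3, 1, 1, 1], ![3, 1, 2, 0], ![3, 1, 3, 3],
   ![3, 2, 0, 1], ![3, 2, 1, 0], ![3, 2, 2, 3], ![3, 2, 3, 2], ![3, 3, 0, 0], ![3, 3, 1, 3], ![3, 3, 2, 2], ![3, 3, 3, 1]]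

def bases3 : List K4 :=
  [![0, 0, 0, 3], ![0, 0, 1, 2], ![0, 0, 2, 1], ![0, 0, 3, 0], ![0, 1, 0, 2], ![0, 1, 1, 1], ![0, 1, 2, 0], ![0, 1, 3, 3],
   ![0, 2, 0, 1], ![0, 2, 1, 0], ![0, 2, 2, 3], ![0, 2, 3, 2], ![0, 3, 0, 0], ![0, 3, 1, 3], ![0, 3, 2, 2], ![0, 3, 3, 1],
   ![1, 0, 0, 2], ![1, 0, 1, 1], ![1, 0, 2, 0], ![1, 0, 3, 3], ![1, 1, 0, 1], ![1, 1, 1, 0], ![1, 1, 2, 3], ![1, 1, 3, 2],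
   ![1, 2, 0, 0], ![1, 2, 1, 3], ![1, 2, 2, 2], ![1, 2, 3, 1], ![1, 3, 0, 3], ![1, 3, 1, 2], ![1, 3, 2, 1], ![1, 3, 3, 0],
   ![2, 0, 0, 1], ![2, 0, 1, 0], ![2, 0, 2, 3], ![2, 0, 3, 2], ![2, 1, 0, 0], ![2, 1, 1, 3], ![2, 1, 2, 2], ![2, 1, 3, 1],
   ![2, 2, 0, 3], ![2, 2, 1, 2], ![2, 2, 2, 1], ![2, 2, 3, 0], ![2, 3, 0, 2], ![2, 3, 1, 1], ![2, 3, 2, 0], ![2, 3, 3, 3],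
   ![3, 0, 0, 0], ![3, 0, 1, 3], ![3, 0, 2, 2], ![3, 0, 3, 1], ![3, 1, 0, 3], ![3, 1, 1, 2], ![3, 1, 2, 1], ![3, 1, 3, 0],
   ![3, 2, 0, 2], ![3, 2, 1, 1], ![3, 2, 2, 0], ![3, 2, 3, 3], ![3, 3, 0, 1], ![3, 3, 1, 0], ![3, 3, 2, 3], ![3, 3, 3, 2]]

/-- the 64 corners `k` with `Σ k ≡ s (mod 4)` -/
def bases (s : Fin 4) : List K4 := ![bases0, bases1, bases2, bases3] s

theorem bases_length : ∀ s : Fin 4, (bases s).length = 64 := by decide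

theorem bases_class : ∀ s : Fin 4, ∀ k ∈ bases s, skL k % 4 = s.val := by decide

/-- number of listed cubes containing the position `q` -/
def coverCount (L : List K4) (q : K4) : ℕ := (L.filter fun k => inCubeB k q).length

/-- a position lies in at most 6 unit cubes of one residue class (`#{S ⊆ [4] : |S| ≡ r (4)} ≤ 6`). -/
theorem cover_le_six0 : ∀ q0 q1 q2 q3 : Fin 4, coverCount bases0 ![q0, q1, q2, q3] ≤ 6 := by decide
theorem cover_le_six1 : ∀ q0 q1 q2 q3 : Fin 4, coverCount bases1 ![q0, q1, q2, q3] ≤ 6 := by decide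
theorem cover_le_six2 : ∀ q0 q1 q2 q3 : Fin 4, coverCount bases2 ![q0, q1, q2, q3] ≤ 6 := by decide
theorem cover_le_six3 : ∀ q0 q1 q2 q3 : Fin 4, coverCount bases3 ![q0, q1, q2, q3] ≤ 6 := by decide

theorem vec_eq (q : K4) : (![q 0, q 1, q 2, q 3] : K4) = q := by
  funext f
  fin_cases f <;> rfl

theorem cover_le_six (s : Fin 4) (q : K4) : coverCount (bases s) q ≤ 6 := by
  rw [← vec_eq q]
  fin_cases s
  · exact cover_le_six0 _ _ _ _
  · exact cover_le_six1 _ _ _ _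
  · exact cover_le_six2 _ _ _ _
  · exact cover_le_six3 _ _ _ _

/-- double counting: if every listed cube carries a position of mass `≥ 7`, then `7·|L| ≤ Σ_q coverCount(q)·n_q`. -/
theorem sum_cover (D : Design) (L : List K4) (h : ∀ k ∈ L, ∃ q, inCubeB k q = true ∧ 7 ≤ nAt q D) :
    7 * (L.length : ℤ) ≤ ∑ q : K4, (coverCount L q : ℤ) * nAt q D := by
  induction L with
  | nil => simp [coverCount]
  | cons k t ih =>
    obtain ⟨q₀, hq₀, h7⟩ := h k List.mem_cons_self
    have iht := ih fun k' hk' => h k' (List.mem_cons_of_mem _ hk')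
    have hsplit : ∀ q, (coverCount (k :: t) q : ℤ) = (if inCubeB k q = true then 1 else 0) + coverCount t q := by
      intro q
      unfold coverCount
      rw [List.filter_cons]
      split <;> simp; ring
    simp only [hsplit, add_mul, Finset.sum_add_distrib, List.length_cons, Nat.cast_succ]
    have hk : (7 : ℤ) ≤ ∑ q : K4, (if inCubeB k q = true then 1 else 0 : ℤ) * nAt q D := by
      have hs := Finset.single_le_sum (f := fun q : K4 => (if inCubeB k q = true then 1 else 0 : ℤ) * nAt q D)
        (fun q _ => mul_nonneg (by split <;> norm_num) (nAt_nonneg q D)) (Finset.mem_univ q₀)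
      simp only [hq₀, if_true, one_mul] at hs
      linarith
    linarith

/-- `Σ_q n_q ≤ m_N(u⁴)`. -/
theorem sum_nAt_le_massU4 (D : Design) : ∑ q : K4, nAt q D ≤ massU4 D := by
  unfold nAt massU4
  rw [← linZ_finset_sum]
  refine linZ_mono _ _ _ fun cm _ _ => ?_
  by_cases h : ∃ q₀, cm.1 = ucell q₀
  · obtain ⟨q₀, e⟩ := h
    rw [e, sum_indC_self]
    have hu : u4B (ucell q₀) = true := by
      simp [u4B, List.all_eq_true, ucell, uL_colevel]
    simp [u4Ind, hu]
  · push Not at h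
    rw [Finset.sum_eq_zero (fun q _ => show indC (ucell q) cm.1 = 0 from if_neg (h q))]
    exact u4Ind_nonneg _

/-- `m_N(u⁴) ≤ Σ_N m`. -/
theorem massU4_le_Nmass (D : Design) : massU4 D ≤ Nmass D := by
  unfold massU4 Nmass
  rw [← linZ_one_eq]
  refine linZ_mono _ _ _ fun cm _ _ => ?_
  unfold u4Ind; split <;> norm_num

/-! ### the class of positive cubes -/

theorem zI_pow_mod4 (n : ℕ) : zI ^ n = zI ^ (n % 4) := by
  conv_lhs => rw [← Nat.div_add_mod n 4, pow_add, pow_mul, zI_pow_four, one_pow, one_mul]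

theorem re_class (μ : GaussianInt) :
    (zI ^ 0 * μ).re = μ.re ∧ (zI ^ 1 * μ).re = -μ.im ∧ (zI ^ 2 * μ).re = -μ.re ∧ (zI ^ 3 * μ).re = μ.im := by
  refine ⟨by simp, by rw [pow_one, zI_mul_re], ?_, ?_⟩
  · rw [zI_sq]; simp
  · rw [pow_succ, zI_sq]; simp [zI, Zsqrtd.re_mul]

theorem CS_of_class {D : Design} (hA : A1e D) (hE : E 14 D = 0) (k : K4) (s : Fin 4) (hs : skL k % 4 = s.val) :
    2 * CS 14 k D = -(zI ^ (s.val) * D.mu).re := by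
  have h := cube_law 14 D hA k
  rw [hE, zI_pow_mod4, sk_eq_skL, hs] at h
  linarith

/-! ### THE RING-2 DOOR IS SHUT -/

/-- **RING-2 DOOR SHUT (height 14).**  No charged ring-2 design on the height-14 alphabet, closed under RULE D with
`Disj`, (A1)-clean and with the Hall certificate `HallPlusUp 8`, satisfies the v4.2 budget `copies + rank ≤ 116`. -/
theorem ring2_door_shut14 {D : Design} (hD : D.OnAlphabet 14) (hR : Ring2 D) (hdisj : Disj D) (hrule : RuleD D)
    (h1 : D.A1) (hμ : D.mu ≠ 0) (hU8 : HallPlusUp D 8) (hdoor : (D.copies : ℤ) + D.rank ≤ 116) : False := by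
  obtain ⟨-, -, hN58, -, -, -⟩ := ring2_doorU hD hR hdisj hrule h1 hμ hU8 hdoor
  obtain ⟨-, -, h32re, h32im, hU, -, -⟩ := door_law hD hR hdisj hrule h1 hμ hU8 hdoor
  have hE : E 14 D = 0 := by
    rw [E_room hD hR hdisj hrule, hU, mPB_eq_zero hD hR hdisj hrule h1]; ring
  have hA := a1e_of_a1 D h1
  obtain ⟨e0, e1, e2, e3⟩ := re_class D.mu
  have hne : D.mu.re ≠ 0 ∨ D.mu.im ≠ 0 := by
    by_contra hc
    push Not at hc
    exact hμ (Zsqrtd.ext hc.1 hc.2)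
  -- the residue class `s` with `−Re(i^s μ) ≥ 32`
  obtain ⟨s, hs⟩ : ∃ s : Fin 4, 32 ≤ -(zI ^ (s.val) * D.mu).re := by
    rcases hne with h | h
    · rcases le_or_gt 0 D.mu.re with hp | hn
      · exact ⟨2, by rw [show (2 : Fin 4).val = 2 from rfl, e2]; omega⟩
      · exact ⟨0, by rw [show (0 : Fin 4).val = 0 from rfl, e0]; omega⟩
    · rcases le_or_gt 0 D.mu.im with hp | hn
      · exact ⟨1, by rw [show (1 : Fin 4).val = 1 from rfl, e1]; omega⟩
      · exact ⟨3, by rw [show (3 : Fin 4).val = 3 from rfl, e3]; omega⟩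
  have hcubes : ∀ k ∈ bases s, ∃ q, inCubeB k q = true ∧ 7 ≤ nAt q D := fun k hk => by
    apply heavy_point hD hR hdisj hrule h1 k
    have hc := CS_of_class hA hE k s (bases_class s k hk)
    linarith
  have h448 := sum_cover D (bases s) hcubes
  rw [bases_length] at h448
  have h6 : ∑ q : K4, (coverCount (bases s) q : ℤ) * nAt q D ≤ 6 * ∑ q : K4, nAt q D := by
    rw [Finset.mul_sum]
    exact Finset.sum_le_sum fun q _ =>
      mul_le_mul_of_nonneg_right (by exact_mod_cast cover_le_six s q) (nAt_nonneg q D)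
  have hsum := sum_nAt_le_massU4 D
  have hm := massU4_le_Nmass D
  push_cast at h448
  linarith

/-- **RING-2 DOOR SHUT (every height): `copies + rank ≥ 117`** for every charged ring-2 design closed under RULE D
(`Disj`, (A1), `HallPlusUp 8`). -/
theorem ring2_door_shut {h : ℤ} {D : Design} (hD : D.OnAlphabet h) (hR : Ring2 D) (hdisj : Disj D) (hrule : RuleD D)
    (h1 : D.A1) (hμ : D.mu ≠ 0) (hU8 : HallPlusUp D 8) : 116 < (D.copies : ℤ) + D.rank := by
  by_contra hle
  push Not at hle
  exact ring2_door_shut14 (onAlphabet14_of_shift hD hR) (ring2_shift (14 - h) hR) (disj_shift _ hdisj)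
    (ruleD_shift _ hrule) (a1_shiftD _ D h1) (by rw [mu_shiftD]; exact hμ) ((hallPlusUp_shiftD _ D 8).mpr hU8)
    (by rw [copies_shift, rank_shift]; exact hle)

/-- the same, as the N-mass floor `Σ_N m ≥ 59` -/
theorem nmass_ge_59 {h : ℤ} {D : Design} (hD : D.OnAlphabet h) (hR : Ring2 D) (hdisj : Disj D) (hrule : RuleD D)
    (h1 : D.A1) (hμ : D.mu ≠ 0) (hU8 : HallPlusUp D 8) : 59 ≤ Nmass D := by
  have := ring2_door_shut hD hR hdisj hrule h1 hμ hU8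
  rw [budget_eq_two_Nmass] at this
  omega



/-- **THE RING-2 CASE OF THE DOOR OF RECORD.**  For ANY letter functional `σ` pricing copies at `≥ 28` each (e.g. `σ = SigmaH.sigmaH`, by
`SigmaH.diag_le_sigmaH`), the v4.2 budget clause `σ(D) + 28(r − 4) + 0 ≤ 3136` is violated by every charged ring-2 design closed under RULE D with
`Disj`, (A1) and PortHall₈ — i.e. the `Ring2` case of `RuleDPlate.SPlus h σ 0` holds (door-1 row `HallUp` not even needed). -/
theorem sPlus_ring2 {h : ℤ} {D : Design} (σ : Design → ℤ) (hσ : 28 * (D.copies : ℤ) ≤ σ D) (hD : D.OnAlphabet h) (hR : Ring2 D)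
    (hdisj : Disj D) (h1 : D.A1) (hrule : RuleD D) (hU8 : HallPlusUp D 8) (hμ : D.mu ≠ 0)
    (hb : RuleDPlate.BudgetClause σ 0 D) : False := by
  have := ring2_door_shut hD hR hdisj hrule h1 hμ hU8
  unfold RuleDPlate.BudgetClause at hb
  omega


end ClassLaw

end Summit.HodgeConjecture.HodgeConjecture.Cruxes.BlochSeedDiscOne.RingTwoMassLaw
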